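import Summits.HubbardSuperconductivity.HubbardSuperconductivity.Theses.WeakCouplingBCS
import Summits.HubbardSuperconductivity.HubbardSuperconductivity.Theses.NodalWardXY
import Literature.MathematicalPhysics.QuantumLattice.DWaveOrderParameterProofs
import Literature.MathematicalPhysics.QuantumLattice.PairCorrelationsProofs
import Literature.MathematicalPhysics.QuantumLattice.ApproximateEigenvectorLemmas
import Literature.MathematicalPhysics.QuantumLattice.HubbardWave0PosSemidefProofs
import Literature.MathematicalPhysics.QuantumLattice.HubbardModelParticleHoleProofs
import Literature.MathematicalPhysics.QuantumLattice.PairChirality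
import Literature.Barriers.HubbardSuperconductivity.PureModelStripeCompetitionProofs
import Literature.MathematicalPhysics.QuantumLattice.HubbardTorusChargeFluctuations
import Literature.MathematicalPhysics.QuantumLattice.FermionOperatorsProofs
import Literature.MathematicalPhysics.QuantumLattice.HubbardRingPerronFrobeniusProofs
import Summits.HubbardSuperconductivity.HubbardSuperconductivity.Theorems.WeakCouplingBCSWcbcsSsbToTorusLROFejerClosure
import Literature.MathematicalPhysics.QuantumLattice.PairFieldMomentum

/-!
# Disproof of `WcbcsSsbToTorusLRO` (stmt-HubbardSuperconductivity-2009) — standing adversary, gen 5 (cycle 5, v1)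

Crux (route `WeakCouplingBCS`, rank 2; shared verbatim with `NodalWardXY.SsbToTorusLRO`):

  `∃ U₀ > 0, ∀ U ∈ Ioo 0 U₀, ∀ δ ∈ Ioo 0 (1/2), ∀ μ, DensityMatched U δ μ → HasDWaveOrder U μ →
     HasDWavePairFieldLROAt U δ`

with `DensityMatched U δ μ :=` the grand-canonical TRACIAL ground-state density of
`hubbardTorusWith 2 (L+1) 1 U μ` tends to `1 - δ` along ALL sides `L+1`, `HasDWaveOrder U μ := 0 < m(U,μ)`,
`m = liminf_{h→0⁺} liminf_L Re ω_{L+1,h}(Δ_d)/(L+1)²` (Koma–Tasaki order parameter, source `-h(Δ_d+Δ_d†)`),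
and the conclusion = the summit matrix at `(U, δ)` (every even-side `(N_L, S^z=0)`-sector ground-state
sequence of the source-free canonical model has `d_{x²-y²}` pair-field LRO).

## Findings (index; every claim below is a checked theorem unless marked DOC)

§1 NORMAL FORMS — `crux_iff`, `crux_iff_eventually` (the window is `∀ᶠ U in 𝓝[>] 0`), `not_crux_iff`.
§2 WHY IT RESISTS — `not_crux_imp_order_io`: every disproof exhibits `HasDWaveOrder U μ` at arbitrarily
   small `U > 0`, i.e. proves d-wave symmetry breaking in the weakly repulsive Hubbard model (the qualitative
   content of crux 4, an open construction); `not_crux_imp_noLRO_io`: … and an absence-of-LRO theorem;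
   `crux_of_noOrder`: the route's kill criterion (ii) ("m = 0 at weak coupling") PROVES this crux (vacuously);
   `crux_of_lro`: so does the thesis itself. Neither side is reachable without many-body control of
   `hubbardTorusWith 2 L 1 U μ` at `U > 0`: NO `_false_without_` theorem is available for ANY hypothesis,
   because every mutilated variant still quantifies only over the interacting model (§3 records the
   lattice of variants and their relative strength instead).
§3 LOAD-BEARING LATTICE — `cruxWithoutDensity_iff` (drop density matching: "order at ONE filling ⇒ LRO at
   EVERY doping δ < 1/2", absurd but not Lean-refutable), `cruxWithoutOrder_iff_nonnegOrder` (drop `0 < m`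
   = weaken it to the theorem `0 ≤ m`: strict positivity is the whole content), `crux_of_withoutWindow`,
   `crux_of_withoutDopingCap` (the window `U < U₀` and the cap `δ < 1/2` only remove cases; they are
   technique, not truth, hypotheses).
§4 NEW (gen 2) FREE WEAKENINGS THE ROUTE CAN TAKE — the deciding theorem `closes` obtains `δ` (and `C`) from
   crux 4 BEFORE it uses this crux, so the quantifier order `∃ U₀ ∀ δ` is NOT needed: `CruxSwapped`
   (`∀ δ, ∃ U₀(δ), ∀ U < U₀, ∀ μ, …`) and even `CruxAtScale` (additionally given crux 4's floor
   `exp(-C/U²) ≤ m(U,μ)`, `U₀` depending on `δ` and `C`) still close the route with crux 4 UNCHANGED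
   (`closes_swapped`, `closes_atScale`, both eight lines). `crux_imp_cruxSwapped`, `cruxSwapped_imp_cruxAtScale`.
   WHY IT MATTERS (DOC, §4 docstrings): the uniform form is hostage, for EVERY `U₀`, to finite-size phase
   selection at a first-order ENDPOINT `μ_c(U)` between the `d_{x²-y²}` phase and a B1g-poor phase that exists
   at arbitrarily small `U` (candidate: the SDW/d-SC boundary at doping `δ_AF(U) → 0⁺`); the swapped form is
   hostage only to a first-order line that does not move as `U → 0⁺` (non-generic), because every moving
   boundary `δ*(U)` is eventually avoided at fixed `δ`.
§5 THE ENDPOINT OBSTRUCTION AND THE ROBUST REPAIR (re-established from gen 1) — `OrderNearby`, `CruxRobust`,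
   `crux_imp_cruxRobust`, `closes_robust` (needs crux 4 strengthened to order on a `μ`-neighbourhood:
   `BcsConstructionRobust`); comparison with §4 (DOC): §4 costs the route nothing, §5 costs a stronger crux 4.
§6 ORDER-PARAMETER SIDE (tree facts, cited by name): `0 ≤ m ≤ 4√2` (`dWaveOrderParameter_nonneg/le_const`),
   the `h`-liminf is an infimum, energy form; hence `hasDWaveOrder_iff_ne_zero`.
§7 SMALL MODELS / COMPUTATIONS / PHASE-DIAGRAM HAZARDS (DOC): see the section docblock.
§9 ODD TORI IN THE HYPOTHESES ARE INESSENTIAL (re-established): `dWaveOrderParameter_le_even`,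
   `crux_of_cruxEvenHyp` — restricting density matching and order to even sides gives a stronger statement
   implying the crux; provers may stay on bipartite tori, refuters gain nothing from odd sides.
§K FINITE-VOLUME KERNEL (re-established): `norm_sq_pairAmplitude_le`, `evenLRO_of_eventually_le`,
   `evenLRO_of_pairAmplitude`, `OffDiagonalPairOrder → HasDWavePairFieldLROAt`, `crux_of_sharpConverse`.
§8 ROUND-1 CRUX IDEAS — their finite-`L` levers are THEOREMS (proved here verbatim): `griffithsSandwich`
   (tangent-face card), `tracialCuspBound` (+ `tracialCuspBound'`: side conditions are decoration),
   `squareCompletionBound`, `quenchedGSOrderFromGain`, and the quenched-corner card's END-TO-END first checkable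
   statement `quenchedCornerOrder` (`HasDWaveOrder U μ ⇒` every normalised ground vector of the number-conserving
   `K_μ - (t/L²)P†P` has `lro ≥ m² - ε` for every `t ∈ (0,1)`, `L ≥ L₀(t)`): the U(1)-breaking hypothesis
   converts losslessly into an every-GS statement for a charge-conserving Hamiltonian. §8b: the card's GLUE
   is proved too — `hasDWavePairFieldLROAt_of_corner : HasDWaveOrder U μ → SeededRecentring U δ μ →
   HolderCorner U δ → HasDWavePairFieldLROAt U δ` (side obligation `quenchedSectorGSExists` discharged),
   `crux_of_transfer`, `cruxSwapped_of_transfer`; so the crux's ENTIRE difficulty is the one-sector transfer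
   `t → 0⁺` uniformly in `L` (`HolderCorner`/`SeededRecentring`), and `transfer_stub_false_at_counterexample`
   says the §4/§5 endpoint hazard is now carried by exactly those two stubs.
§10 (gen 3) SUPERGRADIENT MONOTONICITY (finite `L`, proved): `lro_mono` — for seeds `t₁ < t₂` every sector ground
   state of `Q_{t₂} = H - (t₂/L²)P†P` dominates every sector ground state of `Q_{t₁}` in pair order (two
   variational inequalities); `lro_groundState_le_quenched` (`t₁ = 0`); `lro_le_lroBound`; `quenchedCan_zero`;
   `quenched_sector_variational`.
§11 (gen 3) `HolderCorner` DISSECTED (proved): the Hölder RATE is decoration — `CornerModulus` (right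
   upper-semicontinuity at `t = 0⁺`, uniform in even `L`) follows from `HolderCorner` and still closes the crux
   (`hasDWavePairFieldLROAt_of_modulus`, `crux_of_transferModulus`, `cruxSwapped_of_transferModulus`); and the
   corner FORCES `PairOrderRigidity` (`pairOrderRigidity_of_cornerModulus`): along even `L` all source-free
   `(N_L,S^z=0)` ground states of `hubbardTorus 2 L 1 U` have asymptotically the SAME pair-order density — the
   summit's every-GS content, isolated as a necessary sub-stub; `modulus_stub_false_at_counterexample`.
§12 (gen 3) `SeededRecentring` DISSECTED (proved): `canonicalGCEquivalence_of_seededRecentring` — the stub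
   contains `o(L²)` canonical/grand-canonical equivalence at `(δ, μ)` for the SOURCE-FREE model
   (`canonical_gc_gap_step`); hence FALSE as a bare `Prop` at every `μ` off the thermodynamic chemical potential
   of `1 - δ` (must be filed under `DensityMatched`), and at a first-order endpoint it holds for the finite-size
   winner only; `transferModulus_imp_equivalence`.
§12b (gen 3) `_false_without_` THEOREM (proved): `seededRecentring_false_without_densityMatching` — for every
   `μ ≤ -70`, `|U| ≤ 1`, `δ ∈ (0,1/2)`: `¬ SeededRecentring U δ μ` (via `not_canonicalGCEquivalence_of_mu_le`:
   vacuum trial state `E₀(K_μ) ≤ 0`, `-‖H‖ ≤ E^{sec}`, `‖H‖ ≤ 5L²(2+|U|)`, `N_L > (1-δ)L² - 2`); so the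
   recentring stub is false as a bare `Prop` in `μ` and a skeleton must file it UNDER `DensityMatched`
   (`transfer_guard_needed`).
§13 (gen 3) NON-VACUITY OF THE SUMMIT MATRIX (proved): `admissible_sequence_exists` (every `U`, `δ ≥ 0`, incl. the
   degenerate sides `L = 0, 2`), `hasDWavePairFieldLROAt_nonvacuous`, `not_hasDWavePairFieldLROAt_iff` — the
   conclusion never holds for lack of instances; a disproof of the crux is exactly an order-poor admissible
   sequence at a density-matched, ordered parameter.
§14 (gen 4) UNIFORM-FLOOR NORMAL FORM of the summit matrix (proved): `hasDWavePairFieldLROAt_iff_uniformPairFloor`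
   (`δ ≥ 0`) — `HasDWavePairFieldLROAt U δ ↔ ∃ a > 0, ∀ᶠ k, ∀ admissible ψ at side 2k+2, a ≤ lro ψ`; direction `⇒` by
   a near-minimising admissible sequence chosen through `sInf` (`exists_nearMin_admissible`), no compactness.
§15 (gen 4) TARGETS — the lead's promoted stub `stub_facePurityChord` DISSECTED (proved): `stubFacePurityChord_iff`
   (stub = crux hyps → `ChordFacePurity U δ`); (1) `derivFacePurity_of_chordFacePurity` (Danskin, via the vendored
   chord inequality `chord_div_le_of_eigen`); (2) `sq_mul_lro_le_blockRepulsion` (`L²·lro ≤ Re⟨W_R⟩`, from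
   `sum_blockPair : Σ_a B_a = R²P` + Cauchy–Schwarz; TIGHT at `R = L`: `blockRepulsion_self`,
   `re_expect_blockRepulsion_self`) ⇒ `derivFacePurity_of_hasDWavePairFieldLROAt`: the every-GS block-coherence
   floor at all scales is NECESSARY for the crux's conclusion; (3) `uniformPairFloor_of_derivFacePurity_of_infraredLeak`
   (landed Fejér closure p72085) ⇒ `derivFacePurity_iff_matrix_of_infraredLeak`: MODULO item 1089, derivative face
   purity IS the summit matrix — the line's reduction is the identity at the derivative level; (4)
   `extensiveGap_of_chordFacePurity`: the chord's entire excess = order-poor sector states are EXTENSIVELY excited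
   (`⟨H⟩ ≥ E_sec + (κa/2)L²` whenever `⟨W_R⟩ ≤ (a/2)L²`, `κ = κ(R)` side-independent) = no order-poor state is
   degenerate in energy DENSITY with the ground state (face purity proper), read off two sector ENERGIES; the order
   itself need not survive the repulsion (`κ(R)` may sit below the condensation-energy scale, §15e).
§15d/§15e (gen 4, proved): `repelled_fullScale_eq_quenchedCan` — at `R = L` the block-repelled torus IS the quenched
   canonical family at NEGATIVE seed (`H + κW_L = Q_{-κ}`): the two surviving lines are the `t < 0` (chord) and `t > 0`
   (corner) sides of the same concave `t ↦ E_sec(H - (t/L²)P†P)`; `chord_ge_repelled`, `repelledCoherence_mono`,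
   `chordFacePurity_of_repelledCoherence` — the chord is sandwiched `κ re⟨ψ_κ,Wψ_κ⟩ ≤ chord ≤ κ re⟨ψ₀,Wψ₀⟩` and the
   repelled coherence is non-increasing in `κ`, so `RepelledCoherence ⇒ ChordFacePurity ⇒ DerivFacePurity` (the PROMOTE
   dossier's "FPC ⇐ RepelledCoherence", checked).
§15c (gen 4) TOY (proved): `toy_everyGS_coherence` / `toy_chord_le_one` / `toy_chord_fails` — on `ℂ²`, `H = diag(0,1)`,
   `W = diag(c,0)`: every GS has `⟨W⟩ = c` yet `E(H+κW) - E(H) ≤ 1`, so the chord form is STRICTLY stronger than the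
   derivative form (it needs order-poor states to be extensively excited, cf. `extensiveGap_of_chordFacePurity`).
§16 (gen 4) TARGETS — the imported item 1089 `WindowInfraredBound` (vendored verbatim as `WindowInfraredBound1089`,
   `Iff.rfl` with the Theses decl; proved): `infraredLeak_of_windowInfraredBound` (only the pointwise `InfraredLeak U δ`
   at `U < U₀` is consumed; `crux_of_derivFacePurity_of_infraredLeak`, `crux_of_stub_of_windowInfraredBound`);
   `windowInfraredBound_smallest_momentum`: 1089 forces, at EVERY `U > 0`, `pairStructureFactor d L ψ (1,0) ≤ 2πC·L`
   for every sector GS — no system-scale `d`-wave pair modulation, i.e. no canonical phase separation with a paired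
   component at ANY coupling (its own why-might-fail regime, mVMC `U/t = 10`); the line inherits this ∀U exposure
   gratuitously — take the weak-coupling restriction instead.
§17 (gen 5; CHECKED THEOREMS LIVE IN THE COMPANION MODULE `Cruxes/WcbcsSsbToTorusLRO/DisproofRound2.lean` —
   `import Summits.HubbardSuperconductivity.HubbardSuperconductivity.Cruxes.WcbcsSsbToTorusLRO.DisproofRound2`, same namespace;
   this file stays the index + gens 1–4, kept under the 200 kB workfile cap) NEITHER KT DIRECTION IS ABSTRACT (`ℂ³`/`ℂ²` toys): `not_abstractConverse` — a finite-dimensional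
   U(1) system (Hermitian `H` commuting with `N`, pair operator `P` lowering `N` by 2, `P†P ≤ V²`) with sourced chord
   `≥ (24/25)hmV - 1` (order density `≥ 12m/25` at every fixed `h > 0`, `ac_chord_ge`) whose source-free ground state is
   UNIQUE and PAIR-INERT (`⟨Y, P†P Y⟩ = 0`): the order-free competitor `Y`, degenerate with the ordered ladder in energy
   DENSITY, is invisible to energy densities; `ac_sourced_blind` — below the mesoscopic field `h ≤ 1/(2mV)` the sourced
   problem gains nothing, so the finite-volume data deciding the converse sit at `hL² = O(1)` (tower regime), which the
   double limit of `dWaveOrderParameter` discards; `not_abstractForward` — conversely, full ground-state pair order with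
   sourced chord `≤ 1` uniformly in `V`: KT's `m ≥ √2 o μ₂` needs the double-commutator (locality) budget of Thm 2.2
   (`KomaTasaki.horschVonDerLinden_holds`, item 1211), violated by the toy. LITERATURE ANCHOR: KT1994 §0.7 (arXiv p. 11)
   splits the converse into Conjecture 10 (decomposition into ordered ergodic states = face purity, §15) AND `μ₁ = μ₂`
   (infinite-volume vs finite-volume-GS LRO; only `μ₁ ≥ μ₂` is proved) = the infrared-leak step §15 (3)/item 1089 — the
   gen-4 dissection `DerivFacePurity ∧ InfraredLeak ↔ matrix` is exactly KT's own two-step split. Round-2 lines must bring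
   an input FALSE for `H_Hubbard ⊕ Y`-type competitors (energy scale `O(1)`, or locality of `P` beyond `P†P ≤ V²`).
§18 (gen 5, companion module; proved on the literal objects) EVERY-GS vs SOME-GS bookkeeping: `pairOrderRigidity_of_simple`
   (eventual simplicity of the sector GS ⇒ rigidity), `uniformPairFloor_of_rigidity_of_someGSFloor` (rigidity + a floor for
   SOME admissible state eventually ⇒ the every-GS floor = matrix, §14), `hasDWavePairFieldLROAt_of_simple_of_someGSFloor`,
   `someGSFloor_of_hasDWavePairFieldLROAt` (matrix ⇒ some-GS floor, NOT ⇒ rigidity). Notes: rigidity is not necessary for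
   the crux (only the floor is); simplicity is far more than needed (Schur: multiplicity-free ground eigenspace for the
   symmetries suffices; symmetry-forced degeneracy is harmless) and bare simplicity can fail along infinitely many even `L`
   by symmetry (open shells) — file multiplicity-freeness; no supplier at weak coupling except a crux-4 by-product, which
   must control all states within `O(1)` of the sector ground energy (§17's scale).
§7 (gen 5 update, DOC): Šimkovic–Liu–Deng–Kozik 2016 (PRB 94, 085106; arXiv:1512.04271 §3.1) — exact `U → 0` phase
   diagram at `t' = 0`: `d_{x²-y²}^{(4)}` "in a wide region around half filling", a TRIPLET `p^{(6)}` phase "at `t' = 0`,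
   `n ∼ 0.6`" (i.e. `δ ≈ 0.4 ∈ (0, 1/2)`) which "vanishes already at `U = 0.08`" [Deng et al. 2015], and `d_{xy}^{(4)}` for
   `n < 0.55`: inside the crux's doping interval the `U → 0` B1g window is roughly `δ ≲ 0.35–0.4`; beyond it `m = 0`
   (body vacuous); the B1g/E boundary moves with `U` (avoided at fixed `δ` — §4 swap) and is a mixed-parity sliver with
   continuous edges at BCS level (§7 gen-3 (b)); no first-order endpoint with a B1g-poor compressible partner is reported.
§7 (gen 5, LITERATURE — a PRINTED instance of "sourced order ∧ density matching ∧ NO finite-volume LRO"): Wreszinski–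
   Zagrebnov 2016 (arXiv:1607.03024 §4, p. 13): for the PERFECT Bose gas at `ρ > ρ_c(β)` in van den Berg–Lewis–Pulé boxes
   (anisotropy exponent `α₁ > 1/2`) the Bogoliubov quasi-average order is `(SSB)_qa = (BEC)_qa = ρ - ρ_c(β) > 0` (source
   `√V(η̄ b₀ + η b₀*)`, `V → ∞` at matched density `μ_Λ(β,ρ,η)`, then `η → 0` — the Koma–Tasaki order of limits), "whereas
   for the conventional BEC one gets `lim_Λ ω⁰(b_q* b_q / V) = 0` for any `ρ` and `q ∈ Λ*` as soon as `α₁ > 1/2`": every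
   source-free, density-matched finite-volume equilibrium state has ZERO condensate/ODLRO density in every mode (type-III
   generalised condensation smeared over the infrared quasi-continuum of the long direction), while the infinite-volume
   two-point function still clusters to `ρ₀ > 0` — i.e. KT's `μ₁ > μ₂ = 0`: the equality `μ₁ = μ₂` (§17 anchor) FAILS in a
   physical (free, `T > 0`, anisotropic) model. For the crux (square tori, `T = 0`, interacting fermions) this is not an
   instance — a pair condensate boosted to the smallest pair momentum `2π/L` costs the `O(1)` phase-twist energy `2π²ρ_s`
   and lives in another total-momentum sector — but it is the printed proof that the `μ₁ = μ₂` / infrared-leak step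
   (§15 (3), item 1089) is GEOMETRY-dependent and not a consequence of SSB: a proof must use the isotropy of `Λ_L`.
LANDED (gen 4, negative-side support, commit c77568f10b61, namespace `Summit.HubbardSuperconductivity.WcbcsSsbToTorusLRO.Negative`,
   definition-free on the literal route terms): `Theorems/WcbcsSsbToTorusLRO/Negative/SummitMatrixUniformFloor.lean`
   (p75160; §14: `hasDWavePairFieldLROAt_iff_floor`), `…/Negative/BlockRepulsionDominatesPairOrder.lean` (p75148; §15 (2):
   `sum_blockPair`, `re_expect_pairIntensity_le_sq_mul_blockRepulsion`, `blockRepulsion_self`), `…/Negative/WindowInfraredBound1089.lean`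
   (p75180; §16: `leak_of_windowInfraredBound`, `windowInfraredBound_smallest_momentum`); `…/Negative/FacePurityDissection.lean`
   (§15 (1),(3),(4): `deriv_of_chord`, `deriv_of_hasDWavePairFieldLROAt`, `floor_of_deriv_of_leak`,
   `deriv_iff_hasDWavePairFieldLROAt_of_leak`, `extensiveGap_of_chord`, `stub_gives_deriv`) submitted as p75805
   (dry-run ACCEPT). Lead/planner: IMPORT these four modules rather than re-deriving; the prose table with import lines
   is `Cruxes/WcbcsSsbToTorusLRO/Disprove-stub_facePurityChord.md`.
§7 (gen 3 update, DOC) HAZARD AUDIT: no INSTANCE of the uniform form's endpoint hazard is identified for the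
   `t' = 0` weak-coupling phase diagram inside `δ ∈ (0,1/2)` — the AF/phase-separation endpoint has `n_Y = 1`
   (`δ = 0`, excluded), pairing-channel switches (`B1g→B2g`, `B1g→E`) pass through mixed phases continuously at
   GL level (convexity / Cauchy–Schwarz), and pure non-`B1g` phases have `m = 0` (vacuous); the crux resists
   better than gen 2 suggested, the quantifier swap of §4 remains free insurance.

Gen-1 record (cycle 1, refuter-cdisprove-…-2009-0, evidence `run/gate/evidence/stmt-…-2009/2026-08-15T225353Z-
Disproof.lean`, 48 theorems, rc0 sorry-free; NOT mounted in later seats' jails and never published to the tree —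
this gen-2 file re-establishes what it uses and supersedes it as the published copy): normal forms; why-it-resists
(`not_crux_imp_order_io`, `crux_of_noOrder`); load-bearing lattice; F1-endpoint gap + `CruxRobust`/`closes_robust`;
proof shape `crux_of_sharpConverse` (KT `μ₁ = μ₂` direction) and the finite-volume kernel
(`norm_sq_pairAmplitude_le`, `evenLRO_of_pairAmplitude`, `OffDiagonalPairOrder → HasDWavePairFieldLROAt`);
symmetry-degeneracy lemmas (`cross_term_eq_zero_of_eigen`, `re_quadraticForm_ge_on_span`); `crux_of_cruxEvenHyp`
(odd sides in the hypotheses are inessential); `griffithsSandwich`; 4×4 ED jobs j004880/j004882 (still queued at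
gen-2 start, hub queue ≈ 3000).
-/

noncomputable section

set_option linter.dupNamespace false

namespace Summit.HubbardSuperconductivity.HubbardSuperconductivity.Cruxes.WcbcsSsbToTorusLRO.Disproof

open Literature.MathematicalPhysics.QuantumLattice Literature.Barriers.HubbardSuperconductivity
open Filter Set
open scoped Matrix ComplexOrder
open _root_.Topology
open Summit.HubbardSuperconductivity.HubbardSuperconductivity.Theses.WeakCouplingBCS
  (WcbcsSsbToTorusLRO WcbcsBcsConstruction WcbcsThesis)

/-! ## §1 Normal forms -/

/-- The grand-canonical tracial ground-state density of `hubbardTorusWith 2 (L+1) 1 U μ`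
(`Re ω₀(N̂)/(L+1)²`), the sequence whose limit the crux's first hypothesis prescribes. -/
def gcDensity (U μ : ℝ) (L : ℕ) : ℝ :=
  ((hubbardTorusWith 2 (L + 1) 1 U μ).groundStateFunctional totalNumber).re / ((L + 1 : ℕ) : ℝ) ^ 2

/-- Density matching: the GC tracial density tends to `1 - δ` along ALL sides. -/
def DensityMatched (U δ μ : ℝ) : Prop :=
  Tendsto (gcDensity U μ) atTop (𝓝 (1 - δ))

/-- The body of the crux at one parameter triple. -/
def Body (U δ μ : ℝ) : Prop :=
  DensityMatched U δ μ → HasDWaveOrder U μ → HasDWavePairFieldLROAt U δ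

/-- The SHARED copy in route `NodalWardXY` (rank 4 there) is the same proposition, so everything below applies
to `NodalWardXY.SsbToTorusLRO` verbatim. -/
theorem nodalWardXY_ssbToTorusLRO_iff :
    Summit.HubbardSuperconductivity.HubbardSuperconductivity.Theses.NodalWardXY.SsbToTorusLRO ↔
      WcbcsSsbToTorusLRO :=
  Iff.rfl

/-- The crux, by name, unfolded (definitional). -/
theorem crux_iff :
    WcbcsSsbToTorusLRO ↔
      ∃ U₀ : ℝ, 0 < U₀ ∧ ∀ U ∈ Ioo (0:ℝ) U₀, ∀ δ ∈ Ioo (0:ℝ) (1 / 2), ∀ μ : ℝ, Body U δ μ :=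
  Iff.rfl

/-- The weak-coupling window is the right-neighbourhood filter of `0`: the crux says its body holds
for all `U` EVENTUALLY as `U → 0⁺`. -/
theorem crux_iff_eventually :
    WcbcsSsbToTorusLRO ↔ ∀ᶠ U in 𝓝[>] (0:ℝ), ∀ δ ∈ Ioo (0:ℝ) (1 / 2), ∀ μ : ℝ, Body U δ μ := by
  rw [crux_iff, (nhdsGT_basis (0:ℝ)).eventually_iff]

/-- Negation normal form: a disproof must produce, below EVERY `U₀ > 0`, a triple `(U, δ, μ)` with
density matching, d-wave order, and failure of canonical even-torus LRO. -/
theorem not_crux_iff :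
    ¬ WcbcsSsbToTorusLRO ↔
      ∀ U₀ : ℝ, 0 < U₀ → ∃ U ∈ Ioo (0:ℝ) U₀, ∃ δ ∈ Ioo (0:ℝ) (1 / 2), ∃ μ : ℝ,
        DensityMatched U δ μ ∧ HasDWaveOrder U μ ∧ ¬ HasDWavePairFieldLROAt U δ := by
  rw [crux_iff]
  simp only [Body, not_exists, not_and, not_forall, exists_prop]

/-- Frequently-form of the negation. -/
theorem not_crux_iff_frequently :
    ¬ WcbcsSsbToTorusLRO ↔ ∃ᶠ U in 𝓝[>] (0:ℝ), ∃ δ ∈ Ioo (0:ℝ) (1 / 2), ∃ μ : ℝ, ¬ Body U δ μ := by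
  rw [crux_iff_eventually]
  simp only [Filter.not_eventually, not_forall, exists_prop]

/-! ## §2 Why it resists (as theorems) -/

/-- Every disproof proves d-wave symmetry breaking at arbitrarily small repulsion: `¬ crux` yields, below
every `U₀`, some `U ∈ (0, U₀)` and `μ` with `HasDWaveOrder U μ` — the qualitative content of crux 4
(`WcbcsBcsConstruction`), for which no construction exists (BGM2006 Thm 1.1 stops at `T ≥ e^{-a/U}`). -/
theorem not_crux_imp_order_io (h : ¬ WcbcsSsbToTorusLRO) :
    ∀ U₀ : ℝ, 0 < U₀ → ∃ U ∈ Ioo (0:ℝ) U₀, ∃ μ : ℝ, HasDWaveOrder U μ := by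
  intro U₀ hU₀
  obtain ⟨U, hU, δ, -, μ, -, hord, -⟩ := not_crux_iff.1 h U₀ hU₀
  exact ⟨U, hU, μ, hord⟩

/-- … together with a density-matched chemical potential … -/
theorem not_crux_imp_densityMatched_io (h : ¬ WcbcsSsbToTorusLRO) :
    ∀ U₀ : ℝ, 0 < U₀ → ∃ U ∈ Ioo (0:ℝ) U₀, ∃ δ ∈ Ioo (0:ℝ) (1 / 2), ∃ μ : ℝ,
      DensityMatched U δ μ ∧ HasDWaveOrder U μ := by
  intro U₀ hU₀
  obtain ⟨U, hU, δ, hδ, μ, hdm, hord, -⟩ := not_crux_iff.1 h U₀ hU₀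
  exact ⟨U, hU, δ, hδ, μ, hdm, hord⟩

/-- … and an ABSENCE-of-LRO theorem for the canonical model at arbitrarily small `U`. -/
theorem not_crux_imp_noLRO_io (h : ¬ WcbcsSsbToTorusLRO) :
    ∀ U₀ : ℝ, 0 < U₀ → ∃ U ∈ Ioo (0:ℝ) U₀, ∃ δ ∈ Ioo (0:ℝ) (1 / 2), ¬ HasDWavePairFieldLROAt U δ := by
  intro U₀ hU₀
  obtain ⟨U, hU, δ, hδ, μ, -, -, hno⟩ := not_crux_iff.1 h U₀ hU₀
  exact ⟨U, hU, δ, hδ, hno⟩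

/-- Kill criterion (ii) of the route ("`m(U,μ) = 0` for all small `U` and all `μ`") does not kill THIS
item — it PROVES it, vacuously. -/
theorem crux_of_noOrder (h : ∃ U₀ : ℝ, 0 < U₀ ∧ ∀ U ∈ Ioo (0:ℝ) U₀, ∀ μ : ℝ, ¬ HasDWaveOrder U μ) :
    WcbcsSsbToTorusLRO := by
  obtain ⟨U₀, hU₀, hno⟩ := h
  exact ⟨U₀, hU₀, fun U hU δ _ μ _ hord => absurd hord (hno U hU μ)⟩

/-- So does absence of density matching everywhere (e.g. if GC tracial densities never converged). -/
theorem crux_of_noDensityMatch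
    (h : ∃ U₀ : ℝ, 0 < U₀ ∧ ∀ U ∈ Ioo (0:ℝ) U₀, ∀ δ ∈ Ioo (0:ℝ) (1 / 2), ∀ μ : ℝ,
      HasDWaveOrder U μ → ¬ DensityMatched U δ μ) :
    WcbcsSsbToTorusLRO := by
  obtain ⟨U₀, hU₀, hno⟩ := h
  exact ⟨U₀, hU₀, fun U hU δ hδ μ hdm hord => absurd hdm (hno U hU δ hδ μ hord)⟩

/-- And so does the conclusion alone (LRO at every doping in a weak-coupling window — the thesis `X` made
uniform in `δ`): the crux is weaker than what the route ultimately wants at one `δ`, but across all `δ`. -/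
theorem crux_of_lro (h : ∃ U₀ : ℝ, 0 < U₀ ∧ ∀ U ∈ Ioo (0:ℝ) U₀, ∀ δ ∈ Ioo (0:ℝ) (1 / 2),
      HasDWavePairFieldLROAt U δ) :
    WcbcsSsbToTorusLRO := by
  obtain ⟨U₀, hU₀, hl⟩ := h
  exact ⟨U₀, hU₀, fun U hU δ hδ _ _ _ => hl U hU δ hδ⟩

/-- The window may always be shrunk. -/
theorem crux_window_mono {U₀ U₁ : ℝ} (hU₁ : 0 < U₁) (hle : U₁ ≤ U₀)
    (h : ∀ U ∈ Ioo (0:ℝ) U₀, ∀ δ ∈ Ioo (0:ℝ) (1 / 2), ∀ μ : ℝ, Body U δ μ) :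
    WcbcsSsbToTorusLRO :=
  ⟨U₁, hU₁, fun U hU => h U ⟨hU.1, lt_of_lt_of_le hU.2 hle⟩⟩

/-! ## §3 Load-bearing lattice

No hypothesis can be shown load-bearing by a `_false_without_` THEOREM: every variant below still speaks
only about ground states of `hubbardTorusWith 2 L 1 U μ` / `hubbardTorus 2 L 1 U` at `U > 0`, where no
expectation value is computable today. What CAN be proved is the relative strength of the variants. -/

/-- Drop density matching. -/
def CruxWithoutDensity : Prop :=
  ∃ U₀ : ℝ, 0 < U₀ ∧ ∀ U ∈ Ioo (0:ℝ) U₀, ∀ δ ∈ Ioo (0:ℝ) (1 / 2), ∀ μ : ℝ,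
    HasDWaveOrder U μ → HasDWavePairFieldLROAt U δ

/-- Without density matching the statement says: d-wave order at ONE chemical potential forces canonical
d-wave LRO at EVERY doping `δ ∈ (0, 1/2)` — including dopings where the weak-coupling ground state is
believed to be `d_xy` (RKS2010 Fig. 2: `δ ≳ 0.4`). Physically absurd, formally unrefuted (it still needs
`HasDWaveOrder` somewhere). Density matching is what ties `μ` to `δ`. -/
theorem cruxWithoutDensity_iff :
    CruxWithoutDensity ↔
      ∃ U₀ : ℝ, 0 < U₀ ∧ ∀ U ∈ Ioo (0:ℝ) U₀, (∃ μ : ℝ, HasDWaveOrder U μ) →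
        ∀ δ ∈ Ioo (0:ℝ) (1 / 2), HasDWavePairFieldLROAt U δ := by
  unfold CruxWithoutDensity
  constructor
  · rintro ⟨U₀, hU₀, h⟩
    exact ⟨U₀, hU₀, fun U hU ⟨μ, hμ⟩ δ hδ => h U hU δ hδ μ hμ⟩
  · rintro ⟨U₀, hU₀, h⟩
    exact ⟨U₀, hU₀, fun U hU δ hδ μ hμ => h U hU ⟨μ, hμ⟩ δ hδ⟩

theorem crux_of_withoutDensity (h : CruxWithoutDensity) : WcbcsSsbToTorusLRO := by
  obtain ⟨U₀, hU₀, h⟩ := h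
  exact ⟨U₀, hU₀, fun U hU δ hδ μ _ hord => h U hU δ hδ μ hord⟩

/-- Drop the order hypothesis. -/
def CruxWithoutOrder : Prop :=
  ∃ U₀ : ℝ, 0 < U₀ ∧ ∀ U ∈ Ioo (0:ℝ) U₀, ∀ δ ∈ Ioo (0:ℝ) (1 / 2), ∀ μ : ℝ,
    DensityMatched U δ μ → HasDWavePairFieldLROAt U δ

/-- The crux with `0 < m` weakened to `0 ≤ m`. -/
def CruxWithNonnegOrder : Prop :=
  ∃ U₀ : ℝ, 0 < U₀ ∧ ∀ U ∈ Ioo (0:ℝ) U₀, ∀ δ ∈ Ioo (0:ℝ) (1 / 2), ∀ μ : ℝ,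
    DensityMatched U δ μ → 0 ≤ dWaveOrderParameter U μ → HasDWavePairFieldLROAt U δ

/-- Since `0 ≤ m(U,μ)` is a THEOREM for all `(U, μ)` (tree: `dWaveOrderParameter_nonneg`, variational
principle + the `U(1)` quarter rotation), weakening strict to weak positivity is the same as dropping the
order hypothesis altogether: the strict inequality is the entire load. -/
theorem cruxWithNonnegOrder_iff_withoutOrder : CruxWithNonnegOrder ↔ CruxWithoutOrder := by
  unfold CruxWithNonnegOrder CruxWithoutOrder
  constructor
  · rintro ⟨U₀, hU₀, h⟩
    exact ⟨U₀, hU₀, fun U hU δ hδ μ hdm => h U hU δ hδ μ hdm (dWaveOrderParameter_nonneg U μ)⟩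
  · rintro ⟨U₀, hU₀, h⟩
    exact ⟨U₀, hU₀, fun U hU δ hδ μ hdm _ => h U hU δ hδ μ hdm⟩

theorem crux_of_withoutOrder (h : CruxWithoutOrder) : WcbcsSsbToTorusLRO := by
  obtain ⟨U₀, hU₀, h⟩ := h
  exact ⟨U₀, hU₀, fun U hU δ hδ μ hdm _ => h U hU δ hδ μ hdm⟩

/-- `HasDWaveOrder` fails only by `m = 0`, never by sign. -/
theorem hasDWaveOrder_iff_ne_zero (U μ : ℝ) : HasDWaveOrder U μ ↔ dWaveOrderParameter U μ ≠ 0 := by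
  rw [hasDWaveOrder_iff]
  exact ⟨ne_of_gt, fun h => lt_of_le_of_ne (dWaveOrderParameter_nonneg U μ) (Ne.symm h)⟩

/-- Drop the weak-coupling window (all `U > 0`). Stronger; implies the crux with any window. -/
def CruxWithoutWindow : Prop :=
  ∀ U : ℝ, 0 < U → ∀ δ ∈ Ioo (0:ℝ) (1 / 2), ∀ μ : ℝ, Body U δ μ

theorem crux_of_withoutWindow (h : CruxWithoutWindow) : WcbcsSsbToTorusLRO :=
  ⟨1, one_pos, fun U hU δ hδ μ => h U hU.1 δ hδ μ⟩

/-- Drop the doping cap (all `δ ∈ (0,1)`). Stronger; implies the crux. -/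
def CruxWithoutDopingCap : Prop :=
  ∃ U₀ : ℝ, 0 < U₀ ∧ ∀ U ∈ Ioo (0:ℝ) U₀, ∀ δ ∈ Ioo (0:ℝ) 1, ∀ μ : ℝ, Body U δ μ

theorem crux_of_withoutDopingCap (h : CruxWithoutDopingCap) : WcbcsSsbToTorusLRO := by
  obtain ⟨U₀, hU₀, h⟩ := h
  exact ⟨U₀, hU₀, fun U hU δ hδ μ => h U hU δ ⟨hδ.1, hδ.2.trans one_half_lt_one⟩ μ⟩

/-! ## §4 NEW (gen 2): free weakenings — the `∃ U₀ ∀ δ` uniformity is not used by the route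

`closes : WcbcsSsbToTorusLRO → WcbcsBcsConstruction → HubbardSuperconductivity` destructures crux 4 FIRST
(obtaining `δ`, `U₀`, `C` and the density-matched `μ` with `exp(-C/U²) ≤ m(U,μ)`), and only then invokes this
crux at that `δ`. Hence a version of this crux whose window `U₀` depends on `δ` (and even on `C`) closes the
route with crux 4 UNCHANGED. These weakenings are strictly cheaper targets AND they shed the uniform form's
worst hazard:

* ENDPOINT HAZARD OF THE UNIFORM FORM. If for arbitrarily small `U` there is a first-order (in `μ`) boundary
  `μ_c(U)` between the `d_{x²-y²}` phase `X` and a phase `Y` without B1g order, at dopings inside `(0, 1/2)`,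
  then for every `h > 0` the source `-h(Δ_d+Δ_d†)` selects `X` after `L → ∞` (linear gain `2h·m_X·L²` beats
  the `O(L⁰)` finite-size splitting and `Y`'s quadratic gain), so `HasDWaveOrder U μ_c` holds; if the
  source-FREE finite-torus competition at `μ_c` is won by `Y` along all large `L` (decided by `O(1/L)`
  Casimir-type corrections, a coin flip between the two phases), the tracial density converges to `n_Y`,
  `DensityMatched U (1-n_Y) μ_c` holds, and the crux demands B1g LRO of the canonical states at the pure-`Y`
  endpoint density — false. Candidate at `t' = 0`: the SDW / d-SC boundary at `δ_AF(U) → 0⁺` (present for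
  every `U > 0` by perfect nesting at half filling). The B1g/B2g switch near `δ ≈ 0.4` is NOT a candidate at
  the BCS level: the quartic Fermi-curve overlap `⟨g₁²g₂²⟩ < min(⟨g₁⁴⟩,⟨g₂⁴⟩)` favours a `d+id` coexistence
  REGION with continuous edges (§7 computation), where `m_{B1g} → 0` continuously.
* WHY THE SWAPPED FORM SHEDS IT. At FIXED `δ ∈ (0,1/2)`, every phase boundary `δ*(U)` that MOVES as `U → 0⁺`
  (`δ_AF(U) → 0`, `δ_c(U) → δ_c(0)` with an `o(1)` coexistence sliver) is avoided for `U < U₀(δ)`; only a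
  boundary frozen at a `U`-independent doping would still bite — non-generic. What remains is the genuine
  Koma–Tasaki Conjecture-10 content inside a pure phase.
-/

/-- Swapped quantifiers: the window may depend on the doping. -/
def CruxSwapped : Prop :=
  ∀ δ ∈ Ioo (0:ℝ) (1 / 2), ∃ U₀ : ℝ, 0 < U₀ ∧ ∀ U ∈ Ioo (0:ℝ) U₀, ∀ μ : ℝ, Body U δ μ

/-- Scale form: the window may depend on `δ` AND on crux 4's rate constant `C`, and the order hypothesis is
crux 4's quantitative floor `exp(-C/U²) ≤ m(U, μ)` instead of bare positivity. -/
def CruxAtScale : Prop :=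
  ∀ δ ∈ Ioo (0:ℝ) (1 / 2), ∀ C : ℝ, 0 < C → ∃ U₀ : ℝ, 0 < U₀ ∧ ∀ U ∈ Ioo (0:ℝ) U₀, ∀ μ : ℝ,
    DensityMatched U δ μ → Real.exp (-C / U ^ 2) ≤ dWaveOrderParameter U μ →
      HasDWavePairFieldLROAt U δ

theorem crux_imp_cruxSwapped (h : WcbcsSsbToTorusLRO) : CruxSwapped := by
  obtain ⟨U₀, hU₀, h⟩ := h
  exact fun δ hδ => ⟨U₀, hU₀, fun U hU μ => h U hU δ hδ μ⟩

theorem cruxSwapped_imp_cruxAtScale (h : CruxSwapped) : CruxAtScale := by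
  intro δ hδ C _
  obtain ⟨U₀, hU₀, h⟩ := h δ hδ
  refine ⟨U₀, hU₀, fun U hU μ hdm hfloor => h U hU μ hdm ?_⟩
  exact (hasDWaveOrder_iff U μ).2 (lt_of_lt_of_le (Real.exp_pos _) hfloor)

theorem crux_imp_cruxAtScale (h : WcbcsSsbToTorusLRO) : CruxAtScale :=
  cruxSwapped_imp_cruxAtScale (crux_imp_cruxSwapped h)

/-- The route still closes from the SWAPPED crux and crux 4 as filed (compare `closes` in the route file:
the only change is that `U₁` is obtained after `δ`). -/
theorem closes_swapped (hSsb : CruxSwapped) (hBcs : WcbcsBcsConstruction) :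
    _root_.HubbardSuperconductivity := by
  obtain ⟨δ, hδ, U₀, hU₀, C, _hC, h4⟩ := hBcs
  obtain ⟨U₁, hU₁, h2⟩ := hSsb δ hδ
  have hpos : (0 : ℝ) < min U₀ U₁ / 2 := half_pos (lt_min hU₀ hU₁)
  have hlt : min U₀ U₁ / 2 < min U₀ U₁ := half_lt_self (lt_min hU₀ hU₁)
  obtain ⟨μ, hdens, hm⟩ := h4 (min U₀ U₁ / 2) ⟨hpos, lt_of_lt_of_le hlt (min_le_left U₀ U₁)⟩
  have hord : HasDWaveOrder (min U₀ U₁ / 2) μ :=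
    (hasDWaveOrder_iff _ _).2 (lt_of_lt_of_le (Real.exp_pos _) hm)
  exact ⟨min U₀ U₁ / 2, hpos, δ, hδ,
    h2 (min U₀ U₁ / 2) ⟨hpos, lt_of_lt_of_le hlt (min_le_right U₀ U₁)⟩ μ hdens hord⟩

/-- The route still closes from the SCALE form and crux 4 as filed. -/
theorem closes_atScale (hSsb : CruxAtScale) (hBcs : WcbcsBcsConstruction) :
    _root_.HubbardSuperconductivity := by
  obtain ⟨δ, hδ, U₀, hU₀, C, hC, h4⟩ := hBcs
  obtain ⟨U₁, hU₁, h2⟩ := hSsb δ hδ C hC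
  have hpos : (0 : ℝ) < min U₀ U₁ / 2 := half_pos (lt_min hU₀ hU₁)
  have hlt : min U₀ U₁ / 2 < min U₀ U₁ := half_lt_self (lt_min hU₀ hU₁)
  obtain ⟨μ, hdens, hm⟩ := h4 (min U₀ U₁ / 2) ⟨hpos, lt_of_lt_of_le hlt (min_le_left U₀ U₁)⟩
  exact ⟨min U₀ U₁ / 2, hpos, δ, hδ,
    h2 (min U₀ U₁ / 2) ⟨hpos, lt_of_lt_of_le hlt (min_le_right U₀ U₁)⟩ μ hdens hm⟩

/-- Conversely the uniform crux is recovered from the swapped one only with a `δ`-UNIFORM window — exactly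
the clause the route never uses. (Trivial bookkeeping: uniformity in, uniformity out.) -/
theorem crux_of_cruxSwapped_uniform
    (h : ∃ U₀ : ℝ, 0 < U₀ ∧ ∀ δ ∈ Ioo (0:ℝ) (1 / 2), ∀ U ∈ Ioo (0:ℝ) U₀, ∀ μ : ℝ, Body U δ μ) :
    WcbcsSsbToTorusLRO := by
  obtain ⟨U₀, hU₀, h⟩ := h
  exact ⟨U₀, hU₀, fun U hU δ hδ μ => h δ hδ U hU μ⟩

/-! ## §5 The endpoint obstruction and the robust repair (re-established from gen 1)

Density matching is vacuous INSIDE a grand-canonical density jump but not at its ENDPOINT: at `μ_c` the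
tracial GC density can converge (to the finite-size winner's density) while the source selects the other
phase. Requiring order on a NEIGHBOURHOOD of `μ` removes the endpoint (just below `μ_c` the GC phase is `Y`,
which has no B1g order), at the price of a stronger crux 4. Classical precedent for "torus states at a
first-order point are decided by sub-extensive corrections": Borgs–Kotecký, J. Stat. Phys. 61 (1990) 79;
Borgs–Kotecký–Miracle-Solé, J. Stat. Phys. 62 (1991) 529. -/

/-- d-wave order on a neighbourhood of `μ`. -/
def OrderNearby (U μ : ℝ) : Prop :=
  ∀ᶠ μ' in 𝓝 μ, HasDWaveOrder U μ'

theorem OrderNearby.hasDWaveOrder {U μ : ℝ} (h : OrderNearby U μ) : HasDWaveOrder U μ :=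
  h.self_of_nhds

/-- Robust crux: order required on a neighbourhood of the density-matched `μ`. -/
def CruxRobust : Prop :=
  ∃ U₀ : ℝ, 0 < U₀ ∧ ∀ U ∈ Ioo (0:ℝ) U₀, ∀ δ ∈ Ioo (0:ℝ) (1 / 2), ∀ μ : ℝ,
    DensityMatched U δ μ → OrderNearby U μ → HasDWavePairFieldLROAt U δ

/-- Robust crux 4: the constructed order persists on a neighbourhood of the density-matched `μ`. -/
def BcsConstructionRobust : Prop :=
  ∃ δ ∈ Ioo (0:ℝ) (1 / 2), ∃ U₀ : ℝ, 0 < U₀ ∧ ∀ U ∈ Ioo (0:ℝ) U₀, ∃ μ : ℝ,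
    DensityMatched U δ μ ∧ OrderNearby U μ

theorem crux_imp_cruxRobust (h : WcbcsSsbToTorusLRO) : CruxRobust := by
  obtain ⟨U₀, hU₀, h⟩ := h
  exact ⟨U₀, hU₀, fun U hU δ hδ μ hdm hnb => h U hU δ hδ μ hdm hnb.hasDWaveOrder⟩

/-- The repaired route closes. -/
theorem closes_robust (hSsb : CruxRobust) (hBcs : BcsConstructionRobust) :
    _root_.HubbardSuperconductivity := by
  obtain ⟨U₁, hU₁, h2⟩ := hSsb
  obtain ⟨δ, hδ, U₀, hU₀, h4⟩ := hBcs
  have hpos : (0 : ℝ) < min U₀ U₁ / 2 := half_pos (lt_min hU₀ hU₁)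
  have hlt : min U₀ U₁ / 2 < min U₀ U₁ := half_lt_self (lt_min hU₀ hU₁)
  obtain ⟨μ, hdens, hnb⟩ := h4 (min U₀ U₁ / 2) ⟨hpos, lt_of_lt_of_le hlt (min_le_left U₀ U₁)⟩
  exact ⟨min U₀ U₁ / 2, hpos, δ, hδ,
    h2 (min U₀ U₁ / 2) ⟨hpos, lt_of_lt_of_le hlt (min_le_right U₀ U₁)⟩ δ hδ μ hdens hnb⟩

/-- Swapped AND robust — the cheapest statement of the transfer that still closes the route (with
`BcsConstructionRobust`). -/
def CruxSwappedRobust : Prop :=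
  ∀ δ ∈ Ioo (0:ℝ) (1 / 2), ∃ U₀ : ℝ, 0 < U₀ ∧ ∀ U ∈ Ioo (0:ℝ) U₀, ∀ μ : ℝ,
    DensityMatched U δ μ → OrderNearby U μ → HasDWavePairFieldLROAt U δ

theorem cruxRobust_imp_swappedRobust (h : CruxRobust) : CruxSwappedRobust := by
  obtain ⟨U₀, hU₀, h⟩ := h
  exact fun δ hδ => ⟨U₀, hU₀, fun U hU μ => h U hU δ hδ μ⟩

theorem cruxSwapped_imp_swappedRobust (h : CruxSwapped) : CruxSwappedRobust := by
  intro δ hδ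
  obtain ⟨U₀, hU₀, h⟩ := h δ hδ
  exact ⟨U₀, hU₀, fun U hU μ hdm hnb => h U hU μ hdm hnb.hasDWaveOrder⟩

theorem closes_swappedRobust (hSsb : CruxSwappedRobust) (hBcs : BcsConstructionRobust) :
    _root_.HubbardSuperconductivity := by
  obtain ⟨δ, hδ, U₀, hU₀, h4⟩ := hBcs
  obtain ⟨U₁, hU₁, h2⟩ := hSsb δ hδ
  have hpos : (0 : ℝ) < min U₀ U₁ / 2 := half_pos (lt_min hU₀ hU₁)
  have hlt : min U₀ U₁ / 2 < min U₀ U₁ := half_lt_self (lt_min hU₀ hU₁)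
  obtain ⟨μ, hdens, hnb⟩ := h4 (min U₀ U₁ / 2) ⟨hpos, lt_of_lt_of_le hlt (min_le_left U₀ U₁)⟩
  exact ⟨min U₀ U₁ / 2, hpos, δ, hδ,
    h2 (min U₀ U₁ / 2) ⟨hpos, lt_of_lt_of_le hlt (min_le_right U₀ U₁)⟩ μ hdens hnb⟩

/-! ### §4b Negation normal forms side by side: what a counterexample must look like

`not_crux_iff` lets the bad doping `δ` depend on `U` (a MOVING first-order endpoint kills the uniform
crux); `not_cruxSwapped_iff` needs ONE doping that stays bad along a sequence `U_n → 0⁺` (a FROZEN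
endpoint). -/

theorem not_cruxSwapped_iff :
    ¬ CruxSwapped ↔
      ∃ δ ∈ Ioo (0:ℝ) (1 / 2), ∀ U₀ : ℝ, 0 < U₀ → ∃ U ∈ Ioo (0:ℝ) U₀, ∃ μ : ℝ,
        DensityMatched U δ μ ∧ HasDWaveOrder U μ ∧ ¬ HasDWavePairFieldLROAt U δ := by
  unfold CruxSwapped
  simp only [Body, not_forall, not_exists, not_and, exists_prop]

theorem not_cruxSwapped_iff_frequently :
    ¬ CruxSwapped ↔
      ∃ δ ∈ Ioo (0:ℝ) (1 / 2), ∃ᶠ U in 𝓝[>] (0:ℝ), ∃ μ : ℝ, ¬ Body U δ μ := by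
  unfold CruxSwapped
  have key : ∀ δ : ℝ, (∃ U₀ : ℝ, 0 < U₀ ∧ ∀ U ∈ Ioo (0:ℝ) U₀, ∀ μ : ℝ, Body U δ μ) ↔
      ∀ᶠ U in 𝓝[>] (0:ℝ), ∀ μ : ℝ, Body U δ μ := fun δ => by
    rw [(nhdsGT_basis (0:ℝ)).eventually_iff]
  simp only [key, Filter.not_eventually, not_forall, exists_prop]

/-! ## §K The finite-volume kernel any proof must pass through (re-established from gen 1)

`HasDWavePairFieldLROAt U δ` asks for `liminf_k (2k)⁻⁴ Re⟨ψ_{2k}, P†P ψ_{2k}⟩ > 0`, `P = pairField d (2k)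
= √2 Δ_d`. By Cauchy–Schwarz, `|⟨φ, P ψ⟩|² ≤ Re⟨ψ, P†P ψ⟩` for EVERY unit vector `φ`: a proof of the crux
from its hypotheses must manufacture, for every admissible even-side ground-state sequence, unit vectors
`φ_k` (in the ideal tower picture: the `(N_L - 2, S^z = 0)`-sector ground state) receiving pair amplitude
`|⟨φ_k, P ψ_{2k}⟩| ≥ c·(2k)²` — a Penrose–Onsager–Yang off-diagonal order statement between ADJACENT charge
sectors of the source-FREE canonical model. The Koma–Tasaki order parameter lives in the sourced
grand-canonical state, whose order may be carried by EXCITED canonical states: that is the gap. -/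

section Kernel

variable (g : Literature.Probability.LatticeModels.Site 2 → ℝ)

/-- The a priori constant `C_g = 2 Σ_e |g e|/√2` of `pairFieldCorr_succ_le`. -/
def corrConst : ℝ :=
  ∑ e ∈ insert (0 : Literature.Probability.LatticeModels.Site 2)
    Literature.MathematicalPhysics.QuantumLattice.unitSteps, ‖((g e / Real.sqrt 2 : ℝ) : ℂ)‖ * 2

/-- A priori bound: `Re⟨ψ, P†P ψ⟩ ≤ C_g² (L+1)⁴` for a normalised state (from the tree's pointwise
bound `pairFieldCorr_succ_le` and `sum_pairFieldCorr_succ`). -/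
theorem re_expect_pairField_le (ψ : ∀ L, Fock (Orb (FermionTorus 2 L))) (L : ℕ)
    (hψ : star (ψ (L + 1)) ⬝ᵥ ψ (L + 1) = 1) :
    (expect ((pairField g (L + 1))ᴴ * pairField g (L + 1)) (ψ (L + 1))).re ≤
      corrConst g ^ 2 * ((L + 1 : ℕ) : ℝ) ^ 4 := by
  rw [← sum_pairFieldCorr_succ]
  calc ∑ x : Literature.Probability.LatticeModels.TorusSite 2 (L + 1), ∑ y, pairFieldCorr g ψ (L + 1) x y
      ≤ ∑ x : Literature.Probability.LatticeModels.TorusSite 2 (L + 1),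
          ∑ y : Literature.Probability.LatticeModels.TorusSite 2 (L + 1), corrConst g ^ 2 :=
        Finset.sum_le_sum fun x _ => Finset.sum_le_sum fun y _ => pairFieldCorr_succ_le g ψ L hψ x y
    _ = corrConst g ^ 2 * ((L + 1 : ℕ) : ℝ) ^ 4 := by
        simp only [Finset.sum_const, Finset.card_univ, Fintype.card_pi, ZMod.card,
          Finset.prod_const, Fintype.card_fin]
        push_cast
        ring

/-- Cauchy–Schwarz: the pair amplitude into ANY unit vector is bounded by the pair order,
`|⟨φ, P ψ⟩|² ≤ Re⟨ψ, P†P ψ⟩`. -/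
theorem norm_sq_pairAmplitude_le {L : ℕ} [NeZero L] (ψ φ : Fock (Orb (FermionTorus 2 L)))
    (hφ : star φ ⬝ᵥ φ = 1) :
    ‖star φ ⬝ᵥ (pairField g L *ᵥ ψ)‖ ^ 2 ≤ (expect ((pairField g L)ᴴ * pairField g L) ψ).re := by
  rw [PosSemidefTrace.expect_conjTranspose_mul, ← eucNorm_sq]
  exact pow_le_pow_left₀ (norm_nonneg _) (norm_star_dotProduct_le_eucNorm hφ _) 2

/-- **Even-side LRO from an eventual floor.** If along the even sides `2k+2` the states are normalised
and `a·(2k+2)⁴ ≤ Re⟨ψ_{2k+2}, P†P ψ_{2k+2}⟩` eventually, `a > 0`, then the summit's even-side long-range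
order holds (liminf coboundedness from `re_expect_pairField_le`). -/
theorem evenLRO_of_eventually_le (ψ : ∀ L, Fock (Orb (FermionTorus 2 L))) {a : ℝ} (ha : 0 < a)
    (hnorm : ∀ᶠ k : ℕ in atTop, star (ψ (2 * k + 1 + 1)) ⬝ᵥ ψ (2 * k + 1 + 1) = 1)
    (hlow : ∀ᶠ k : ℕ in atTop, a * ((2 * k + 1 + 1 : ℕ) : ℝ) ^ 4 ≤
      (expect ((pairField g (2 * k + 1 + 1))ᴴ * pairField g (2 * k + 1 + 1))
        (ψ (2 * k + 1 + 1))).re) :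
    Literature.Probability.LatticeModels.HasLongRangeOrder
      (fun k => Literature.Probability.LatticeModels.halfOpenBox 2 (2 * k))
      (fun k => torusPullback (pairFieldCorr g ψ) (2 * k)) := by
  unfold Literature.Probability.LatticeModels.HasLongRangeOrder
  rw [← Filter.liminf_nat_add _ 1]
  have key : ∀ k : ℕ,
      (∑ x ∈ Literature.Probability.LatticeModels.halfOpenBox 2 (2 * (k + 1)),
        ∑ y ∈ Literature.Probability.LatticeModels.halfOpenBox 2 (2 * (k + 1)),
          torusPullback (pairFieldCorr g ψ) (2 * (k + 1)) x y) /
        ((Literature.Probability.LatticeModels.halfOpenBox 2 (2 * (k + 1))).card : ℝ) ^ 2 =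
      (expect ((pairField g (2 * k + 1 + 1))ᴴ * pairField g (2 * k + 1 + 1))
          (ψ (2 * k + 1 + 1))).re / ((2 * k + 1 + 1 : ℕ) : ℝ) ^ 4 := by
    intro k
    rw [show 2 * (k + 1) = 2 * k + 1 + 1 by ring]
    exact torusLROSeq_pairFieldCorr_succ g ψ (2 * k + 1)
  simp only [key]
  have hpos : ∀ k : ℕ, (0 : ℝ) < ((2 * k + 1 + 1 : ℕ) : ℝ) ^ 4 := fun k => by positivity
  refine lt_of_lt_of_le ha (le_liminf_of_le ?_ ?_)
  · refine isCoboundedUnder_ge_of_eventually_le _ (x := corrConst g ^ 2) ?_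
    filter_upwards [hnorm] with k hk
    rw [div_le_iff₀ (hpos k)]
    exact re_expect_pairField_le g ψ (2 * k + 1) hk
  · filter_upwards [hlow] with k hk
    rwa [le_div_iff₀ (hpos k)]

/-- **Even-side LRO from pair amplitudes** (the Penrose–Onsager–Yang form): unit vectors `φ_k`
receiving pair amplitude `c·(2k+2)² ≤ |⟨φ_k, P ψ_{2k+2}⟩|` eventually, `c > 0`, give LRO. -/
theorem evenLRO_of_pairAmplitude (ψ : ∀ L, Fock (Orb (FermionTorus 2 L))) {c : ℝ} (hc : 0 < c)
    (hnorm : ∀ᶠ k : ℕ in atTop, star (ψ (2 * k + 1 + 1)) ⬝ᵥ ψ (2 * k + 1 + 1) = 1)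
    (hamp : ∀ᶠ k : ℕ in atTop, ∃ φ : Fock (Orb (FermionTorus 2 (2 * k + 1 + 1))),
      star φ ⬝ᵥ φ = 1 ∧
        c * ((2 * k + 1 + 1 : ℕ) : ℝ) ^ 2 ≤ ‖star φ ⬝ᵥ (pairField g (2 * k + 1 + 1) *ᵥ ψ (2 * k + 1 + 1))‖) :
    Literature.Probability.LatticeModels.HasLongRangeOrder
      (fun k => Literature.Probability.LatticeModels.halfOpenBox 2 (2 * k))
      (fun k => torusPullback (pairFieldCorr g ψ) (2 * k)) := by
  refine evenLRO_of_eventually_le g ψ (a := c ^ 2) (by positivity) hnorm ?_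
  filter_upwards [hamp] with k ⟨φ, hφ, hcφ⟩
  have hc0 : (0 : ℝ) ≤ c * ((2 * k + 1 + 1 : ℕ) : ℝ) ^ 2 := by positivity
  calc c ^ 2 * ((2 * k + 1 + 1 : ℕ) : ℝ) ^ 4 = (c * ((2 * k + 1 + 1 : ℕ) : ℝ) ^ 2) ^ 2 := by ring
    _ ≤ ‖star φ ⬝ᵥ (pairField g (2 * k + 1 + 1) *ᵥ ψ (2 * k + 1 + 1))‖ ^ 2 :=
        pow_le_pow_left₀ hc0 hcφ 2
    _ ≤ _ := norm_sq_pairAmplitude_le g _ φ hφ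

end Kernel

/-- **Off-diagonal pair order at `(U, δ)`** (the proof-shape target): a constant `c > 0` such that every
admissible even-side sector ground-state sequence eventually has a unit vector receiving `d`-wave pair
amplitude `≥ c·(side)²`. -/
def OffDiagonalPairOrder (U δ : ℝ) : Prop :=
  ∃ c : ℝ, 0 < c ∧ ∀ (N : ℕ → ℕ) (ψ : ∀ L, Fock (Orb (FermionTorus 2 L))),
    (∀ L, Even L → N L = 2 * ⌊(1 - δ) * (L : ℝ) ^ 2 / 2⌋₊ ∧ star (ψ L) ⬝ᵥ ψ L = 1 ∧
        IsGroundStateInSector (hubbardTorus 2 L 1 U) (N L) 0 (ψ L)) →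
      ∀ᶠ k : ℕ in atTop, ∃ φ : Fock (Orb (FermionTorus 2 (2 * k + 1 + 1))), star φ ⬝ᵥ φ = 1 ∧
        c * ((2 * k + 1 + 1 : ℕ) : ℝ) ^ 2 ≤
          ‖star φ ⬝ᵥ (pairField dWaveFormFactor (2 * k + 1 + 1) *ᵥ ψ (2 * k + 1 + 1))‖

/-- Off-diagonal pair order implies the summit matrix at `(U, δ)`. -/
theorem hasDWavePairFieldLROAt_of_offDiagonalPairOrder {U δ : ℝ} (h : OffDiagonalPairOrder U δ) :
    HasDWavePairFieldLROAt U δ := by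
  obtain ⟨c, hc, h⟩ := h
  intro N ψ hE
  refine evenLRO_of_pairAmplitude dWaveFormFactor ψ hc (Eventually.of_forall fun k => ?_) (h N ψ hE)
  exact (hE (2 * k + 1 + 1) ⟨k + 1, by ring⟩).2.1

/-- The crux follows from "SSB ⇒ off-diagonal pair order between adjacent charge sectors" — the shape
every honest proof takes (the tower picture: `φ_k` = the `(N_L - 2)`-sector ground state). -/
def SsbToOffDiagonalPairOrder : Prop :=
  ∃ U₀ : ℝ, 0 < U₀ ∧ ∀ U ∈ Ioo (0:ℝ) U₀, ∀ δ ∈ Ioo (0:ℝ) (1 / 2), ∀ μ : ℝ,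
    DensityMatched U δ μ → HasDWaveOrder U μ → OffDiagonalPairOrder U δ

theorem crux_of_ssbToOffDiagonalPairOrder (h : SsbToOffDiagonalPairOrder) : WcbcsSsbToTorusLRO := by
  obtain ⟨U₀, hU₀, h⟩ := h
  exact ⟨U₀, hU₀, fun U hU δ hδ μ hdm hord =>
    hasDWavePairFieldLROAt_of_offDiagonalPairOrder (h U hU δ hδ μ hdm hord)⟩

/-- **The Koma–Tasaki sharp converse** `m² ≤ liminf (2k)⁻⁴ Re⟨ψ_{2k}, P†P ψ_{2k}⟩` for every admissible
even-side sequence (KT1994 p. 11: "we are only able to prove the one sided inequality μ₁ ≥ μ₂ … Let us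
proceed by assuming that the equality μ₁ = μ₂ is valid"; with `P = √2Δ_d` the expected value is `2m²`). -/
def SharpConverse : Prop :=
  ∃ U₀ : ℝ, 0 < U₀ ∧ ∀ U ∈ Ioo (0:ℝ) U₀, ∀ δ ∈ Ioo (0:ℝ) (1 / 2), ∀ μ : ℝ, DensityMatched U δ μ →
    ∀ (N : ℕ → ℕ) (ψ : ∀ L, Fock (Orb (FermionTorus 2 L))),
      (∀ L, Even L → N L = 2 * ⌊(1 - δ) * (L : ℝ) ^ 2 / 2⌋₊ ∧ star (ψ L) ⬝ᵥ ψ L = 1 ∧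
          IsGroundStateInSector (hubbardTorus 2 L 1 U) (N L) 0 (ψ L)) →
        ∀ᶠ k : ℕ in atTop, dWaveOrderParameter U μ ^ 2 / 2 * ((2 * k + 1 + 1 : ℕ) : ℝ) ^ 4 ≤
          (expect ((pairField dWaveFormFactor (2 * k + 1 + 1))ᴴ * pairField dWaveFormFactor (2 * k + 1 + 1))
            (ψ (2 * k + 1 + 1))).re

/-- The sharp converse (even in the weak eventual form above, with any positive fraction of `m²`)
implies the crux. -/
theorem crux_of_sharpConverse (h : SharpConverse) : WcbcsSsbToTorusLRO := by
  obtain ⟨U₀, hU₀, h⟩ := h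
  refine ⟨U₀, hU₀, fun U hU δ hδ μ hdm hord N ψ hE => ?_⟩
  have hm : 0 < dWaveOrderParameter U μ ^ 2 / 2 := by
    have := (hasDWaveOrder_iff U μ).1 hord
    positivity
  exact evenLRO_of_eventually_le dWaveFormFactor ψ hm
    (Eventually.of_forall fun k => (hE (2 * k + 1 + 1) ⟨k + 1, by ring⟩).2.1) (h U hU δ hδ μ hdm N ψ hE)

/-! ## §9 Odd tori in the HYPOTHESES are inessential (re-established from gen 1)

The crux's density matching and order parameter run over ALL sides `L+1`, the conclusion only over even sides.
Restricting both hypotheses to even sides gives WEAKER hypotheses, hence a STRONGER statement `CruxEvenHyp`,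
which implies the crux (`crux_of_cruxEvenHyp`): provers may work on even (bipartite) tori throughout; a
refuter gains nothing from odd tori. Key inequality: `dWaveOrderParameter ≤ dWaveOrderParameterEven`
(a liminf along a subsequence dominates the full liminf; the `h`-liminf is monotone). -/

section EvenHyp

/-- Density matching along even sides `2k+2` only. -/
def DensityMatchedEven (U δ μ : ℝ) : Prop :=
  Tendsto (fun k : ℕ => gcDensity U μ (2 * k + 1)) atTop (𝓝 (1 - δ))

/-- The order parameter with the inner liminf along even sides only. -/
def dWaveOrderParameterEven (U μ : ℝ) : ℝ :=
  liminf (fun h : ℝ => liminf (fun k : ℕ => dWaveSourceDensity (2 * k + 1 + 1) U μ h) atTop) (𝓝[>] 0)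

/-- `d`-wave order seen along even sides. -/
def HasDWaveOrderEven (U μ : ℝ) : Prop := 0 < dWaveOrderParameterEven U μ

theorem densityMatchedEven_of_densityMatched {U δ μ : ℝ} (h : DensityMatched U δ μ) :
    DensityMatchedEven U δ μ :=
  h.comp (tendsto_atTop_atTop.2 fun b => ⟨b, fun a ha => by omega⟩ :
    Tendsto (fun k : ℕ => 2 * k + 1) atTop atTop)

/-- A real sequence bounded from both sides: its liminf is dominated by the liminf along any subsequence. -/
theorem liminf_le_liminf_comp {u : ℕ → ℝ} {a b : ℝ} (ha : ∀ n, a ≤ u n) (hb : ∀ n, u n ≤ b)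
    {φ : ℕ → ℕ} (hφ : Tendsto φ atTop atTop) :
    liminf u atTop ≤ liminf (u ∘ φ) atTop := by
  refine le_of_forall_lt_imp_le_of_dense fun c hc => ?_
  have hev : ∀ᶠ n in atTop, c < u n :=
    Filter.eventually_lt_of_lt_liminf hc (isBoundedUnder_of_eventually_ge (Eventually.of_forall ha))
  have hev' : ∀ᶠ k in atTop, c ≤ (u ∘ φ) k := (hφ.eventually hev).mono fun k hk => hk.le
  exact le_liminf_of_le (isCoboundedUnder_ge_of_eventually_le _ (Eventually.of_forall fun k => hb (φ k))) hev'

/-- `m ≤ m_even`. -/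
theorem dWaveOrderParameter_le_even (U μ : ℝ) : dWaveOrderParameter U μ ≤ dWaveOrderParameterEven U μ := by
  rw [dWaveOrderParameter, dWaveOrderParameterEven]
  set B : ℝ := 2 * ∑ e ∈ insert (0 : Literature.Probability.LatticeModels.Site 2)
    Literature.MathematicalPhysics.QuantumLattice.unitSteps, |dWaveFormFactor e / Real.sqrt 2| with hB
  have hφ : Tendsto (fun k : ℕ => 2 * k + 1) atTop atTop :=
    tendsto_atTop_atTop.2 fun b => ⟨b, fun a ha => by omega⟩
  have hinner : ∀ h : ℝ, 0 ≤ h →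
      liminf (fun L : ℕ => dWaveSourceDensity (L + 1) U μ h) atTop ≤
        liminf (fun k : ℕ => dWaveSourceDensity (2 * k + 1 + 1) U μ h) atTop := by
    intro h hh
    have := liminf_le_liminf_comp (u := fun L : ℕ => dWaveSourceDensity (L + 1) U μ h)
      (fun L => dWaveSourceDensity_nonneg U μ hh) (fun L => dWaveSourceDensity_le_const (L + 1) U μ h) hφ
    simpa [Function.comp_def] using this
  refine Filter.liminf_le_liminf ?_ ?_ ?_
  · filter_upwards [self_mem_nhdsWithin] with h hh
    exact hinner h (le_of_lt hh)
  · refine isBoundedUnder_of_eventually_ge (a := 0) ?_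
    filter_upwards [self_mem_nhdsWithin] with h hh
    exact liminf_dWaveSourceDensity_nonneg U μ (le_of_lt hh)
  · refine isCoboundedUnder_ge_of_eventually_le _ (x := B) ?_
    filter_upwards [self_mem_nhdsWithin] with h hh
    exact Filter.liminf_le_of_frequently_le
      (Eventually.of_forall fun k : ℕ => dWaveSourceDensity_le_const (2 * k + 1 + 1) U μ h).frequently
      (isBoundedUnder_of_eventually_ge
        (Eventually.of_forall fun k : ℕ => dWaveSourceDensity_nonneg (L := 2 * k + 1 + 1) U μ hh.le))

theorem hasDWaveOrderEven_of_hasDWaveOrder {U μ : ℝ} (h : HasDWaveOrder U μ) : HasDWaveOrderEven U μ :=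
  lt_of_lt_of_le ((hasDWaveOrder_iff U μ).1 h) (dWaveOrderParameter_le_even U μ)

/-- The crux with BOTH hypotheses restricted to even sides. -/
def CruxEvenHyp : Prop :=
  ∃ U₀ : ℝ, 0 < U₀ ∧ ∀ U ∈ Ioo (0:ℝ) U₀, ∀ δ ∈ Ioo (0:ℝ) (1 / 2), ∀ μ : ℝ,
    DensityMatchedEven U δ μ → HasDWaveOrderEven U μ → HasDWavePairFieldLROAt U δ

/-- Even-side hypotheses suffice: `CruxEvenHyp → crux`. -/
theorem crux_of_cruxEvenHyp (h : CruxEvenHyp) : WcbcsSsbToTorusLRO := by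
  obtain ⟨U₀, hU₀, h⟩ := h
  exact ⟨U₀, hU₀, fun U hU δ hδ μ hdm hord =>
    h U hU δ hδ μ (densityMatchedEven_of_densityMatched hdm) (hasDWaveOrderEven_of_hasDWaveOrder hord)⟩

end EvenHyp

/-! ## §8 Round-1 crux ideas: the finite-`L` lemmas that are "provable now" ARE (proved here), and where
the hazard sits

The quenched-corner card (`Ideas/quenched-corner-by-square-completion.md`, `SketchQuenchedCorner.lean`) and
the tangent-face card (`Ideas/tangent-face-legendre-spine.md`) both start from finite-volume convex analysis
of the sourced ground energy `E(h) = E₀(K_μ - h(P + P†))`. Their typed first lemmas are corollaries of the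
tree's sandwich `dWaveSourceDensity_mul_le_groundEnergy_drop` / `groundEnergy_gain_le_dWaveSourceDensity`
and of positivity of the tracial state; they are discharged below VERBATIM (same binders, same bodies as in
`SketchQuenchedCorner.lean`, restated here rather than imported so that this file does not depend on an
ideator's scratch module). ADVERSARIAL NOTE (DOC): none of these touches the crux's difficulty. The
transfer statements `HolderCorner U δ` (right-continuity at `t = 0⁺`, uniform in even `L`, of the every-GS
pair order of `hubbardTorus - (t/L²)P†P` in the sector) and `SeededRecentring U δ μ` fail exactly in the
first-order ENDPOINT configuration of §4/§5 (a `t = 0⁺` jump of the quenched every-GS order, resp. an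
`O(t)·L²` instead of `O(t²)·L²` recentring cost on a flat piece of `e(ρ)`), i.e. they relocate the hazard,
they do not remove it; and `SeededRecentring U δ μ` as a bare `Prop` is false at any `μ` that is not a
subgradient of the canonical energy density at `1 - δ` (it is only ever used under `DensityMatched`). -/

section IdeaLemmas

open Matrix

variable (L : ℕ) [NeZero L]

/-- Index type of the torus Fock space (as in `SketchQuenchedCorner.lean`). -/
abbrev ι (L : ℕ) : Type := Finset (Orb (FermionTorus 2 L))

/-- `P_L = pairField dWaveFormFactor L` (`= √2 Δ_d`). -/
abbrev pF (L : ℕ) [NeZero L] : Matrix (ι L) (ι L) ℂ := pairField dWaveFormFactor L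

/-- The quenched grand-canonical Hamiltonian `K_μ - (t/L²) P†P` (verbatim `QuenchedCorner.quenchedGC`). -/
def quenchedGC (U μ t : ℝ) : Matrix (ι L) (ι L) ℂ :=
  hubbardTorusWith 2 L 1 U μ - ((t / (L : ℝ) ^ 2 : ℝ) : ℂ) • ((pF L)ᴴ * pF L)

/-- `L⁻⁴ Re⟨φ, P†P φ⟩` (verbatim `QuenchedCorner.lro`). -/
def lro (φ : Fock (Orb (FermionTorus 2 L))) : ℝ :=
  (expect ((pF L)ᴴ * pF L) φ).re / (L : ℝ) ^ 4

/-- **`GriffithsSandwich`** (tangent-face card, first lemma; gen-1 `griffithsSandwich`): chord slopes of the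
concave sourced energy bracket the tracial density. Two invocations of the tree sandwich. -/
theorem griffithsSandwich (U μ h₁ h h₂ : ℝ) (h1 : h₁ < h) (h2 : h < h₂) :
    ((dWaveSourceTorus L U μ h₁).groundEnergy - (dWaveSourceTorus L U μ h).groundEnergy) / (h - h₁) ≤
        2 * (L : ℝ) ^ 2 * dWaveSourceDensity L U μ h ∧
      2 * (L : ℝ) ^ 2 * dWaveSourceDensity L U μ h ≤
        ((dWaveSourceTorus L U μ h).groundEnergy - (dWaveSourceTorus L U μ h₂).groundEnergy) / (h₂ - h) := by
  constructor
  · rw [div_le_iff₀ (sub_pos.2 h1)]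
    have := dWaveSourceDensity_mul_le_groundEnergy_drop (L := L) U μ h h₁
    nlinarith [this]
  · rw [le_div_iff₀ (sub_pos.2 h2)]
    have := dWaveSourceDensity_mul_le_groundEnergy_drop (L := L) U μ h h₂
    nlinarith [this]

/-- **`TracialCuspBound`** (quenched-corner card, Lemma D; verbatim body): for `0 ≤ s ≤ h`,
`(h - s)·2L²·dens(s) ≤ E₀(K_μ) - E₀(K_μ - h(P+P†))`. -/
theorem tracialCuspBound (U μ s h : ℝ) (_hs : 0 ≤ s) (_hsh : s ≤ h) :
    (h - s) * (2 * (L : ℝ) ^ 2 * dWaveSourceDensity L U μ s) ≤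
      (hubbardTorusWith 2 L 1 U μ).groundEnergy - (dWaveSourceTorus L U μ h).groundEnergy := by
  have h1 := dWaveSourceDensity_mul_le_groundEnergy_drop (L := L) U μ s h
  have h2 := groundEnergy_dWaveSourceTorus_le (L := L) U μ s
  rw [dWaveSourceTorus_zero] at h2
  linarith

/-- `TracialCuspBound` holds with NO condition on `s, h` at all (hypothesis mutation: both side conditions of
the card's Lemma D are decoration — `E(s) ≤ E(0)` for every real `s`, and the sandwich is two-sided). -/
theorem tracialCuspBound' (U μ s h : ℝ) :
    (h - s) * (2 * (L : ℝ) ^ 2 * dWaveSourceDensity L U μ s) ≤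
      (hubbardTorusWith 2 L 1 U μ).groundEnergy - (dWaveSourceTorus L U μ h).groundEnergy := by
  have h1 := dWaveSourceDensity_mul_le_groundEnergy_drop (L := L) U μ s h
  have h2 := groundEnergy_dWaveSourceTorus_le (L := L) U μ s
  rw [dWaveSourceTorus_zero] at h2
  linarith

omit [NeZero L] in
/-- The index type of the torus Fock space is nonempty (the vacuum). -/
instance instNonemptyι : Nonempty (ι L) := ⟨∅⟩

/-- The quenched Hamiltonian is Hermitian. -/
theorem isHermitian_quenchedGC (U μ t : ℝ) : (quenchedGC L U μ t).IsHermitian := by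
  unfold quenchedGC
  refine (isHermitian_hubbardTorusWith L 1 U μ).sub (Matrix.IsHermitian.smul ?_ ?_)
  · exact Matrix.isHermitian_conjTranspose_mul_self _
  · rw [isSelfAdjoint_iff, Complex.star_def, Complex.conj_ofReal]

/-- Completing the square: for real `a, b` and any square matrix `P`,
`(aP - b)ᴴ(aP - b) = a²·P†P - ab·(P + P†) + b²`. -/
theorem square_identity {m : Type*} [Fintype m] [DecidableEq m] (P : Matrix m m ℂ) (a b : ℝ) :
    ((a : ℂ) • P - (b : ℂ) • (1 : Matrix m m ℂ))ᴴ * ((a : ℂ) • P - (b : ℂ) • (1 : Matrix m m ℂ)) =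
      ((a : ℂ) * a) • (Pᴴ * P) - ((a : ℂ) * b) • (P + Pᴴ) + ((b : ℂ) * b) • (1 : Matrix m m ℂ) := by
  have ha : star (a : ℂ) = a := by rw [Complex.star_def, Complex.conj_ofReal]
  have hb : star (b : ℂ) = b := by rw [Complex.star_def, Complex.conj_ofReal]
  rw [conjTranspose_sub, conjTranspose_smul, conjTranspose_smul, conjTranspose_one, ha, hb]
  simp only [sub_mul, mul_sub, smul_mul_assoc, mul_smul_comm, Matrix.mul_one, Matrix.one_mul,
    smul_add, smul_sub, smul_smul]
  rw [mul_comm (b : ℂ) a]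
  abel

/-- **`SquareCompletionBound`** (quenched-corner card, first lemma; verbatim body): with
`X = (√t/L)P - (hL/√t)·1`, `XᴴX = (t/L²)P†P - h(P+P†) + (h²L²/t)·1 = S - Q + (h²L²/t)·1 ≥ 0` in the tracial
ground state of the SOURCED Hamiltonian `S`, which is also a trial state for the quenched `Q`. -/
theorem squareCompletionBound (U μ h t : ℝ) (ht : 0 < t) :
    (quenchedGC L U μ t).groundEnergy - h ^ 2 * (L : ℝ) ^ 2 / t ≤ (dWaveSourceTorus L U μ h).groundEnergy := by
  have hL : (0 : ℝ) < (L : ℝ) := Nat.cast_pos.2 (Nat.pos_of_ne_zero (NeZero.ne L))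
  have hSH : (dWaveSourceTorus L U μ h).IsHermitian :=
    dWaveSourceTorus_isHermitian L (isHermitian_hubbardTorusWith L 1 U μ) h
  have hQH : (quenchedGC L U μ t).IsHermitian := isHermitian_quenchedGC L U μ t
  have hsq : Real.sqrt t ^ 2 = t := Real.sq_sqrt ht.le
  have hst : 0 < Real.sqrt t := Real.sqrt_pos.2 ht
  -- the square, with a = √t/L and b = hL/√t
  have hab : Real.sqrt t / (L : ℝ) * (h * (L : ℝ) / Real.sqrt t) = h := by
    field_simp
  have haa : Real.sqrt t / (L : ℝ) * (Real.sqrt t / (L : ℝ)) = t / (L : ℝ) ^ 2 := by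
    rw [div_mul_div_comm, ← sq, hsq, sq]
  have hbb : h * (L : ℝ) / Real.sqrt t * (h * (L : ℝ) / Real.sqrt t) = h ^ 2 * (L : ℝ) ^ 2 / t := by
    rw [div_mul_div_comm, ← sq, ← sq (Real.sqrt t), hsq]; ring
  have hXX := square_identity (pF L) (Real.sqrt t / (L : ℝ)) (h * (L : ℝ) / Real.sqrt t)
  rw [← Complex.ofReal_mul, ← Complex.ofReal_mul, ← Complex.ofReal_mul, hab, haa, hbb] at hXX
  -- XᴴX = S - Q + b²·1
  have hSQ : ((t / (L : ℝ) ^ 2 : ℝ) : ℂ) • ((pF L)ᴴ * pF L) - (h : ℂ) • (pF L + (pF L)ᴴ) +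
      ((h ^ 2 * (L : ℝ) ^ 2 / t : ℝ) : ℂ) • (1 : Matrix (ι L) (ι L) ℂ) =
      dWaveSourceTorus L U μ h - quenchedGC L U μ t +
        ((h ^ 2 * (L : ℝ) ^ 2 / t : ℝ) : ℂ) • (1 : Matrix (ι L) (ι L) ℂ) := by
    rw [dWaveSourceTorus, quenchedGC]
    abel
  rw [hSQ] at hXX
  -- positivity of the square in the sourced tracial state, and the trial-state inequality
  have hpos := Matrix.groundStateFunctional_nonneg (dWaveSourceTorus L U μ h)
    (((Real.sqrt t / (L : ℝ) : ℝ) : ℂ) • pF L - ((h * (L : ℝ) / Real.sqrt t : ℝ) : ℂ) • (1 : Matrix (ι L) (ι L) ℂ))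
  rw [hXX, map_add, map_sub, Matrix.groundStateFunctional_hamiltonian hSH, map_smul,
    Matrix.groundStateFunctional_one hSH] at hpos
  obtain ⟨hre, -⟩ := Complex.nonneg_iff.mp hpos
  simp only [Complex.add_re, Complex.sub_re, Complex.ofReal_re, smul_eq_mul, mul_one] at hre
  have htrial : (quenchedGC L U μ t).groundEnergy ≤
      ((dWaveSourceTorus L U μ h).groundStateFunctional (quenchedGC L U μ t)).re :=
    Matrix.groundEnergy_le_groundStateFunctional_re hSH hQH
  linarith

/-- **`QuenchedGSOrderFromGain`** (quenched-corner card; verbatim body): every normalised ground vector of the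
quenched model carries the quenched energy gain as pair order,
`E₀(K_μ) - E₀(K_μ - (t/L²)P†P) ≤ t L² · lro Φ` (`= (t/L²) Re⟨Φ, P†P Φ⟩`). One variational inequality; the
hypothesis `0 < t` is not used. -/
theorem quenchedGSOrderFromGain (U μ t : ℝ) (Φ : Fock (Orb (FermionTorus 2 L))) (_ht : 0 < t)
    (hΦ : (quenchedGC L U μ t).IsGroundStateVector Φ) (hΦ1 : star Φ ⬝ᵥ Φ = 1) :
    (hubbardTorusWith 2 L 1 U μ).groundEnergy - (quenchedGC L U μ t).groundEnergy ≤
      t * (L : ℝ) ^ 2 * lro L Φ := by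
  have hL : (0 : ℝ) < (L : ℝ) := Nat.cast_pos.2 (Nat.pos_of_ne_zero (NeZero.ne L))
  have hK := Matrix.groundEnergy_le_rayleigh_holds (isHermitian_hubbardTorusWith L 1 U μ) Φ hΦ1
  -- ⟨Φ, Q Φ⟩ = E₀(Q)
  have hQ : (star Φ ⬝ᵥ quenchedGC L U μ t *ᵥ Φ).re = (quenchedGC L U μ t).groundEnergy := by
    rw [hΦ.2, dotProduct_smul, hΦ1]
    simp
  -- K = Q + (t/L²) P†P as quadratic forms
  have hsplit : star Φ ⬝ᵥ hubbardTorusWith 2 L 1 U μ *ᵥ Φ =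
      star Φ ⬝ᵥ quenchedGC L U μ t *ᵥ Φ + ((t / (L : ℝ) ^ 2 : ℝ) : ℂ) * expect ((pF L)ᴴ * pF L) Φ := by
    rw [quenchedGC, Matrix.sub_mulVec, Matrix.smul_mulVec, dotProduct_sub, dotProduct_smul, smul_eq_mul,
      expect]
    ring
  have hre : (star Φ ⬝ᵥ hubbardTorusWith 2 L 1 U μ *ᵥ Φ).re =
      (quenchedGC L U μ t).groundEnergy + t / (L : ℝ) ^ 2 * (expect ((pF L)ᴴ * pF L) Φ).re := by
    rw [hsplit, Complex.add_re, hQ, Complex.re_ofReal_mul]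
  have hlro : t * (L : ℝ) ^ 2 * lro L Φ = t / (L : ℝ) ^ 2 * (expect ((pF L)ᴴ * pF L) Φ).re := by
    unfold lro
    field_simp
  rw [hlro]
  linarith

/-- Unpacking `HasDWaveOrder`: for every `s > 0` and `ε' > 0`, eventually in the side `L + 1` the sourced
tracial density exceeds `m - ε'` (the `h`-liminf is an infimum, tree `dWaveOrderParameter_le_liminf`, and the
inner sequence is bounded below by `0`). -/
theorem eventually_density_gt (U μ : ℝ) {s ε' : ℝ} (hs : 0 < s) (hε' : 0 < ε') :
    ∀ᶠ n : ℕ in atTop, dWaveOrderParameter U μ - ε' < dWaveSourceDensity (n + 1) U μ s := by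
  have hle := dWaveOrderParameter_le_liminf U μ hs
  refine Filter.eventually_lt_of_lt_liminf (lt_of_lt_of_le (by linarith) hle) ?_
  exact isBoundedUnder_of_eventually_ge (a := 0)
    (Eventually.of_forall fun n => dWaveSourceDensity_nonneg U μ hs.le)

/-- The quenched energy GAIN at weak seed, from the order parameter alone (no ground vector of the quenched
model is needed): for `η ∈ (0, 1/2]`, `t > 0`, eventually in the side,
`t L² m²(1 - 4η) ≤ E₀(K_μ) - E₀(K_μ - (t/L²)P†P)` (cusp up to `h = mt` from source `s = ηmt`, then the square). -/
theorem quenchedGap_lower (U μ : ℝ) (hord : HasDWaveOrder U μ) {η t : ℝ} (hη0 : 0 < η) (hη : η ≤ 1 / 2)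
    (ht0 : 0 < t) :
    ∃ N : ℕ, ∀ n : ℕ, N ≤ n →
      t * ((n + 1 : ℕ) : ℝ) ^ 2 * (dWaveOrderParameter U μ ^ 2 * (1 - 4 * η)) ≤
        (hubbardTorusWith 2 (n + 1) 1 U μ).groundEnergy - (quenchedGC (n + 1) U μ t).groundEnergy := by
  set m := dWaveOrderParameter U μ with hm_def
  have hm : 0 < m := (hasDWaveOrder_iff U μ).1 hord
  have hs : 0 < η * m * t := by positivity
  obtain ⟨N, hN⟩ := eventually_atTop.1 (eventually_density_gt U μ hs (mul_pos hη0 hm))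
  refine ⟨N, fun n hn => ?_⟩
  have hdens : m - η * m < dWaveSourceDensity (n + 1) U μ (η * m * t) := hN n hn
  have h1 := tracialCuspBound' (n + 1) U μ (η * m * t) (m * t)
  have h2 := squareCompletionBound (n + 1) U μ (m * t) t ht0
  have hgap : (m * t - η * m * t) * (2 * ((n + 1 : ℕ) : ℝ) ^ 2 * (m - η * m)) ≤
      (m * t - η * m * t) * (2 * ((n + 1 : ℕ) : ℝ) ^ 2 * dWaveSourceDensity (n + 1) U μ (η * m * t)) := by
    have hpos : 0 ≤ m * t - η * m * t := by nlinarith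
    exact mul_le_mul_of_nonneg_left (by nlinarith [hdens.le]) hpos
  have hsq : (m * t) ^ 2 * ((n + 1 : ℕ) : ℝ) ^ 2 / t = m ^ 2 * t * ((n + 1 : ℕ) : ℝ) ^ 2 := by
    field_simp
  rw [hsq] at h2
  have e : (m * t - η * m * t) * (2 * ((n + 1 : ℕ) : ℝ) ^ 2 * (m - η * m)) - m ^ 2 * t * ((n + 1 : ℕ) : ℝ) ^ 2
      = t * ((n + 1 : ℕ) : ℝ) ^ 2 * (m ^ 2 * (1 - 4 * η + 2 * η ^ 2)) := by ring
  have hdrop : t * ((n + 1 : ℕ) : ℝ) ^ 2 * (m ^ 2 * (1 - 4 * η)) ≤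
      t * ((n + 1 : ℕ) : ℝ) ^ 2 * (m ^ 2 * (1 - 4 * η + 2 * η ^ 2)) := by
    gcongr
    nlinarith
  linarith

/-- **`QuenchedCornerOrder`** — the quenched-corner card's "first checkable statement of the line", PROVED
(verbatim body up to the names of this file; the card's `t₀` may be taken `= 1`, indeed any `t > 0` works):
Koma–Tasaki `d`-wave order `m > 0` forces EVERY normalised ground vector of the number-conserving quenched
model `K_μ - (t/L²)P†P` to carry pair order `lro ≥ m² - ε` for all large `L`. Chain: unpack the liminfs at
source `s = ηmt`, cusp bound up to `h = mt`, complete the square, read the gain off any ground vector.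
So the U(1)-breaking hypothesis converts LOSSLESSLY into an every-ground-state statement for a
charge-conserving Hamiltonian: the crux's entire difficulty is the transfer `t → 0⁺` uniformly in `L`
inside ONE particle-number sector (`HolderCorner` / `SeededRecentring`), where §4/§5's endpoint hazard sits. -/
theorem quenchedCornerOrder (U μ : ℝ) (hord : HasDWaveOrder U μ) (ε : ℝ) (hε : 0 < ε) :
    ∃ t₀ : ℝ, 0 < t₀ ∧ ∀ t ∈ Set.Ioo (0 : ℝ) t₀, ∃ L₀ : ℕ, ∀ (L : ℕ) [NeZero L], L₀ ≤ L →
      ∀ Φ : Fock (Orb (FermionTorus 2 L)),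
        (quenchedGC L U μ t).IsGroundStateVector Φ → star Φ ⬝ᵥ Φ = 1 →
          dWaveOrderParameter U μ ^ 2 - ε ≤ lro L Φ := by
  set m := dWaveOrderParameter U μ with hm_def
  have hm : 0 < m := (hasDWaveOrder_iff U μ).1 hord
  set η : ℝ := min (1 / 4) (ε / (4 * m ^ 2)) with hη_def
  have hη0 : 0 < η := lt_min (by norm_num) (by positivity)
  have hη4 : η ≤ 1 / 4 := min_le_left _ _
  have hηε : 4 * η * m ^ 2 ≤ ε := by
    have : η ≤ ε / (4 * m ^ 2) := min_le_right _ _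
    rw [le_div_iff₀ (by positivity)] at this
    linarith
  refine ⟨1, one_pos, fun t ht => ?_⟩
  obtain ⟨N, hN⟩ := quenchedGap_lower U μ hord hη0 (by linarith) ht.1
  refine ⟨N + 1, fun L _ hL Φ hΦ hΦ1 => ?_⟩
  obtain ⟨n, rfl⟩ : ∃ n, L = n + 1 := ⟨L - 1, by omega⟩
  have ht0 : 0 < t := ht.1
  have key := (hN n (by omega)).trans (quenchedGSOrderFromGain (n + 1) U μ t Φ ht0 hΦ hΦ1)
  have hfin : m ^ 2 * (1 - 4 * η) ≤ lro (n + 1) Φ := le_of_mul_le_mul_left key (by positivity)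
  nlinarith

/-! ### §8b The card's transfer glue `C⁺ ⇒ crux` IS provable now (proved): the crux reduces to two named stubs

Verbatim copies of the card's `quenchedCan`, `SeededRecentring`, `HolderCorner`; the one side obligation the
card leaves implicit (`QuenchedSectorGSExists`: normalised sector ground states of the quenched CANONICAL model
exist — `P†P` has `(N↑,N↓)`-grade `(0,0)`) is DISCHARGED (`quenchedSectorGSExists`, via the tree's
`PairChirality.Shifts` and `sector_groundState`). Then `hasDWavePairFieldLROAt_of_corner`: at fixed `(U, δ, μ)`,
`HasDWaveOrder U μ ∧ SeededRecentring U δ μ ∧ HolderCorner U δ ⇒ HasDWavePairFieldLROAt U δ` — NO density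
matching is used formally (it is only what makes `SeededRecentring` plausible); `crux_of_transfer` and
`cruxSwapped_of_transfer` package it. ADVERSARIAL READING (`transfer_stub_false_at_counterexample`): at any
counterexample configuration (order but no LRO) one of the two stubs is false — the endpoint hazard of §4/§5 is
carried entirely by `SeededRecentring ∧ HolderCorner`. -/

/-- The quenched CANONICAL torus Hamiltonian `H - (t/L²) P†P` (verbatim `QuenchedCorner.quenchedCan`). -/
def quenchedCan (U t : ℝ) : Matrix (ι L) (ι L) ℂ :=
  hubbardTorus 2 L 1 U - ((t / (L : ℝ) ^ 2 : ℝ) : ℂ) • ((pF L)ᴴ * pF L)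

/-- `quenchedGC = quenchedCan - μ N̂`. -/
theorem quenchedGC_eq (U μ t : ℝ) :
    quenchedGC L U μ t = quenchedCan L U t - (μ : ℂ) • totalNumber := by
  rw [quenchedGC, quenchedCan, hubbardTorusWith_eq]
  abel

/-- Verbatim `QuenchedCorner.SeededRecentring`. -/
def SeededRecentring (U δ μ : ℝ) : Prop :=
  ∀ ε : ℝ, 0 < ε → ∃ t₀ : ℝ, 0 < t₀ ∧ ∀ t ∈ Set.Ioo (0 : ℝ) t₀, ∃ L₀ : ℕ,
    ∀ (L : ℕ) [NeZero L], L₀ ≤ L → Even L →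
      (quenchedCan L U t).minEnergyOn (szSector (2 * ⌊(1 - δ) * (L : ℝ) ^ 2 / 2⌋₊) 0) -
          μ * ((2 * ⌊(1 - δ) * (L : ℝ) ^ 2 / 2⌋₊ : ℕ) : ℝ) - (quenchedGC L U μ t).groundEnergy ≤
        ε * t * (L : ℝ) ^ 2

/-- Verbatim `QuenchedCorner.HolderCorner`. -/
def HolderCorner (U δ : ℝ) : Prop :=
  ∃ C a t₀ : ℝ, 0 < C ∧ a < 1 ∧ 0 < t₀ ∧ ∀ t ∈ Set.Ioo (0 : ℝ) t₀, ∃ L₀ : ℕ,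
    ∀ (L : ℕ) [NeZero L], L₀ ≤ L → Even L →
      ∀ ψ₀ ψ₁ : Fock (Orb (FermionTorus 2 L)),
        IsGroundStateInSector (hubbardTorus 2 L 1 U) (2 * ⌊(1 - δ) * (L : ℝ) ^ 2 / 2⌋₊) 0 ψ₀ →
        star ψ₀ ⬝ᵥ ψ₀ = 1 →
        IsGroundStateInSector (quenchedCan L U t) (2 * ⌊(1 - δ) * (L : ℝ) ^ 2 / 2⌋₊) 0 ψ₁ →
        star ψ₁ ⬝ᵥ ψ₁ = 1 →
          lro L ψ₁ - lro L ψ₀ ≤ C * t ^ (1 - a)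

/-- The side obligation (as used by the glue): normalised sector ground states of the quenched canonical model
exist in every NON-TRIVIAL sector `(2n, S^z = 0)`. DISCHARGED below (`quenchedSectorGSExists`): `P†P` has
`(N↑, N↓)`-grade `(0,0)` (tree `PairChirality.Shifts`), so `quenchedCan` is block diagonal and the tree's
`sector_groundState` applies. -/
def QuenchedSectorGSExists (U : ℝ) : Prop :=
  ∀ (t : ℝ) (L : ℕ) [NeZero L] (n : ℕ),
    (∃ φ : Fock (Orb (FermionTorus 2 L)), φ ∈ szSector (2 * n) 0 ∧ φ ≠ 0) →
      ∃ ψ : Fock (Orb (FermionTorus 2 L)), star ψ ⬝ᵥ ψ = 1 ∧ IsGroundStateInSector (quenchedCan L U t) (2 * n) 0 ψ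

/-- `P†P` preserves the `(N↑, N↓)` sectors. -/
theorem preservesSectors_pairField_conjTranspose_mul :
    PreservesSectors ((pF L)ᴴ * pF L) := by
  have hP : PairChirality.Shifts (-1) (-1) (pF L) :=
    PairChirality.Shifts.sum fun x _ => PairChirality.shifts_localPair L dWaveFormFactor x
  have h := (hP.conjTranspose).mul hP
  norm_num at h
  exact h.preservesSectors

/-- The quenched canonical Hamiltonian preserves the `(N↑, N↓)` sectors. -/
theorem preservesSectors_quenchedCan (U t : ℝ) : PreservesSectors (quenchedCan L U t) := by
  intro s s' hst
  have hH := LiebThm1.preservesSectors_hamiltonian (fermionTorusGraph 2 L) 1 U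
  have hP := preservesSectors_pairField_conjTranspose_mul L
  rw [quenchedCan, hubbardTorus, Matrix.sub_apply, Matrix.smul_apply, smul_eq_mul] at hst
  by_cases h1 : hamiltonian (fermionTorusGraph 2 L) 1 U s s' = 0
  · rw [h1, zero_sub, neg_ne_zero] at hst
    exact hP s s' (right_ne_zero_of_mul hst)
  · exact hH s s' h1

/-- The quenched canonical Hamiltonian is Hermitian. -/
theorem isHermitian_quenchedCan (U t : ℝ) : (quenchedCan L U t).IsHermitian := by
  unfold quenchedCan
  refine (LiebThm1.hamiltonian_isHermitian (fermionTorusGraph 2 L) 1 U).sub (Matrix.IsHermitian.smul ?_ ?_)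
  · exact Matrix.isHermitian_conjTranspose_mul_self _
  · rw [isSelfAdjoint_iff, Complex.star_def, Complex.conj_ofReal]

/-- **Discharge of the side obligation**: quenched sector ground states exist. -/
theorem quenchedSectorGSExists (U : ℝ) : QuenchedSectorGSExists U := by
  classical
  intro t L _ n hne
  obtain ⟨φ, hφ, hφ0⟩ := hne
  have hφ' : IsInSector n n φ := (mem_szSector_two_mul_zero_iff n φ).1 hφ
  have hp : ∃ s : Finset (Orb (FermionTorus 2 L)), (upPart s).card = n ∧ (downPart s).card = n := by
    by_contra h
    push Not at h
    exact hφ0 (funext fun s => hφ' s (fun hs => h s hs.1 hs.2))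
  have hinv : ∀ s s' : Finset (Orb (FermionTorus 2 L)), ¬((upPart s).card = n ∧ (downPart s).card = n) →
      ((upPart s').card = n ∧ (downPart s').card = n) → quenchedCan L U t s s' = 0 := by
    intro s s' hs hs'
    by_contra h
    have := preservesSectors_quenchedCan L U t s s' h
    exact hs ⟨this.1.trans hs'.1, this.2.trans hs'.2⟩
  obtain ⟨⟨v, hv, hv0, hHv⟩, -⟩ := sector_groundState (quenchedCan L U t) (isHermitian_quenchedCan L U t)
    (fun s => (upPart s).card = n ∧ (downPart s).card = n) hp hinv (szSector (2 * n) 0)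
    (fun v => mem_szSector_two_mul_zero_iff n v)
  obtain ⟨c, hc0, hc1⟩ := exists_smul_unit hv0
  exact ⟨c • v, hc1, isGroundStateInSector_smul ⟨hv, hv0, hHv⟩ hc0⟩

/-- The canonical gain inequality for a normalised sector ground state `ψ₁` of the quenched canonical model:
`(t/L²) Re⟨ψ₁, P†P ψ₁⟩ ≥ E₀(K_μ) - (E₁ - μN)`, `E₁` the sector energy (variational principle for `K_μ`, and
`N̂ ψ₁ = N ψ₁`). -/
theorem quenched_sector_gain (U μ t : ℝ) (N : ℕ) (ψ₁ : Fock (Orb (FermionTorus 2 L)))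
    (hψ₁ : IsGroundStateInSector (quenchedCan L U t) N 0 ψ₁) (h1 : star ψ₁ ⬝ᵥ ψ₁ = 1) :
    (hubbardTorusWith 2 L 1 U μ).groundEnergy - ((quenchedCan L U t).minEnergyOn (szSector N 0) - μ * N) ≤
      t / (L : ℝ) ^ 2 * (expect ((pF L)ᴴ * pF L) ψ₁).re := by
  have hK := Matrix.groundEnergy_le_rayleigh_holds (isHermitian_hubbardTorusWith L 1 U μ) ψ₁ h1
  have hN : (totalNumber : Matrix (ι L) (ι L) ℂ) *ᵥ ψ₁ = (N : ℂ) • ψ₁ :=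
    totalNumber_mulVec_of_isNParticle ((mem_szSector_iff N 0 ψ₁).1 hψ₁.1).1
  have hE : star ψ₁ ⬝ᵥ quenchedCan L U t *ᵥ ψ₁ = ((quenchedCan L U t).minEnergyOn (szSector N 0) : ℂ) := by
    rw [hψ₁.2.2, dotProduct_smul, h1, smul_eq_mul, mul_one]
  have hsplit : star ψ₁ ⬝ᵥ hubbardTorusWith 2 L 1 U μ *ᵥ ψ₁ =
      star ψ₁ ⬝ᵥ quenchedCan L U t *ᵥ ψ₁ - (μ : ℂ) * N + ((t / (L : ℝ) ^ 2 : ℝ) : ℂ) * expect ((pF L)ᴴ * pF L) ψ₁ := by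
    have e : hubbardTorusWith 2 L 1 U μ = quenchedCan L U t - (μ : ℂ) • totalNumber +
        ((t / (L : ℝ) ^ 2 : ℝ) : ℂ) • ((pF L)ᴴ * pF L) := by
      rw [quenchedCan, hubbardTorusWith_eq]; abel
    rw [e, Matrix.add_mulVec, Matrix.sub_mulVec, Matrix.smul_mulVec, Matrix.smul_mulVec, hN, dotProduct_add,
      dotProduct_sub, dotProduct_smul, dotProduct_smul, dotProduct_smul, h1, smul_eq_mul, smul_eq_mul, smul_eq_mul,
      mul_one, expect]
  have hre : (star ψ₁ ⬝ᵥ hubbardTorusWith 2 L 1 U μ *ᵥ ψ₁).re =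
      (quenchedCan L U t).minEnergyOn (szSector N 0) - μ * N + t / (L : ℝ) ^ 2 * (expect ((pF L)ᴴ * pF L) ψ₁).re := by
    rw [hsplit, hE]
    simp only [Complex.add_re, Complex.sub_re, Complex.ofReal_re, Complex.re_ofReal_mul, Complex.natCast_re]
  linarith

/-- A real power with positive exponent can be made small: for `C > 0`, `0 < p`, `0 < b` there is `t₁ > 0`
with `C * t ^ p ≤ b` for all `t ∈ (0, t₁]`. -/
theorem exists_rpow_small {C p b : ℝ} (hC : 0 < C) (hp : 0 < p) (hb : 0 < b) :
    ∃ t₁ : ℝ, 0 < t₁ ∧ ∀ t : ℝ, 0 < t → t ≤ t₁ → C * t ^ p ≤ b := by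
  refine ⟨(b / C) ^ (1 / p), Real.rpow_pos_of_pos (div_pos hb hC) _, fun t ht htle => ?_⟩
  have h1 : t ^ p ≤ ((b / C) ^ (1 / p)) ^ p := Real.rpow_le_rpow ht.le htle hp.le
  rw [← Real.rpow_mul (div_pos hb hC).le, one_div_mul_cancel hp.ne', Real.rpow_one] at h1
  calc C * t ^ p ≤ C * (b / C) := mul_le_mul_of_nonneg_left h1 hC.le
    _ = b := mul_div_cancel₀ b hC.ne'

/-- **The transfer glue, proved.** At fixed `(U, δ, μ)`: Koma–Tasaki `d`-wave order, seeded recentring,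
the Hölder corner and existence of quenched sector ground states imply the summit matrix at `(U, δ)`.
Constants: `η = 1/16`, recentring slack `ε = m²/8`, seed `t` small enough for `C t^{1-a} ≤ m²/8`, floor
`m²/2`. -/
theorem hasDWavePairFieldLROAt_of_transfer {U δ μ : ℝ} (hord : HasDWaveOrder U μ)
    (hR : SeededRecentring U δ μ) (hH : HolderCorner U δ) (hE : QuenchedSectorGSExists U) :
    HasDWavePairFieldLROAt U δ := by
  set m := dWaveOrderParameter U μ with hm_def
  have hm : 0 < m := (hasDWaveOrder_iff U μ).1 hord
  obtain ⟨C, a, tH, hC, ha, htH, hH⟩ := hH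
  obtain ⟨tR, htR, hR⟩ := hR (m ^ 2 / 8) (by positivity)
  obtain ⟨t₁, ht₁, hsmall⟩ := exists_rpow_small hC (sub_pos.2 ha) (show 0 < m ^ 2 / 8 by positivity)
  -- the seed
  set t : ℝ := min (min (tH / 2) (tR / 2)) t₁ with ht_def
  have ht0 : 0 < t := lt_min (lt_min (by linarith) (by linarith)) ht₁
  have htH' : t ∈ Set.Ioo 0 tH :=
    ⟨ht0, lt_of_le_of_lt ((min_le_left _ _).trans (min_le_left _ _)) (by linarith)⟩
  have htR' : t ∈ Set.Ioo 0 tR :=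
    ⟨ht0, lt_of_le_of_lt ((min_le_left _ _).trans (min_le_right _ _)) (by linarith)⟩
  have hCt : C * t ^ (1 - a) ≤ m ^ 2 / 8 := hsmall t ht0 (min_le_right _ _)
  obtain ⟨LH, hH⟩ := hH t htH'
  obtain ⟨LR, hR⟩ := hR t htR'
  obtain ⟨N, hN⟩ := quenchedGap_lower U μ hord (η := 1 / 16) (by norm_num) (by norm_num) ht0
  -- the admissible sequence
  intro Nseq ψ hadm
  refine evenLRO_of_eventually_le dWaveFormFactor ψ (a := m ^ 2 / 2) (by positivity)
    (Eventually.of_forall fun k => (hadm (2 * k + 1 + 1) ⟨k + 1, by ring⟩).2.1) ?_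
  refine eventually_atTop.2 ⟨max (max LH LR) N, fun k hk => ?_⟩
  have hkH : LH ≤ 2 * k + 1 + 1 := by omega
  have hkR : LR ≤ 2 * k + 1 + 1 := by omega
  have hkN : N ≤ 2 * k + 1 := by omega
  have heven : Even (2 * k + 1 + 1) := ⟨k + 1, by ring⟩
  obtain ⟨hNL, hnorm0, hGS0⟩ := hadm (2 * k + 1 + 1) heven
  set L := 2 * k + 1 + 1 with hL_def
  set nL := ⌊(1 - δ) * (L : ℝ) ^ 2 / 2⌋₊ with hnL_def
  rw [hNL] at hGS0
  -- a quenched sector ground state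
  obtain ⟨ψ₁, hnorm1, hGS1⟩ := hE t L nL ⟨ψ L, hGS0.1, hGS0.2.1⟩
  -- (1) gain from the order parameter, (2) recentring, (3) canonical gain inequality, (4) Hölder corner
  have h1 : t * ((L : ℕ) : ℝ) ^ 2 * (m ^ 2 * (1 - 4 * (1 / 16))) ≤
      (hubbardTorusWith 2 L 1 U μ).groundEnergy - (quenchedGC L U μ t).groundEnergy := hN (2 * k + 1) hkN
  have h2 := hR L hkR heven
  have h3 := quenched_sector_gain L U μ t (2 * nL) ψ₁ hGS1 hnorm1
  have h4 := hH L hkH heven (ψ L) ψ₁ hGS0 hnorm0 hGS1 hnorm1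
  have hLpos : (0 : ℝ) < ((L : ℕ) : ℝ) := by positivity
  -- lro ψ₁ ≥ m²·(3/4) - m²/8
  have hlro1 : m ^ 2 * (3 / 4) - m ^ 2 / 8 ≤ lro L ψ₁ := by
    have key : t * ((L : ℕ) : ℝ) ^ 2 * (m ^ 2 * (3 / 4) - m ^ 2 / 8) ≤ t * ((L : ℕ) : ℝ) ^ 2 * lro L ψ₁ := by
      have e : t * ((L : ℕ) : ℝ) ^ 2 * lro L ψ₁ = t / ((L : ℕ) : ℝ) ^ 2 * (expect ((pF L)ᴴ * pF L) ψ₁).re := by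
        unfold lro; field_simp
      rw [e]
      nlinarith
    exact le_of_mul_le_mul_left key (by positivity)
  -- lro (ψ L) ≥ m²/2, i.e. the floor on Re⟨P†P⟩
  have hlro0 : m ^ 2 / 2 ≤ lro L (ψ L) := by linarith
  unfold lro at hlro0
  rwa [le_div_iff₀ (by positivity)] at hlro0

/-- **The glue with the side obligation discharged**: order + recentring + Hölder corner ⇒ the summit
matrix at `(U, δ)`. -/
theorem hasDWavePairFieldLROAt_of_corner {U δ μ : ℝ} (hord : HasDWaveOrder U μ)
    (hR : SeededRecentring U δ μ) (hH : HolderCorner U δ) : HasDWavePairFieldLROAt U δ :=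
  hasDWavePairFieldLROAt_of_transfer hord hR hH (quenchedSectorGSExists U)

/-- Contrapositive, for the adversary: at any would-be counterexample to the crux (order, density matched or
not, but no LRO) one of the two transfer stubs is FALSE — the endpoint hazard of §4/§5 is carried entirely
by `SeededRecentring ∧ HolderCorner`. -/
theorem transfer_stub_false_at_counterexample {U δ μ : ℝ} (hord : HasDWaveOrder U μ)
    (hno : ¬ HasDWavePairFieldLROAt U δ) : ¬ (SeededRecentring U δ μ ∧ HolderCorner U δ) :=
  fun h => hno (hasDWavePairFieldLROAt_of_corner hord h.1 h.2)

/-- The transfer statements for all parameters (the card's `C⁺`). -/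
def Transfer : Prop :=
  ∃ U₀ : ℝ, 0 < U₀ ∧ ∀ U ∈ Ioo (0:ℝ) U₀, ∀ δ ∈ Ioo (0:ℝ) (1 / 2), ∀ μ : ℝ,
    DensityMatched U δ μ → HasDWaveOrder U μ → SeededRecentring U δ μ ∧ HolderCorner U δ

/-- **`crux_of_transfer`**: the quenched-corner line closes the crux from its two transfer stubs. -/
theorem crux_of_transfer (h : Transfer) : WcbcsSsbToTorusLRO := by
  obtain ⟨U₀, hU₀, h⟩ := h
  refine ⟨U₀, hU₀, fun U hU δ hδ μ hdm hord => ?_⟩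
  obtain ⟨hR, hH⟩ := h U hU δ hδ μ hdm hord
  exact hasDWavePairFieldLROAt_of_corner hord hR hH

/-- Swapped-quantifier transfer closes the SWAPPED crux (and hence the route, `closes_swapped`). -/
theorem cruxSwapped_of_transfer
    (h : ∀ δ ∈ Ioo (0:ℝ) (1 / 2), ∃ U₀ : ℝ, 0 < U₀ ∧ ∀ U ∈ Ioo (0:ℝ) U₀, ∀ μ : ℝ,
      DensityMatched U δ μ → HasDWaveOrder U μ → SeededRecentring U δ μ ∧ HolderCorner U δ) :
    CruxSwapped := by
  intro δ hδ
  obtain ⟨U₀, hU₀, h⟩ := h δ hδ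
  refine ⟨U₀, hU₀, fun U hU μ hdm hord => ?_⟩
  obtain ⟨hR, hH⟩ := h U hU μ hdm hord
  exact hasDWavePairFieldLROAt_of_corner hord hR hH

end IdeaLemmas

/-! ## §10 (gen 3) Supergradient monotonicity of the quenched every-GS pair order (finite `L`, proved)

For the number-conserving quenched family `Q_t = hubbardTorus 2 L 1 U - (t/L²)P†P` restricted to a sector
`(2n, S^z = 0)`, the sector energy `t ↦ E^{sec}(t)` is a minimum of affine functions, hence concave, and
`-L²·lro` of any sector ground state is a supergradient. Consequence (`lro_mono`): for seeds `t₁ < t₂`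
EVERY normalised sector ground state at `t₂` carries at least the pair order of EVERY normalised sector
ground state at `t₁` — two variational inequalities, no spectral theory. In particular (`t₁ = 0`): for
every `t > 0` the quenched sector ground states dominate the MAXIMUM of `lro` over the source-free sector
ground-state manifold. This is the lever behind §11. Also recorded: the uniform bound `lro φ ≤ B_d²`
(`lro_le_lroBound`, from the tree's `norm_pairField_le`) and `quenchedCan_zero`. -/

section CycleThree

open Matrix
open scoped Matrix.Norms.L2Operator

variable (L : ℕ) [NeZero L]

/-- At zero seed the quenched canonical Hamiltonian is the Hubbard Hamiltonian. -/
theorem quenchedCan_zero (U : ℝ) : quenchedCan L U 0 = hubbardTorus 2 L 1 U := by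
  simp [quenchedCan]

/-- The quenched quadratic form: `Re⟨φ, Q_t φ⟩ = Re⟨φ, H φ⟩ - t·L²·lro φ`. -/
theorem re_quenchedCan_form (U t : ℝ) (Φ : Fock (Orb (FermionTorus 2 L))) :
    (star Φ ⬝ᵥ quenchedCan L U t *ᵥ Φ).re =
      (star Φ ⬝ᵥ hubbardTorus 2 L 1 U *ᵥ Φ).re - t * (L : ℝ) ^ 2 * lro L Φ := by
  have hL : (0 : ℝ) < (L : ℝ) := Nat.cast_pos.2 (Nat.pos_of_ne_zero (NeZero.ne L))
  have hsplit : star Φ ⬝ᵥ hubbardTorus 2 L 1 U *ᵥ Φ =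
      star Φ ⬝ᵥ quenchedCan L U t *ᵥ Φ + ((t / (L : ℝ) ^ 2 : ℝ) : ℂ) * expect ((pF L)ᴴ * pF L) Φ := by
    rw [quenchedCan, Matrix.sub_mulVec, Matrix.smul_mulVec, dotProduct_sub, dotProduct_smul, smul_eq_mul,
      expect]
    ring
  have hre : (star Φ ⬝ᵥ hubbardTorus 2 L 1 U *ᵥ Φ).re =
      (star Φ ⬝ᵥ quenchedCan L U t *ᵥ Φ).re + t / (L : ℝ) ^ 2 * (expect ((pF L)ᴴ * pF L) Φ).re := by
    rw [hsplit, Complex.add_re, Complex.re_ofReal_mul]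
  have hlro : t * (L : ℝ) ^ 2 * lro L Φ = t / (L : ℝ) ^ 2 * (expect ((pF L)ᴴ * pF L) Φ).re := by
    unfold lro
    field_simp
  linarith

/-- The a priori bound `B_d² = (2 Σ_e |d(e)/√2|)²` on the pair-order density of a unit vector. -/
def lroBound : ℝ :=
  (2 * ∑ e ∈ insert (0 : Literature.Probability.LatticeModels.Site 2)
    Literature.MathematicalPhysics.QuantumLattice.unitSteps, |dWaveFormFactor e / Real.sqrt 2|) ^ 2

omit [NeZero L] in
theorem lroBound_nonneg : 0 ≤ lroBound := sq_nonneg _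

/-- `lro φ ≤ B_d²` for every unit vector (operator norm `‖P‖ ≤ B_d L²`, tree `norm_pairField_le`). -/
theorem lro_le_lroBound (φ : Fock (Orb (FermionTorus 2 L))) (hφ : star φ ⬝ᵥ φ = 1) :
    lro L φ ≤ lroBound := by
  have hL : (0 : ℝ) < (L : ℝ) := Nat.cast_pos.2 (Nat.pos_of_ne_zero (NeZero.ne L))
  have hL4 : (0 : ℝ) < (L : ℝ) ^ 4 := by positivity
  have hre : (expect ((pF L)ᴴ * pF L) φ).re = eucNorm (pF L *ᵥ φ) ^ 2 := by
    rw [PosSemidefTrace.expect_conjTranspose_mul, ← eucNorm_sq]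
  have h1 : eucNorm (pF L *ᵥ φ) ≤
      (2 * ∑ e ∈ insert (0 : Literature.Probability.LatticeModels.Site 2)
        Literature.MathematicalPhysics.QuantumLattice.unitSteps, |dWaveFormFactor e / Real.sqrt 2|) * (L : ℝ) ^ 2 :=
    calc eucNorm (pF L *ᵥ φ) ≤ ‖pF L‖ * eucNorm φ := eucNorm_mulVec_le _ _
      _ = ‖pF L‖ := by rw [eucNorm_eq_one hφ, mul_one]
      _ ≤ _ := norm_pairField_le dWaveFormFactor L
  unfold lro
  rw [div_le_iff₀ hL4, hre]
  calc eucNorm (pF L *ᵥ φ) ^ 2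
      ≤ ((2 * ∑ e ∈ insert (0 : Literature.Probability.LatticeModels.Site 2)
          Literature.MathematicalPhysics.QuantumLattice.unitSteps, |dWaveFormFactor e / Real.sqrt 2|) *
          (L : ℝ) ^ 2) ^ 2 := pow_le_pow_left₀ (eucNorm_nonneg _) h1 2
    _ = lroBound * (L : ℝ) ^ 4 := by rw [lroBound]; ring

/-- The variational principle in the sector `(2n, S^z = 0)` for the quenched canonical Hamiltonian
(second half of the tree's `sector_groundState`; the block structure is `preservesSectors_quenchedCan`). -/
theorem quenched_sector_variational (U t : ℝ) (n : ℕ)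
    (hne : ∃ φ : Fock (Orb (FermionTorus 2 L)), φ ∈ szSector (2 * n) 0 ∧ φ ≠ 0)
    (v : Fock (Orb (FermionTorus 2 L))) (hv : v ∈ szSector (2 * n) 0) (hv1 : star v ⬝ᵥ v = 1) :
    (quenchedCan L U t).minEnergyOn (szSector (2 * n) 0) ≤ (star v ⬝ᵥ quenchedCan L U t *ᵥ v).re := by
  classical
  obtain ⟨φ, hφ, hφ0⟩ := hne
  have hφ' : IsInSector n n φ := (mem_szSector_two_mul_zero_iff n φ).1 hφ
  have hp : ∃ s : Finset (Orb (FermionTorus 2 L)), (upPart s).card = n ∧ (downPart s).card = n := by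
    by_contra h
    push Not at h
    exact hφ0 (funext fun s => hφ' s (fun hs => h s hs.1 hs.2))
  have hinv : ∀ s s' : Finset (Orb (FermionTorus 2 L)), ¬((upPart s).card = n ∧ (downPart s).card = n) →
      ((upPart s').card = n ∧ (downPart s').card = n) → quenchedCan L U t s s' = 0 := by
    intro s s' hs hs'
    by_contra h
    have := preservesSectors_quenchedCan L U t s s' h
    exact hs ⟨this.1.trans hs'.1, this.2.trans hs'.2⟩
  exact (sector_groundState (quenchedCan L U t) (isHermitian_quenchedCan L U t)
    (fun s => (upPart s).card = n ∧ (downPart s).card = n) hp hinv (szSector (2 * n) 0)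
    (fun v => mem_szSector_two_mul_zero_iff n v)).2 v hv hv1

/-- For a normalised sector ground state the quadratic form is the sector energy. -/
theorem re_form_eq_minEnergyOn {U t : ℝ} {n : ℕ} {ψ : Fock (Orb (FermionTorus 2 L))}
    (h : IsGroundStateInSector (quenchedCan L U t) (2 * n) 0 ψ) (hn : star ψ ⬝ᵥ ψ = 1) :
    (star ψ ⬝ᵥ quenchedCan L U t *ᵥ ψ).re = (quenchedCan L U t).minEnergyOn (szSector (2 * n) 0) := by
  rw [h.2.2, dotProduct_smul, hn]
  simp

/-- **Supergradient monotonicity** (finite `L`): for seeds `t₁ < t₂`, every normalised sector ground state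
at `t₂` has at least the pair order of every normalised sector ground state at `t₁`. Proof: add the two
variational inequalities `E(t₁) ≤ ⟨ψ₂, Q_{t₁} ψ₂⟩`, `E(t₂) ≤ ⟨ψ₁, Q_{t₂} ψ₁⟩`. -/
theorem lro_mono {U t₁ t₂ : ℝ} (ht : t₁ < t₂) {n : ℕ} {ψ₁ ψ₂ : Fock (Orb (FermionTorus 2 L))}
    (h₁ : IsGroundStateInSector (quenchedCan L U t₁) (2 * n) 0 ψ₁) (h₁n : star ψ₁ ⬝ᵥ ψ₁ = 1)
    (h₂ : IsGroundStateInSector (quenchedCan L U t₂) (2 * n) 0 ψ₂) (h₂n : star ψ₂ ⬝ᵥ ψ₂ = 1) :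
    lro L ψ₁ ≤ lro L ψ₂ := by
  have hL : (0 : ℝ) < (L : ℝ) := Nat.cast_pos.2 (Nat.pos_of_ne_zero (NeZero.ne L))
  have hL2 : (0 : ℝ) < (L : ℝ) ^ 2 := by positivity
  have hne : ∃ φ : Fock (Orb (FermionTorus 2 L)), φ ∈ szSector (2 * n) 0 ∧ φ ≠ 0 := ⟨ψ₁, h₁.1, h₁.2.1⟩
  have hv₁ := quenched_sector_variational L U t₁ n hne ψ₂ h₂.1 h₂n
  have hv₂ := quenched_sector_variational L U t₂ n hne ψ₁ h₁.1 h₁n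
  rw [← re_form_eq_minEnergyOn L h₁ h₁n] at hv₁
  rw [← re_form_eq_minEnergyOn L h₂ h₂n] at hv₂
  rw [re_quenchedCan_form, re_quenchedCan_form] at hv₁ hv₂
  by_contra hlt
  push Not at hlt
  have hpos : 0 < (t₂ - t₁) * ((L : ℝ) ^ 2 * (lro L ψ₁ - lro L ψ₂)) :=
    mul_pos (sub_pos.2 ht) (mul_pos hL2 (sub_pos.2 hlt))
  nlinarith [hv₁, hv₂, hpos]

/-- Special case `t₁ = 0`: for every `t > 0`, every quenched sector ground state dominates every
source-free sector ground state in pair order. -/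
theorem lro_groundState_le_quenched {U t : ℝ} (ht : 0 < t) {n : ℕ} {ψ₀ ψ₁ : Fock (Orb (FermionTorus 2 L))}
    (h₀ : IsGroundStateInSector (hubbardTorus 2 L 1 U) (2 * n) 0 ψ₀) (h₀n : star ψ₀ ⬝ᵥ ψ₀ = 1)
    (h₁ : IsGroundStateInSector (quenchedCan L U t) (2 * n) 0 ψ₁) (h₁n : star ψ₁ ⬝ᵥ ψ₁ = 1) :
    lro L ψ₀ ≤ lro L ψ₁ := by
  rw [← quenchedCan_zero L U] at h₀
  exact lro_mono L ht h₀ h₀n h₁ h₁n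

/-! ## §11 (gen 3) `HolderCorner` dissected: the Hölder rate is decoration; what remains is
pair-order RIGIDITY of the source-free ground states plus no jump of the quenched order at `t = 0⁺`

Two findings, both theorems.
(1) HYPOTHESIS MUTATION — `CornerModulus`: the glue `hasDWavePairFieldLROAt_of_transfer` uses `HolderCorner`
at ONE seed `t` with `C t^{1-a} ≤ m²/8`; so the power law is not load-bearing. `CornerModulus U δ` (right
upper-semicontinuity at `t = 0⁺`, uniformly in even `L`, of the every-GS quenched pair order relative to every
source-free sector ground state) is implied by `HolderCorner` and STILL closes the crux with `SeededRecentring`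
(`hasDWavePairFieldLROAt_of_modulus`, `crux_of_transferModulus`). Leads should file the weaker stub.
(2) NECESSARY CONDITION — `PairOrderRigidity`: by §10, for `t > 0` every quenched sector ground state has
`lro ≥ max_{GS(0)} lro`, so `CornerModulus` (a fortiori `HolderCorner`) forces the `lro`-SPREAD over the
source-free `(N_L, S^z=0)` ground-state manifold of `hubbardTorus 2 L 1 U` to vanish as `L → ∞` along even sides
(`pairOrderRigidity_of_cornerModulus`). This is a statement about the pure, source-free, canonical Hubbard
model alone: asymptotically ALL sector ground states have the same `d`-wave pair-order density. It is exactly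
the "every ground state" content of the summit matrix (only ACCIDENTAL same-sector degeneracy with an
order-poor partner violates it, cf. gen-1's Schur remark), now isolated as a sub-stub of the corner. ADVERSARY
READING: the corner stub carries BOTH hazards of the crux — the first-order endpoint (a `t = 0⁺` JUMP of the
quenched order, §4/§5) and the every-GS hazard (rigidity) — and nothing else is hidden in it: modulo rigidity,
`CornerModulus` is the statement that `t ↦ limsup_L sup_{GS(t)} lro` (non-decreasing by §10) is right-continuous
at `0`. -/

/-- **Pair-order rigidity** of the source-free sector ground states at `(U, δ)`: along even sides, the spread
of `lro` over the normalised ground states of `hubbardTorus 2 L 1 U` in the sector `(N_L, S^z = 0)` tends to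
`0`. -/
def PairOrderRigidity (U δ : ℝ) : Prop :=
  ∀ ε : ℝ, 0 < ε → ∃ L₀ : ℕ, ∀ (L : ℕ) [NeZero L], L₀ ≤ L → Even L →
    ∀ ψ ψ' : Fock (Orb (FermionTorus 2 L)),
      IsGroundStateInSector (hubbardTorus 2 L 1 U) (2 * ⌊(1 - δ) * (L : ℝ) ^ 2 / 2⌋₊) 0 ψ →
      star ψ ⬝ᵥ ψ = 1 →
      IsGroundStateInSector (hubbardTorus 2 L 1 U) (2 * ⌊(1 - δ) * (L : ℝ) ^ 2 / 2⌋₊) 0 ψ' →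
      star ψ' ⬝ᵥ ψ' = 1 →
        lro L ψ' - lro L ψ ≤ ε

/-- **Corner modulus** (the weakened corner stub): right upper-semicontinuity at `t = 0⁺`, uniformly in even
`L`, of the every-GS quenched pair order relative to every source-free sector ground state. -/
def CornerModulus (U δ : ℝ) : Prop :=
  ∀ η : ℝ, 0 < η → ∃ t₁ : ℝ, 0 < t₁ ∧ ∀ t ∈ Set.Ioo (0 : ℝ) t₁, ∃ L₀ : ℕ,
    ∀ (L : ℕ) [NeZero L], L₀ ≤ L → Even L →
      ∀ ψ₀ ψ₁ : Fock (Orb (FermionTorus 2 L)),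
        IsGroundStateInSector (hubbardTorus 2 L 1 U) (2 * ⌊(1 - δ) * (L : ℝ) ^ 2 / 2⌋₊) 0 ψ₀ →
        star ψ₀ ⬝ᵥ ψ₀ = 1 →
        IsGroundStateInSector (quenchedCan L U t) (2 * ⌊(1 - δ) * (L : ℝ) ^ 2 / 2⌋₊) 0 ψ₁ →
        star ψ₁ ⬝ᵥ ψ₁ = 1 →
          lro L ψ₁ - lro L ψ₀ ≤ η

omit [NeZero L] in
/-- The Hölder rate is decoration: `HolderCorner ⇒ CornerModulus`. -/
theorem cornerModulus_of_holderCorner {U δ : ℝ} (hH : HolderCorner U δ) : CornerModulus U δ := by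
  intro η hη
  obtain ⟨C, a, t₀, hC, ha, ht₀, hH⟩ := hH
  obtain ⟨t₁, ht₁, hsmall⟩ := exists_rpow_small hC (sub_pos.2 ha) hη
  refine ⟨min t₀ t₁, lt_min ht₀ ht₁, fun t ht => ?_⟩
  obtain ⟨L₀, hL₀⟩ := hH t ⟨ht.1, lt_of_lt_of_le ht.2 (min_le_left _ _)⟩
  refine ⟨L₀, fun L _ hL hev ψ₀ ψ₁ h0 h0n h1 h1n => ?_⟩
  have h := hL₀ L hL hev ψ₀ ψ₁ h0 h0n h1 h1n
  have hCt : C * t ^ (1 - a) ≤ η := hsmall t ht.1 (le_of_lt (lt_of_lt_of_le ht.2 (min_le_right _ _)))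
  linarith

omit [NeZero L] in
/-- **The corner forces rigidity**: `CornerModulus U δ → PairOrderRigidity U δ` (hence also from
`HolderCorner`). Proof: at a small seed `t`, a quenched sector ground state `ψ₁` exists
(`quenchedSectorGSExists`), dominates `ψ'` in pair order (§10), and exceeds `ψ` by at most `ε` (corner). -/
theorem pairOrderRigidity_of_cornerModulus {U δ : ℝ} (hM : CornerModulus U δ) : PairOrderRigidity U δ := by
  intro ε hε
  obtain ⟨t₁, ht₁, hM⟩ := hM ε hε
  have ht : t₁ / 2 ∈ Set.Ioo 0 t₁ := ⟨by linarith, by linarith⟩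
  obtain ⟨L₀, hL₀⟩ := hM (t₁ / 2) ht
  refine ⟨L₀, fun L _ hL hev ψ ψ' hψ hψn hψ' hψ'n => ?_⟩
  obtain ⟨ψ₁, hψ₁n, hψ₁⟩ := quenchedSectorGSExists U (t₁ / 2) L _ ⟨ψ, hψ.1, hψ.2.1⟩
  have hmono := lro_groundState_le_quenched L ht.1 hψ' hψ'n hψ₁ hψ₁n
  have hcorner := hL₀ L hL hev ψ ψ₁ hψ hψn hψ₁ hψ₁n
  linarith

omit [NeZero L] in
theorem pairOrderRigidity_of_holderCorner {U δ : ℝ} (hH : HolderCorner U δ) : PairOrderRigidity U δ :=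
  pairOrderRigidity_of_cornerModulus (cornerModulus_of_holderCorner hH)

omit [NeZero L] in
/-- **The glue with the weakened corner stub**: order + recentring + corner modulus (+ the discharged
existence of quenched sector ground states) ⇒ the summit matrix at `(U, δ)`. Same constants as
`hasDWavePairFieldLROAt_of_transfer` (`η = 1/16`, slack `m²/8`, floor `m²/2`). -/
theorem hasDWavePairFieldLROAt_of_modulus {U δ μ : ℝ} (hord : HasDWaveOrder U μ)
    (hR : SeededRecentring U δ μ) (hM : CornerModulus U δ) :
    HasDWavePairFieldLROAt U δ := by
  have hE : QuenchedSectorGSExists U := quenchedSectorGSExists U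
  set m := dWaveOrderParameter U μ with hm_def
  have hm : 0 < m := (hasDWaveOrder_iff U μ).1 hord
  obtain ⟨tH, htH, hH⟩ := hM (m ^ 2 / 8) (by positivity)
  obtain ⟨tR, htR, hR⟩ := hR (m ^ 2 / 8) (by positivity)
  -- the seed
  set t : ℝ := min (tH / 2) (tR / 2) with ht_def
  have ht0 : 0 < t := lt_min (by linarith) (by linarith)
  have htH' : t ∈ Set.Ioo 0 tH := ⟨ht0, lt_of_le_of_lt (min_le_left _ _) (by linarith)⟩
  have htR' : t ∈ Set.Ioo 0 tR := ⟨ht0, lt_of_le_of_lt (min_le_right _ _) (by linarith)⟩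
  obtain ⟨LH, hH⟩ := hH t htH'
  obtain ⟨LR, hR⟩ := hR t htR'
  obtain ⟨N, hN⟩ := quenchedGap_lower U μ hord (η := 1 / 16) (by norm_num) (by norm_num) ht0
  -- the admissible sequence
  intro Nseq ψ hadm
  refine evenLRO_of_eventually_le dWaveFormFactor ψ (a := m ^ 2 / 2) (by positivity)
    (Eventually.of_forall fun k => (hadm (2 * k + 1 + 1) ⟨k + 1, by ring⟩).2.1) ?_
  refine eventually_atTop.2 ⟨max (max LH LR) N, fun k hk => ?_⟩
  have hkH : LH ≤ 2 * k + 1 + 1 := by omega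
  have hkR : LR ≤ 2 * k + 1 + 1 := by omega
  have hkN : N ≤ 2 * k + 1 := by omega
  have heven : Even (2 * k + 1 + 1) := ⟨k + 1, by ring⟩
  obtain ⟨hNL, hnorm0, hGS0⟩ := hadm (2 * k + 1 + 1) heven
  set L := 2 * k + 1 + 1 with hL_def
  set nL := ⌊(1 - δ) * (L : ℝ) ^ 2 / 2⌋₊ with hnL_def
  rw [hNL] at hGS0
  obtain ⟨ψ₁, hnorm1, hGS1⟩ := hE t L nL ⟨ψ L, hGS0.1, hGS0.2.1⟩
  have h1 : t * ((L : ℕ) : ℝ) ^ 2 * (m ^ 2 * (1 - 4 * (1 / 16))) ≤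
      (hubbardTorusWith 2 L 1 U μ).groundEnergy - (quenchedGC L U μ t).groundEnergy := hN (2 * k + 1) hkN
  have h2 := hR L hkR heven
  have h3 := quenched_sector_gain L U μ t (2 * nL) ψ₁ hGS1 hnorm1
  have h4 := hH L hkH heven (ψ L) ψ₁ hGS0 hnorm0 hGS1 hnorm1
  have hLpos : (0 : ℝ) < ((L : ℕ) : ℝ) := by positivity
  have hlro1 : m ^ 2 * (3 / 4) - m ^ 2 / 8 ≤ lro L ψ₁ := by
    have key : t * ((L : ℕ) : ℝ) ^ 2 * (m ^ 2 * (3 / 4) - m ^ 2 / 8) ≤ t * ((L : ℕ) : ℝ) ^ 2 * lro L ψ₁ := by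
      have e : t * ((L : ℕ) : ℝ) ^ 2 * lro L ψ₁ = t / ((L : ℕ) : ℝ) ^ 2 * (expect ((pF L)ᴴ * pF L) ψ₁).re := by
        unfold lro; field_simp
      rw [e]
      nlinarith
    exact le_of_mul_le_mul_left key (by positivity)
  have hlro0 : m ^ 2 / 2 ≤ lro L (ψ L) := by linarith
  unfold lro at hlro0
  rwa [le_div_iff₀ (by positivity)] at hlro0

/-- The transfer with the weakened corner stub. -/
def TransferModulus : Prop :=
  ∃ U₀ : ℝ, 0 < U₀ ∧ ∀ U ∈ Ioo (0:ℝ) U₀, ∀ δ ∈ Ioo (0:ℝ) (1 / 2), ∀ μ : ℝ,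
    DensityMatched U δ μ → HasDWaveOrder U μ → SeededRecentring U δ μ ∧ CornerModulus U δ

omit [NeZero L] in
theorem transferModulus_of_transfer (h : Transfer) : TransferModulus := by
  obtain ⟨U₀, hU₀, h⟩ := h
  refine ⟨U₀, hU₀, fun U hU δ hδ μ hdm hord => ?_⟩
  obtain ⟨hR, hH⟩ := h U hU δ hδ μ hdm hord
  exact ⟨hR, cornerModulus_of_holderCorner hH⟩

omit [NeZero L] in
/-- **`crux_of_transferModulus`**: the quenched-corner line closes the crux from `SeededRecentring` and the
WEAKER corner stub `CornerModulus`. -/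
theorem crux_of_transferModulus (h : TransferModulus) : WcbcsSsbToTorusLRO := by
  obtain ⟨U₀, hU₀, h⟩ := h
  refine ⟨U₀, hU₀, fun U hU δ hδ μ hdm hord => ?_⟩
  obtain ⟨hR, hM⟩ := h U hU δ hδ μ hdm hord
  exact hasDWavePairFieldLROAt_of_modulus hord hR hM

omit [NeZero L] in
/-- Swapped-quantifier version (closes `CruxSwapped`, hence the route by `closes_swapped`). -/
theorem cruxSwapped_of_transferModulus
    (h : ∀ δ ∈ Ioo (0:ℝ) (1 / 2), ∃ U₀ : ℝ, 0 < U₀ ∧ ∀ U ∈ Ioo (0:ℝ) U₀, ∀ μ : ℝ,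
      DensityMatched U δ μ → HasDWaveOrder U μ → SeededRecentring U δ μ ∧ CornerModulus U δ) :
    CruxSwapped := by
  intro δ hδ
  obtain ⟨U₀, hU₀, h⟩ := h δ hδ
  refine ⟨U₀, hU₀, fun U hU μ hdm hord => ?_⟩
  obtain ⟨hR, hM⟩ := h U hU μ hdm hord
  exact hasDWavePairFieldLROAt_of_modulus hord hR hM

omit [NeZero L] in
/-- Contrapositive for the adversary: at a would-be counterexample (order, no LRO) EITHER recentring OR the
corner modulus fails; and if the corner modulus holds, rigidity holds too — so a counterexample with rigid,
order-carrying source-free ground states must break `SeededRecentring` (the canonical/GC step, §12). -/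
theorem modulus_stub_false_at_counterexample {U δ μ : ℝ} (hord : HasDWaveOrder U μ)
    (hno : ¬ HasDWavePairFieldLROAt U δ) : ¬ SeededRecentring U δ μ ∨ ¬ CornerModulus U δ := by
  by_contra h
  push Not at h
  exact hno (hasDWavePairFieldLROAt_of_modulus hord h.1 h.2)

/-! ## §12 (gen 3) `SeededRecentring` dissected: it contains canonical/grand-canonical equivalence at
`(δ, μ)` for the SOURCE-FREE model

`SeededRecentring U δ μ` bounds `E^{sec}_t(N_L) - μN_L - E₀(Q^{GC}_{μ,t})` by `ε t L²` for small seeds `t`.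
Letting `t → 0⁺` through the variational bounds `E^{sec}_0 ≤ E^{sec}_t + tL²B_d²` (§10) and
`E₀(Q^{GC}_{μ,t}) ≤ E₀(K_μ)` gives (`canonicalGCEquivalence_of_seededRecentring`): the canonical sector energy
of `hubbardTorus 2 L 1 U` at `N_L = 2⌊(1-δ)L²/2⌋`, shifted by `-μN_L`, lies within `o(L²)` of the
grand-canonical ground energy `E₀(K_μ)` along even `L`. Consequences. (i) As a bare `Prop` in `μ`,
`SeededRecentring U δ μ` is FALSE at every `μ` that is not a thermodynamic chemical potential of the density
`1 - δ` — e.g. outside the band, where `E₀(K_μ) ≤ (U - 2μ)L²` (filled torus) while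
`E^{sec}(N_L) - μN_L ≥ -(8 + μ(1-δ))L²` — so a skeleton must state it UNDER `DensityMatched U δ μ` (as
`Transfer` does) or with `μ` supplied by crux 4; (ii) even under density matching, the `o(L²)` equivalence is an
honest piece of thermodynamic-limit work (existence and strict convexity of the canonical energy density at
`1 - δ`, plus control of the tracial average over degenerate GC ground sectors) that no tree theorem provides;
(iii) at a first-order endpoint `μ_c` the equivalence holds for the finite-size WINNER's density only — the
§4/§5 hazard enters `SeededRecentring` through exactly this door. -/

/-- One finite-`L` step: the source-free canonical/GC gap is controlled by the quenched one plus `tL²B_d²`. -/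
theorem canonical_gc_gap_step (U μ t : ℝ) (ht : 0 ≤ t) (n : ℕ)
    (hne : ∃ φ : Fock (Orb (FermionTorus 2 L)), φ ∈ szSector (2 * n) 0 ∧ φ ≠ 0) :
    (hubbardTorus 2 L 1 U).minEnergyOn (szSector (2 * n) 0) - (hubbardTorusWith 2 L 1 U μ).groundEnergy ≤
      (quenchedCan L U t).minEnergyOn (szSector (2 * n) 0) - (quenchedGC L U μ t).groundEnergy +
        t * (L : ℝ) ^ 2 * lroBound := by
  have hL : (0 : ℝ) < (L : ℝ) := Nat.cast_pos.2 (Nat.pos_of_ne_zero (NeZero.ne L))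
  obtain ⟨ψ₁, hψ₁n, hψ₁⟩ := quenchedSectorGSExists U t L n hne
  -- (1) sector variational principle for `H = Q_0` at `ψ₁`
  have h1 : (hubbardTorus 2 L 1 U).minEnergyOn (szSector (2 * n) 0) ≤
      (star ψ₁ ⬝ᵥ hubbardTorus 2 L 1 U *ᵥ ψ₁).re := by
    have := quenched_sector_variational L U 0 n hne ψ₁ hψ₁.1 hψ₁n
    rwa [quenchedCan_zero] at this
  -- (2) `⟨ψ₁, H ψ₁⟩ = E^{sec}_t + t L² lro ψ₁ ≤ E^{sec}_t + t L² B`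
  have h2 : (star ψ₁ ⬝ᵥ hubbardTorus 2 L 1 U *ᵥ ψ₁).re =
      (quenchedCan L U t).minEnergyOn (szSector (2 * n) 0) + t * (L : ℝ) ^ 2 * lro L ψ₁ := by
    have := re_quenchedCan_form L U t ψ₁
    rw [re_form_eq_minEnergyOn L hψ₁ hψ₁n] at this
    linarith
  have h2' : t * (L : ℝ) ^ 2 * lro L ψ₁ ≤ t * (L : ℝ) ^ 2 * lroBound :=
    mul_le_mul_of_nonneg_left (lro_le_lroBound L ψ₁ hψ₁n) (by positivity)
  -- (3) `E₀(Q^{GC}_t) ≤ E₀(K_μ)`: the tracial ground state of `K_μ` is a trial state for `Q^{GC}_t`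
  have h3 : (quenchedGC L U μ t).groundEnergy ≤ (hubbardTorusWith 2 L 1 U μ).groundEnergy := by
    have hKH := isHermitian_hubbardTorusWith L 1 U μ
    have hQH := isHermitian_quenchedGC L U μ t
    have htrial := Matrix.groundEnergy_le_groundStateFunctional_re hKH hQH
    have hsplit : (hubbardTorusWith 2 L 1 U μ).groundStateFunctional (quenchedGC L U μ t) =
        (hubbardTorusWith 2 L 1 U μ).groundEnergy -
          ((t / (L : ℝ) ^ 2 : ℝ) : ℂ) * (hubbardTorusWith 2 L 1 U μ).groundStateFunctional ((pF L)ᴴ * pF L) := by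
      rw [quenchedGC, map_sub, map_smul, Matrix.groundStateFunctional_hamiltonian hKH, smul_eq_mul]
    have hnn := Matrix.groundStateFunctional_nonneg (hubbardTorusWith 2 L 1 U μ) (pF L)
    obtain ⟨hre, -⟩ := Complex.nonneg_iff.mp hnn
    rw [hsplit] at htrial
    simp only [Complex.sub_re, Complex.ofReal_re, Complex.re_ofReal_mul] at htrial
    have : 0 ≤ t / (L : ℝ) ^ 2 * ((hubbardTorusWith 2 L 1 U μ).groundStateFunctional ((pF L)ᴴ * pF L)).re :=
      mul_nonneg (div_nonneg ht (sq_nonneg _)) (by simpa using hre)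
    linarith
  linarith

/-- Canonical/grand-canonical equivalence at `(δ, μ)` in the source-free model, at resolution `o(L²)` along
even sides (stated for sides where the sector is non-empty, which is automatic for the sides that matter). -/
def CanonicalGCEquivalence (U δ μ : ℝ) : Prop :=
  ∀ ε : ℝ, 0 < ε → ∃ L₀ : ℕ, ∀ (L : ℕ) [NeZero L], L₀ ≤ L → Even L →
    (∃ φ : Fock (Orb (FermionTorus 2 L)), φ ∈ szSector (2 * ⌊(1 - δ) * (L : ℝ) ^ 2 / 2⌋₊) 0 ∧ φ ≠ 0) →
      (hubbardTorus 2 L 1 U).minEnergyOn (szSector (2 * ⌊(1 - δ) * (L : ℝ) ^ 2 / 2⌋₊) 0) -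
          μ * ((2 * ⌊(1 - δ) * (L : ℝ) ^ 2 / 2⌋₊ : ℕ) : ℝ) - (hubbardTorusWith 2 L 1 U μ).groundEnergy ≤
        ε * (L : ℝ) ^ 2

omit [NeZero L] in
/-- **`SeededRecentring ⇒ CanonicalGCEquivalence`** (the recentring stub pins `μ` to the thermodynamic chemical
potential of the density `1 - δ` and asserts `o(L²)` equivalence of ensembles for the source-free model). -/
theorem canonicalGCEquivalence_of_seededRecentring {U δ μ : ℝ} (hR : SeededRecentring U δ μ) :
    CanonicalGCEquivalence U δ μ := by
  intro ε hε
  obtain ⟨t₀, ht₀, hR⟩ := hR 1 one_pos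
  have hB : 0 ≤ lroBound := lroBound_nonneg
  set t : ℝ := min (t₀ / 2) (ε / (1 + lroBound)) with ht_def
  have ht0 : 0 < t := lt_min (by linarith) (div_pos hε (by linarith))
  have htI : t ∈ Set.Ioo 0 t₀ := ⟨ht0, lt_of_le_of_lt (min_le_left _ _) (by linarith)⟩
  have htε : t * (1 + lroBound) ≤ ε := by
    have : t ≤ ε / (1 + lroBound) := min_le_right _ _
    rwa [le_div_iff₀ (by linarith)] at this
  obtain ⟨L₀, hL₀⟩ := hR t htI
  refine ⟨L₀, fun L _ hL hev hne => ?_⟩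
  have hstep := canonical_gc_gap_step L U μ t ht0.le _ hne
  have h4 := hL₀ L hL hev
  have hL2 : 0 ≤ (L : ℝ) ^ 2 := sq_nonneg _
  have htε' : t * (1 + lroBound) * (L : ℝ) ^ 2 ≤ ε * (L : ℝ) ^ 2 := mul_le_mul_of_nonneg_right htε hL2
  nlinarith [hstep, h4, htε', hL2]

omit [NeZero L] in
/-- Hence the transfer stubs of the quenched-corner line (in either form) contain `CanonicalGCEquivalence` at
every density-matched, ordered parameter — the canonical/GC step is not avoided, only moved. -/
theorem transferModulus_imp_equivalence (h : TransferModulus) :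
    ∃ U₀ : ℝ, 0 < U₀ ∧ ∀ U ∈ Ioo (0:ℝ) U₀, ∀ δ ∈ Ioo (0:ℝ) (1 / 2), ∀ μ : ℝ,
      DensityMatched U δ μ → HasDWaveOrder U μ → CanonicalGCEquivalence U δ μ ∧ PairOrderRigidity U δ := by
  obtain ⟨U₀, hU₀, h⟩ := h
  refine ⟨U₀, hU₀, fun U hU δ hδ μ hdm hord => ?_⟩
  obtain ⟨hR, hM⟩ := h U hU δ hδ μ hdm hord
  exact ⟨canonicalGCEquivalence_of_seededRecentring hR, pairOrderRigidity_of_cornerModulus hM⟩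

/-! ### §12b (gen 3) A `_false_without_` theorem: the recentring stub is FALSE off the thermodynamic chemical
potential

For `μ ≤ -70` (any `|U| ≤ 1`, `δ ∈ (0, 1/2)`) the source-free canonical/GC gap exceeds `L²` on every even side
`L ≥ 4`, so `CanonicalGCEquivalence U δ μ` and hence `SeededRecentring U δ μ` FAIL
(`seededRecentring_false_without_densityMatching`). Hence any skeleton must carry `DensityMatched U δ μ` (or
crux 4's `μ`) INTO the recentring stub: "any proof must use density matching", in the only form available for
this crux (cf. §3: no `_false_without_` theorem exists for the crux itself). Ingredients, all elementary: the
vacuum as a trial state (`E₀(K_μ) ≤ 0`), `-‖H‖ ≤ E₀(H) ≤ E^{sec}`, the term count `‖H‖ ≤ 5L²(2 + |U|)` (tree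
`norm_sum_hubbardTermOp_le`, `card_hubbardIdx_torus_le`), and `N_L > (1-δ)L² - 2`. The constant `70` is lazy
(`> (‖H‖/L² + 1)/((1-δ) - 2/L²)` would do). The mirror statement for `μ` above the band (filled torus as trial
state) is omitted. -/

omit [NeZero L] in
/-- `|Λ_L| = L²` for the fermion torus. -/
theorem card_fermionTorus_two : Fintype.card (FermionTorus 2 L) = L ^ 2 := by
  change Fintype.card (Fin 2 → Fin L) = L ^ 2
  rw [Fintype.card_fun, Fintype.card_fin, Fintype.card_fin]

/-- Norm bound `‖H‖ ≤ 5L²(2 + |U|)` for the torus Hubbard Hamiltonian at `t = 1` (at most `5L²` local terms, each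
of norm `≤ 2|t| + |U|`). -/
theorem norm_hubbardTorus_le (U : ℝ) : ‖hubbardTorus 2 L 1 U‖ ≤ 5 * (L : ℝ) ^ 2 * (2 + |U|) := by
  have hsum : hubbardTorus 2 L 1 U = ∑ Z, hubbardTermOp (fermionTorusGraph 2 L) 1 U 0 Z := by
    rw [sum_hubbardTermOp, hamiltonianWith_zero]
    rfl
  have hcard : (Fintype.card (HubbardIdx (fermionTorusGraph 2 L)) : ℝ) ≤ 5 * (L : ℝ) ^ 2 := by
    have h := card_hubbardIdx_torus_le 2 L
    have h' : ((Fintype.card (HubbardIdx (fermionTorusGraph 2 L)) : ℕ) : ℝ) ≤ (((2 * 2 + 1) * L ^ 2 : ℕ) : ℝ) := by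
      exact_mod_cast h
    have e : (((2 * 2 + 1) * L ^ 2 : ℕ) : ℝ) = 5 * (L : ℝ) ^ 2 := by push_cast; ring
    linarith
  have hU2 : 0 ≤ 2 + |U| := by positivity
  rw [hsum]
  calc ‖∑ Z, hubbardTermOp (fermionTorusGraph 2 L) 1 U 0 Z‖
      ≤ (Finset.univ : Finset (HubbardIdx (fermionTorusGraph 2 L))).card * (2 * |(1 : ℝ)| + |U| + 2 * |(0 : ℝ)|) :=
        norm_sum_hubbardTermOp_le (fermionTorusGraph 2 L) 1 U 0 Finset.univ
    _ = (Fintype.card (HubbardIdx (fermionTorusGraph 2 L)) : ℝ) * (2 + |U|) := by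
        rw [Finset.card_univ, abs_one, abs_zero]; ring
    _ ≤ 5 * (L : ℝ) ^ 2 * (2 + |U|) := mul_le_mul_of_nonneg_right hcard hU2

omit [NeZero L] in
/-- Normalised sector ground states of the source-free torus exist in `(2n, S^z = 0)` for `n ≤ L²` (tree
`szSector_groundState`). -/
theorem exists_unit_groundStateInSector (U : ℝ) {n : ℕ} (hn : n ≤ L ^ 2) :
    ∃ ψ : Fock (Orb (FermionTorus 2 L)), star ψ ⬝ᵥ ψ = 1 ∧
      IsGroundStateInSector (hubbardTorus 2 L 1 U) (2 * n) 0 ψ := by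
  classical
  have hn' : n ≤ Fintype.card (FermionTorus 2 L) := by rwa [card_fermionTorus_two]
  obtain ⟨⟨ψ, hψ⟩, -⟩ := szSector_groundState (fermionTorusGraph 2 L) 1 U hn'
  obtain ⟨c, hc0, hc1⟩ := exists_smul_unit hψ.2.1
  exact ⟨c • ψ, hc1, isGroundStateInSector_smul hψ hc0⟩

omit [NeZero L] in
/-- The vacuum carries no particles (three-line copy of the tree's `isNParticle_vacuum`, to spare an import). -/
theorem isNParticle_vacuum' : IsNParticle 0 (vacuum : Fock (Orb (FermionTorus 2 L))) := by
  intro s hs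
  have : s ≠ ∅ := fun h => hs (by rw [h, Finset.card_empty])
  simp [vacuum, this]

omit [NeZero L] in
/-- **Vacuum bound**: `E₀(K_μ) ≤ 0` for all `U, μ` (`K_μ |0⟩ = 0`). -/
theorem groundEnergy_hubbardTorusWith_le_zero (U μ : ℝ) : (hubbardTorusWith 2 L 1 U μ).groundEnergy ≤ 0 := by
  have hvac1 : star (vacuum : Fock (Orb (FermionTorus 2 L))) ⬝ᵥ vacuum = 1 := by
    simp [vacuum, dotProduct, Pi.single_apply]
  have hN : (totalNumber : Matrix (ι L) (ι L) ℂ) *ᵥ (vacuum : Fock (Orb (FermionTorus 2 L))) = 0 := by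
    have := totalNumber_mulVec_of_isNParticle (isNParticle_vacuum' L)
    simpa using this
  have hK : hubbardTorusWith 2 L 1 U μ *ᵥ (vacuum : Fock (Orb (FermionTorus 2 L))) = 0 := by
    rw [hubbardTorusWith_eq, Matrix.sub_mulVec, Matrix.smul_mulVec, hN, smul_zero, sub_zero, hubbardTorus,
      hamiltonian_mulVec_vacuum]
  have h := Matrix.groundEnergy_le_rayleigh_holds (isHermitian_hubbardTorusWith L 1 U μ) vacuum hvac1
  rw [hK, dotProduct_zero] at h
  simpa using h

omit [NeZero L] in
/-- `⌊(1-δ)L²/2⌋ ≤ L²` for `δ ≥ 0`. -/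
theorem halfFilling_floor_le_sq {δ : ℝ} (hδ : 0 ≤ δ) : ⌊(1 - δ) * (L : ℝ) ^ 2 / 2⌋₊ ≤ L ^ 2 := by
  have hx : (1 - δ) * (L : ℝ) ^ 2 / 2 ≤ ((L ^ 2 : ℕ) : ℝ) := by
    push_cast
    nlinarith [sq_nonneg (L : ℝ)]
  exact (Nat.floor_mono hx).trans (Nat.floor_natCast _).le

/-- **Lower bound on the source-free canonical/GC gap far below the band**: for `|U| ≤ 1`, `0 ≤ δ ≤ 1/2`,
`μ ≤ -70`, `L ≥ 4`: `E^{sec}(N_L) - μN_L - E₀(K_μ) > L²`. -/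
theorem canonical_gc_gap_lower {U δ μ : ℝ} (hU : |U| ≤ 1) (hδ0 : 0 ≤ δ) (hδ : δ ≤ 1 / 2) (hμ : μ ≤ -70)
    (hL : 4 ≤ L) :
    (L : ℝ) ^ 2 <
      (hubbardTorus 2 L 1 U).minEnergyOn (szSector (2 * ⌊(1 - δ) * (L : ℝ) ^ 2 / 2⌋₊) 0) -
        μ * ((2 * ⌊(1 - δ) * (L : ℝ) ^ 2 / 2⌋₊ : ℕ) : ℝ) - (hubbardTorusWith 2 L 1 U μ).groundEnergy := by
  have h4 : (1 - δ) * (L : ℝ) ^ 2 - 2 < ((2 * ⌊(1 - δ) * (L : ℝ) ^ 2 / 2⌋₊ : ℕ) : ℝ) := by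
    have := Nat.lt_floor_add_one ((1 - δ) * (L : ℝ) ^ 2 / 2)
    push_cast
    linarith
  obtain ⟨ψ, hψ1, hψ⟩ := exists_unit_groundStateInSector L U (halfFilling_floor_le_sq L hδ0)
  set n := ⌊(1 - δ) * (L : ℝ) ^ 2 / 2⌋₊ with hn
  have hLr : (4 : ℝ) ≤ L := by exact_mod_cast hL
  have hL2 : (16 : ℝ) ≤ (L : ℝ) ^ 2 := by nlinarith
  -- `E^{sec} = ⟨ψ, H ψ⟩ ≥ E₀(H) ≥ -‖H‖ ≥ -15 L²`
  have hEsec : (star ψ ⬝ᵥ hubbardTorus 2 L 1 U *ᵥ ψ).re = (hubbardTorus 2 L 1 U).minEnergyOn (szSector (2 * n) 0) := by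
    rw [hψ.2.2, dotProduct_smul, hψ1]
    simp
  have hHH : (hubbardTorus 2 L 1 U).IsHermitian := by
    rw [← hubbardTorusWith_zero]
    exact isHermitian_hubbardTorusWith L 1 U 0
  have h1 : (hubbardTorus 2 L 1 U).groundEnergy ≤ (hubbardTorus 2 L 1 U).minEnergyOn (szSector (2 * n) 0) := by
    rw [← hEsec]
    exact Matrix.groundEnergy_le_rayleigh_holds hHH ψ hψ1
  have h2 : -(5 * (L : ℝ) ^ 2 * (2 + |U|)) ≤ (hubbardTorus 2 L 1 U).groundEnergy :=
    (neg_le_neg (norm_hubbardTorus_le L U)).trans (neg_norm_le_groundEnergy hHH)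
  have h2' : -(15 * (L : ℝ) ^ 2) ≤ (hubbardTorus 2 L 1 U).groundEnergy := by
    nlinarith [h2, hU, abs_nonneg U, sq_nonneg (L : ℝ)]
  -- `E₀(K_μ) ≤ 0`
  have h3 := groundEnergy_hubbardTorusWith_le_zero L U μ
  -- `-μ N_L ≥ 70 N_L > 70 ((1-δ)L² - 2) ≥ 35 L² - 140`
  have hN0 : (0 : ℝ) ≤ ((2 * n : ℕ) : ℝ) := by positivity
  have h5 : 70 * (((2 * n : ℕ) : ℝ)) ≤ -(μ * ((2 * n : ℕ) : ℝ)) := by nlinarith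
  have h6 : (1 - δ) * (L : ℝ) ^ 2 ≥ (L : ℝ) ^ 2 / 2 := by nlinarith
  linarith

omit [NeZero L] in
/-- **`CanonicalGCEquivalence` fails far below the band.** -/
theorem not_canonicalGCEquivalence_of_mu_le {U δ μ : ℝ} (hU : |U| ≤ 1) (hδ : δ ∈ Set.Ioo (0:ℝ) (1 / 2))
    (hμ : μ ≤ -70) : ¬ CanonicalGCEquivalence U δ μ := by
  intro hC
  obtain ⟨L₀, hL₀⟩ := hC 1 one_pos
  haveI : NeZero (2 * (L₀ + 2)) := ⟨by omega⟩
  obtain ⟨ψ, hψ1, hψ⟩ :=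
    exists_unit_groundStateInSector (2 * (L₀ + 2)) U (halfFilling_floor_le_sq (2 * (L₀ + 2)) hδ.1.le)
  have key := hL₀ (2 * (L₀ + 2)) (by omega) ⟨L₀ + 2, by ring⟩ ⟨ψ, hψ.1, hψ.2.1⟩
  have low := canonical_gc_gap_lower (2 * (L₀ + 2)) hU hδ.1.le hδ.2.le hμ (by omega)
  linarith

omit [NeZero L] in
/-- **`seededRecentring_false_without_densityMatching`**: as a bare `Prop` in `μ` the recentring stub is false
(here: for every `μ ≤ -70`, `|U| ≤ 1`, `δ ∈ (0, 1/2)`); it must be filed under `DensityMatched U δ μ`. -/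
theorem seededRecentring_false_without_densityMatching {U δ μ : ℝ} (hU : |U| ≤ 1)
    (hδ : δ ∈ Set.Ioo (0:ℝ) (1 / 2)) (hμ : μ ≤ -70) : ¬ SeededRecentring U δ μ :=
  fun h => not_canonicalGCEquivalence_of_mu_le hU hδ hμ (canonicalGCEquivalence_of_seededRecentring h)

omit [NeZero L] in
/-- In particular the UNGUARDED transfer `∀ μ, HasDWaveOrder U μ → SeededRecentring U δ μ ∧ …` cannot be what a
skeleton files unless it also proves `¬ HasDWaveOrder U μ` below the band (true — a band insulator/vacuum has no
pair response — but itself a piece of work); the guarded form `DensityMatched U δ μ → …` of `Transfer` is the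
right one, and there `DensityMatched U δ (-70)` is simply false (density `0 ≠ 1 - δ`). -/
theorem transfer_guard_needed {U δ : ℝ} (hU : |U| ≤ 1) (hδ : δ ∈ Set.Ioo (0:ℝ) (1 / 2))
    (h : ∀ μ : ℝ, SeededRecentring U δ μ) : False :=
  seededRecentring_false_without_densityMatching hU hδ (le_refl (-70)) (h (-70))

/-! ## §13 (gen 3) The summit matrix is never vacuous (junk audit, proved)

`HasDWavePairFieldLROAt U δ` quantifies over ADMISSIBLE sequences (`N_L = 2⌊(1-δ)L²/2⌋`, unit norm, sector ground
state at every even `L`, including the degenerate sides `L = 0` — one-dimensional Fock space, the vacuum — and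
`L = 2`). For every `U` and every `δ ≥ 0` an admissible sequence EXISTS (`admissible_sequence_exists`, by choice
over the tree's `szSector_groundState`, `⌊(1-δ)L²/2⌋ ≤ L² = |Λ_L|`), so the conclusion of the crux can never hold
for lack of instances (`hasDWavePairFieldLROAt_nonvacuous`): a proof must produce long-range order, a disproof
must produce an order-poor admissible sequence. -/

omit [NeZero L] in
/-- **Admissible sequences exist** for every `U` and every `δ ≥ 0`. -/
theorem admissible_sequence_exists (U : ℝ) {δ : ℝ} (hδ : 0 ≤ δ) :
    ∃ (N : ℕ → ℕ) (ψ : ∀ L, Fock (Orb (FermionTorus 2 L))),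
      ∀ L, Even L → N L = 2 * ⌊(1 - δ) * (L : ℝ) ^ 2 / 2⌋₊ ∧ star (ψ L) ⬝ᵥ ψ L = 1 ∧
        IsGroundStateInSector (hubbardTorus 2 L 1 U) (N L) 0 (ψ L) := by
  have h : ∀ L : ℕ, ∃ ψ : Fock (Orb (FermionTorus 2 L)), star ψ ⬝ᵥ ψ = 1 ∧
      IsGroundStateInSector (hubbardTorus 2 L 1 U) (2 * ⌊(1 - δ) * (L : ℝ) ^ 2 / 2⌋₊) 0 ψ :=
    fun L => exists_unit_groundStateInSector L U (halfFilling_floor_le_sq L hδ)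
  choose ψ hψ using h
  exact ⟨fun L => 2 * ⌊(1 - δ) * (L : ℝ) ^ 2 / 2⌋₊, ψ, fun L _ => ⟨rfl, (hψ L).1, (hψ L).2⟩⟩

omit [NeZero L] in
/-- **The summit matrix is not vacuous**: at `δ ≥ 0` it yields an admissible sequence WITH `d`-wave LRO. -/
theorem hasDWavePairFieldLROAt_nonvacuous {U δ : ℝ} (hδ : 0 ≤ δ) (h : HasDWavePairFieldLROAt U δ) :
    ∃ (N : ℕ → ℕ) (ψ : ∀ L, Fock (Orb (FermionTorus 2 L))),
      (∀ L, Even L → N L = 2 * ⌊(1 - δ) * (L : ℝ) ^ 2 / 2⌋₊ ∧ star (ψ L) ⬝ᵥ ψ L = 1 ∧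
          IsGroundStateInSector (hubbardTorus 2 L 1 U) (N L) 0 (ψ L)) ∧
        Literature.Probability.LatticeModels.HasLongRangeOrder
          (fun k => Literature.Probability.LatticeModels.halfOpenBox 2 (2 * k))
          (fun k => torusPullback (pairFieldCorr dWaveFormFactor ψ) (2 * k)) := by
  obtain ⟨N, ψ, hadm⟩ := admissible_sequence_exists U hδ
  exact ⟨N, ψ, hadm, h N ψ hadm⟩

omit [NeZero L] in
/-- Dually, a refutation of the summit matrix at `(U, δ)` is exactly an order-poor admissible sequence. -/
theorem not_hasDWavePairFieldLROAt_iff {U δ : ℝ} :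
    ¬ HasDWavePairFieldLROAt U δ ↔
      ∃ (N : ℕ → ℕ) (ψ : ∀ L, Fock (Orb (FermionTorus 2 L))),
        (∀ L, Even L → N L = 2 * ⌊(1 - δ) * (L : ℝ) ^ 2 / 2⌋₊ ∧ star (ψ L) ⬝ᵥ ψ L = 1 ∧
            IsGroundStateInSector (hubbardTorus 2 L 1 U) (N L) 0 (ψ L)) ∧
          ¬ Literature.Probability.LatticeModels.HasLongRangeOrder
            (fun k => Literature.Probability.LatticeModels.halfOpenBox 2 (2 * k))
            (fun k => torusPullback (pairFieldCorr dWaveFormFactor ψ) (2 * k)) := by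
  unfold HasDWavePairFieldLROAt
  push Not
  rfl

end CycleThree

section CycleFour

open Matrix
open scoped Matrix.Norms.L2Operator
variable (L : ℕ) [NeZero L]

/-! ### (gen 4) Variational bookkeeping on a sector (vendored: the five-line chord inequality of
`Theorems/BalabanIRBirEveryGroundStateSchur.lean`, restated here so that this file does not import another route's
Theses through that module) -/

omit [NeZero L] in
/-- `re ⟨ψ, A ψ⟩ ≥ -Σ_{s,t} |A_{st}|` for a unit vector. -/
theorem neg_sum_norm_le_rayleigh {n : Type*} [Fintype n] (A : Matrix n n ℂ) {ψ : n → ℂ} (hψ : star ψ ⬝ᵥ ψ = 1) :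
    -(∑ s, ∑ t, ‖A s t‖) ≤ (star ψ ⬝ᵥ A *ᵥ ψ).re := by
  have hcomp : ∀ s, ‖ψ s‖ ≤ 1 := by
    intro s
    have h1 : ‖ψ s‖ ^ 2 ≤ ∑ t, ‖ψ t‖ ^ 2 :=
      Finset.single_le_sum (fun t _ => sq_nonneg (‖ψ t‖)) (Finset.mem_univ s)
    have h2 : (∑ t, ‖ψ t‖ ^ 2 : ℝ) = 1 := by
      have := congrArg Complex.re hψ
      rw [dotProduct, Complex.re_sum] at this
      simp only [Pi.star_apply, Complex.star_def, Complex.conj_mul', Complex.one_re] at this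
      rw [← this]
      refine Finset.sum_congr rfl fun t _ => ?_
      norm_cast
    rw [h2] at h1
    nlinarith [norm_nonneg (ψ s)]
  have hbound : ‖star ψ ⬝ᵥ A *ᵥ ψ‖ ≤ ∑ s, ∑ t, ‖A s t‖ := by
    rw [dotProduct]
    refine (norm_sum_le _ _).trans (Finset.sum_le_sum fun s _ => ?_)
    rw [Pi.star_apply, norm_mul, norm_star, Matrix.mulVec, dotProduct]
    refine (mul_le_of_le_one_left (norm_nonneg _) (hcomp s)).trans ?_
    refine (norm_sum_le _ _).trans (Finset.sum_le_sum fun t _ => ?_)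
    rw [norm_mul]
    exact mul_le_of_le_one_right (norm_nonneg _) (hcomp t)
  have := Complex.abs_re_le_norm (star ψ ⬝ᵥ A *ᵥ ψ)
  rw [abs_le] at this
  linarith [this.1]

omit [NeZero L] in
/-- The Rayleigh set of `A` on unit vectors of `K` is bounded below. -/
theorem bddBelow_rayleigh {n : Type*} [Fintype n] (A : Matrix n n ℂ) (K : Submodule ℂ (n → ℂ)) :
    BddBelow {E : ℝ | ∃ ψ ∈ K, star ψ ⬝ᵥ ψ = 1 ∧ E = (star ψ ⬝ᵥ A *ᵥ ψ).re} := by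
  refine ⟨-(∑ s, ∑ t, ‖A s t‖), ?_⟩
  rintro E ⟨ψ, -, hψ, rfl⟩
  exact neg_sum_norm_le_rayleigh A hψ

omit [NeZero L] in
/-- Variational principle in a sector: `minEnergyOn A K ≤ re ⟨ψ, A ψ⟩` for unit `ψ ∈ K`. -/
theorem minEnergyOn_le_rayleigh {n : Type*} [Fintype n] (A : Matrix n n ℂ) (K : Submodule ℂ (n → ℂ))
    {ψ : n → ℂ} (hψK : ψ ∈ K) (hψ : star ψ ⬝ᵥ ψ = 1) : A.minEnergyOn K ≤ (star ψ ⬝ᵥ A *ᵥ ψ).re :=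
  csInf_le (bddBelow_rayleigh A K) ⟨ψ, hψK, hψ, rfl⟩

omit [NeZero L] in
/-- The chord inequality for a sector eigen-ground-state:
`(minEnergyOn (H + κY) K - minEnergyOn H K)/κ ≤ re ⟨ψ, Y ψ⟩`. -/
theorem chord_div_le_of_eigen {n : Type*} [Fintype n] (H Y : Matrix n n ℂ) (K : Submodule ℂ (n → ℂ)) {κ : ℝ}
    (hκ : 0 < κ) {ψ : n → ℂ} (hψK : ψ ∈ K) (hψ : star ψ ⬝ᵥ ψ = 1)
    (heig : H *ᵥ ψ = ((H.minEnergyOn K : ℝ) : ℂ) • ψ) :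
    ((H + (κ : ℂ) • Y).minEnergyOn K - H.minEnergyOn K) / κ ≤ (star ψ ⬝ᵥ Y *ᵥ ψ).re := by
  have hground : (star ψ ⬝ᵥ H *ᵥ ψ).re = H.minEnergyOn K := by
    rw [heig, dotProduct_smul, hψ, smul_eq_mul, mul_one, Complex.ofReal_re]
  have h1 := minEnergyOn_le_rayleigh (H + (κ : ℂ) • Y) K hψK hψ
  rw [Matrix.add_mulVec, dotProduct_add, Complex.add_re, Matrix.smul_mulVec, dotProduct_smul,
    smul_eq_mul, Complex.re_ofReal_mul, hground] at h1
  rw [div_le_iff₀ hκ]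
  linarith


/-! ## §14 (gen 4) Uniform-floor normal form of the summit matrix (proved)

`HasDWavePairFieldLROAt U δ` quantifies over SEQUENCES of sector ground states (one per side) and asks for a
positive `liminf`. Equivalent, and easier to attack or to feed: ONE constant `a > 0` lying below the pair-order
density `lro ψ = L⁻⁴ Re⟨ψ, P†P ψ⟩` of EVERY normalised `(N_L, S^z = 0)` ground state at EVERY large even side
(`UniformPairFloor U δ`). Direction `⇐` is the §K kernel; direction `⇒` (`δ ≥ 0`) runs the summit matrix on a
NEAR-MINIMISING admissible sequence (chosen side by side through `sInf` over the non-empty, bounded-below set of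
ground-state pair orders — no compactness needed) and reads the floor off its `liminf`. Consequence used in §15:
any statement of the form "every sector ground state has [monotone image of `lro`] ≥ const" with the constant
independent of the state is NOT stronger than the summit matrix — it is the summit matrix. -/

/-- Admissibility of ONE state at ONE side: a normalised ground state of `hubbardTorus 2 L 1 U` in the sector
`(N_L, S^z = 0)`, `N_L = 2⌊(1-δ)L²/2⌋`. -/
def IsAdmissibleAt (U δ : ℝ) (L : ℕ) (ψ : Fock (Orb (FermionTorus 2 L))) : Prop :=
  IsGroundStateInSector (hubbardTorus 2 L 1 U) (2 * ⌊(1 - δ) * (L : ℝ) ^ 2 / 2⌋₊) 0 ψ ∧ star ψ ⬝ᵥ ψ = 1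

/-- **Uniform pair floor** at `(U, δ)`: one `a > 0` with `a ≤ lro ψ` for every admissible `ψ` at every large
even side `2k+2`. -/
def UniformPairFloor (U δ : ℝ) : Prop :=
  ∃ a : ℝ, 0 < a ∧ ∀ᶠ k : ℕ in atTop, ∀ ψ : Fock (Orb (FermionTorus 2 (2 * k + 1 + 1))),
    IsAdmissibleAt U δ (2 * k + 1 + 1) ψ → a ≤ lro (2 * k + 1 + 1) ψ

/-- `lro ≥ 0` (`Re⟨ψ, P†P ψ⟩ = ‖Pψ‖²`). -/
theorem lro_nonneg (φ : Fock (Orb (FermionTorus 2 L))) : 0 ≤ lro L φ := by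
  unfold lro
  have hre : (expect ((pF L)ᴴ * pF L) φ).re = eucNorm (pF L *ᵥ φ) ^ 2 := by
    rw [PosSemidefTrace.expect_conjTranspose_mul, ← eucNorm_sq]
  rw [hre]
  positivity

omit [NeZero L] in
/-- The pair-order density on ALL sides (junk `0` at side `0`, where `pairField` is not defined). -/
def plro : ∀ L : ℕ, Fock (Orb (FermionTorus 2 L)) → ℝ
  | 0, _ => 0
  | L + 1, ψ => lro (L + 1) ψ

omit [NeZero L] in
theorem plro_succ (L : ℕ) (ψ : Fock (Orb (FermionTorus 2 (L + 1)))) : plro (L + 1) ψ = lro (L + 1) ψ := rfl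

omit [NeZero L] in
theorem plro_nonneg : ∀ (L : ℕ) (φ : Fock (Orb (FermionTorus 2 L))), 0 ≤ plro L φ
  | 0, _ => le_rfl
  | L + 1, φ => lro_nonneg (L + 1) φ

omit [NeZero L] in
/-- Near-minimisers of the pair order over the admissible states exist at every side (`δ ≥ 0`: the sector is
non-empty, tree `szSector_groundState`; the set of admissible pair orders is bounded below by `0`). -/
theorem exists_nearMin_admissible (U : ℝ) {δ : ℝ} (hδ : 0 ≤ δ) (L : ℕ) {ε : ℝ} (hε : 0 < ε) :
    ∃ ψ : Fock (Orb (FermionTorus 2 L)), IsAdmissibleAt U δ L ψ ∧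
      ∀ φ : Fock (Orb (FermionTorus 2 L)), IsAdmissibleAt U δ L φ → plro L ψ ≤ plro L φ + ε := by
  set S : Set ℝ := (fun φ => plro L φ) '' {φ | IsAdmissibleAt U δ L φ} with hS
  obtain ⟨ψ₀, hψ₀1, hψ₀⟩ := exists_unit_groundStateInSector L U (halfFilling_floor_le_sq L hδ)
  have hne : S.Nonempty := ⟨plro L ψ₀, ψ₀, ⟨hψ₀, hψ₀1⟩, rfl⟩
  have hbdd : BddBelow S := ⟨0, by rintro x ⟨φ, -, rfl⟩; exact plro_nonneg L φ⟩
  obtain ⟨x, ⟨ψ, hψ, rfl⟩, hx⟩ := exists_lt_of_csInf_lt hne (lt_add_of_pos_right (sInf S) hε)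
  refine ⟨ψ, hψ, fun φ hφ => ?_⟩
  have : sInf S ≤ plro L φ := csInf_le hbdd ⟨φ, hφ, rfl⟩
  linarith

omit [NeZero L] in
/-- **Floor ⇒ summit matrix** (§K kernel). -/
theorem hasDWavePairFieldLROAt_of_uniformPairFloor {U δ : ℝ} (h : UniformPairFloor U δ) :
    HasDWavePairFieldLROAt U δ := by
  obtain ⟨a, ha, h⟩ := h
  intro N ψ hadm
  refine evenLRO_of_eventually_le dWaveFormFactor ψ ha
    (Eventually.of_forall fun k => (hadm (2 * k + 1 + 1) ⟨k + 1, by ring⟩).2.1) ?_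
  filter_upwards [h] with k hk
  obtain ⟨hNL, hnorm, hGS⟩ := hadm (2 * k + 1 + 1) ⟨k + 1, by ring⟩
  rw [hNL] at hGS
  have := hk (ψ (2 * k + 1 + 1)) ⟨hGS, hnorm⟩
  unfold lro at this
  rwa [le_div_iff₀ (by positivity)] at this

omit [NeZero L] in
/-- **Summit matrix ⇒ floor** (`δ ≥ 0`): run the matrix on a near-minimising admissible sequence. -/
theorem uniformPairFloor_of_hasDWavePairFieldLROAt {U δ : ℝ} (hδ : 0 ≤ δ) (h : HasDWavePairFieldLROAt U δ) :
    UniformPairFloor U δ := by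
  have hch : ∀ L : ℕ, ∃ ψ : Fock (Orb (FermionTorus 2 L)), IsAdmissibleAt U δ L ψ ∧
      ∀ φ : Fock (Orb (FermionTorus 2 L)), IsAdmissibleAt U δ L φ → plro L ψ ≤ plro L φ + 1 / ((L : ℝ) + 1) :=
    fun L => exists_nearMin_admissible U hδ L (by positivity)
  choose ψ hψadm hψmin using hch
  have hadm : ∀ L : ℕ, Even L → 2 * ⌊(1 - δ) * (L : ℝ) ^ 2 / 2⌋₊ = 2 * ⌊(1 - δ) * (L : ℝ) ^ 2 / 2⌋₊ ∧
      star (ψ L) ⬝ᵥ ψ L = 1 ∧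
        IsGroundStateInSector (hubbardTorus 2 L 1 U) (2 * ⌊(1 - δ) * (L : ℝ) ^ 2 / 2⌋₊) 0 (ψ L) :=
    fun L _ => ⟨rfl, (hψadm L).2, (hψadm L).1⟩
  have hLRO := h (fun L => 2 * ⌊(1 - δ) * (L : ℝ) ^ 2 / 2⌋₊) ψ hadm
  unfold Literature.Probability.LatticeModels.HasLongRangeOrder at hLRO
  rw [← Filter.liminf_nat_add _ 1] at hLRO
  have key : ∀ k : ℕ,
      (∑ x ∈ Literature.Probability.LatticeModels.halfOpenBox 2 (2 * (k + 1)),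
        ∑ y ∈ Literature.Probability.LatticeModels.halfOpenBox 2 (2 * (k + 1)),
          torusPullback (pairFieldCorr dWaveFormFactor ψ) (2 * (k + 1)) x y) /
        ((Literature.Probability.LatticeModels.halfOpenBox 2 (2 * (k + 1))).card : ℝ) ^ 2 =
      lro (2 * k + 1 + 1) (ψ (2 * k + 1 + 1)) := by
    intro k
    rw [show 2 * (k + 1) = 2 * k + 1 + 1 by ring]
    exact torusLROSeq_pairFieldCorr_succ dWaveFormFactor ψ (2 * k + 1)
  simp only [key] at hLRO
  set ℓ := liminf (fun k : ℕ => lro (2 * k + 1 + 1) (ψ (2 * k + 1 + 1))) atTop with hℓ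
  have hev : ∀ᶠ k : ℕ in atTop, ℓ / 2 < lro (2 * k + 1 + 1) (ψ (2 * k + 1 + 1)) :=
    Filter.eventually_lt_of_lt_liminf (by linarith)
      (isBoundedUnder_of_eventually_ge (Eventually.of_forall fun k => lro_nonneg _ _))
  obtain ⟨n, hn⟩ := exists_nat_one_div_lt (show 0 < ℓ / 4 by linarith)
  have hev2 : ∀ᶠ k : ℕ in atTop, 1 / (((2 * k + 1 + 1 : ℕ) : ℝ) + 1) ≤ ℓ / 4 := by
    filter_upwards [Filter.eventually_ge_atTop n] with k hk
    have h1 : (n : ℝ) + 1 ≤ ((2 * k + 1 + 1 : ℕ) : ℝ) + 1 := by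
      have : (n : ℝ) ≤ ((2 * k + 1 + 1 : ℕ) : ℝ) := by exact_mod_cast (by omega : n ≤ 2 * k + 1 + 1)
      linarith
    exact (one_div_le_one_div_of_le (by positivity) h1).trans hn.le
  refine ⟨ℓ / 4, by linarith, ?_⟩
  filter_upwards [hev, hev2] with k hk hk2
  intro φ hφ
  have hmin := hψmin (2 * k + 1 + 1) φ hφ
  rw [plro_succ, plro_succ] at hmin
  linarith

omit [NeZero L] in
/-- **The normal form**: for `δ ≥ 0`, `HasDWavePairFieldLROAt U δ ↔ UniformPairFloor U δ`. -/
theorem hasDWavePairFieldLROAt_iff_uniformPairFloor {U δ : ℝ} (hδ : 0 ≤ δ) :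
    HasDWavePairFieldLROAt U δ ↔ UniformPairFloor U δ :=
  ⟨uniformPairFloor_of_hasDWavePairFieldLROAt hδ, hasDWavePairFieldLROAt_of_uniformPairFloor⟩


/-! ## §15 (gen 4) TARGETS — `stub_facePurityChord` of line `tangent-face-legendre-spine`, dissected (proved)

The lead's one open stub (PROMOTE dossier `PROMOTE-stub_facePurityChord.md`) is, at fixed `(U, δ)`, the CHORD
statement `ChordFacePurity U δ` below (`stubFacePurityChord_iff`: the registered signature is literally
`crux hypotheses → ChordFacePurity U δ`). Findings, all theorems:

1. `derivFacePurity_of_chordFacePurity` — Danskin, repulsive direction: the chord form implies the DERIVATIVE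
   (every-ground-state) form `DerivFacePurity U δ`: one `a > 0` with `Re⟨ψ, W_R ψ⟩ ≥ a L²` for every
   admissible `ψ`, every block scale `R`, eventually in the even side.
2. `sq_mul_lro_le_blockRepulsion` — block coherence DOMINATES pair order at every scale: `L²·lro ψ ≤ Re⟨ψ, W_R ψ⟩`
   for every vector (`Σ_a B_a = R²·P`, `sum_blockPair`, and Cauchy–Schwarz over the `L²` anchors). Hence
   `derivFacePurity_of_uniformPairFloor` and, with §14, `derivFacePurity_of_hasDWavePairFieldLROAt`: the
   derivative form of face purity is a CONSEQUENCE of the summit matrix at `(U, δ)` (`δ ≥ 0`) — it is not an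
   independent bet, and "every-GS is free" (PICKED.md (3)) is true in the strong sense that the every-GS floor at
   all scales is NECESSARY for the crux's conclusion.
3. `uniformPairFloor_of_derivFacePurity_of_infraredLeak` — conversely, with the infrared leak at `(U, δ)`
   (`InfraredLeak U δ`, supplied on the line by item stmt-1089) and the LANDED Fejér closure
   (`Theorems.WcbcsSsbToTorusLRO.stub_fejerClosure`, p72085), the derivative form gives the uniform floor, i.e.
   the summit matrix (§14). So MODULO stmt-1089: `DerivFacePurity U δ ↔ HasDWavePairFieldLROAt U δ`
   (`derivFacePurity_iff_matrix_of_infraredLeak`). The line's reduction, read at the derivative level, is the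
   identity map; its entire non-circular content is the passage chord → derivative, i.e.
4. `extensiveGap_of_chordFacePurity` — what the chord adds: an EXTENSIVE energy penalty
   `⟨φ, H φ⟩ ≥ E_sec + (κa/2)L²` for every unit `φ` of the sector whose block coherence is `≤ (a/2)L²`
   (order-poor states are extensively excited, with `κ = κ(R)` independent of `L`). This is face purity proper —
   no order-poor state is degenerate in energy DENSITY with the ground state — read off two sector ENERGIES, which
   is why the card bets on it (energies are what a constructive expansion certifies); it does not require the order
   to survive the repulsion (`κ(R)` may be taken below the condensation-energy scale), and it is strictly more than
   the crux asks. ADVERSARY READING: a promoted item `C_P` in chord form can fail while the crux holds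
   (order-poor low-lying eigenstates with `o(L²)` excitation energy at some scale `R`: e.g. a competing phase of
   equal energy DENSITY but different particle density is invisible to the canonical crux yet kills the chord
   through sector-changing… no — `W_R` and `H` preserve the sector; the competitor must live IN the sector, i.e.
   at the same density: phase coexistence at equal density, codimension ≥ 2, cf. drefute SURVIVED.md §3); in
   derivative form it cannot fail unless the summit conjunct fails at `(U, δ)`.
RECOMMENDATION (for the planner's promote step): file `C_P` in DERIVATIVE form only if an honest supplier of the
every-GS floor other than the crux itself is named (there is none: it IS the crux body modulo 1089); file it in
CHORD form knowing it is crux + stability; in either case use the swapped quantifiers of §4. -/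

/-- The Kac block pair operator `B_a = Σ_{u ∈ [0,R)²} P_{a+u}` (syntax of the stub; blocks wrap around). -/
def blockPair (R : ℕ) (a : Literature.Probability.LatticeModels.TorusSite 2 L) : Matrix (ι L) (ι L) ℂ :=
  ∑ u : Fin 2 → Fin R, localPair dWaveFormFactor L (a + fun i => ((u i : ℕ) : ZMod L))

/-- The block repulsion `W_R = R⁻⁴ Σ_a B_aᴴ B_a` (syntax of the stub). -/
def blockRepulsion (R : ℕ) : Matrix (ι L) (ι L) ℂ :=
  ((((R : ℝ) ^ 4)⁻¹ : ℝ) : ℂ) •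
    ∑ a : Literature.Probability.LatticeModels.TorusSite 2 L, (blockPair L R a)ᴴ * blockPair L R a

omit [NeZero L] in
/-- The registered stub `stub_facePurityChord`, verbatim. -/
def StubFacePurityChord : Prop :=
  ∃ U₀ : ℝ, 0 < U₀ ∧ ∀ U ∈ Set.Ioo (0:ℝ) U₀, ∀ δ ∈ Set.Ioo (0:ℝ) (1 / 2), ∀ μ : ℝ, Filter.Tendsto (fun L : ℕ => ((hubbardTorusWith 2 (L + 1) 1 U μ).groundStateFunctional totalNumber).re / ((L + 1 : ℕ) : ℝ) ^ 2) Filter.atTop (nhds (1 - δ)) → HasDWaveOrder U μ → ∃ a : ℝ, 0 < a ∧ ∀ R : ℕ, 0 < R → ∃ κ : ℝ, 0 < κ ∧ ∀ᶠ k : ℕ in Filter.atTop, κ * a * ((2 * k + 1 + 1 : ℕ) : ℝ) ^ 2 ≤ (hubbardTorus 2 (2 * k + 1 + 1) 1 U + (κ : ℂ) • ((((R : ℝ) ^ 4)⁻¹ : ℝ) : ℂ) • ∑ a : Literature.Probability.LatticeModels.TorusSite 2 (2 * k + 1 + 1), (∑ u : Fin 2 → Fin R, localPair dWaveFormFactor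 (2 * k + 1 + 1) (a + fun i => ((u i : ℕ) : ZMod (2 * k + 1 + 1))))ᴴ * (∑ u : Fin 2 → Fin R, localPair dWaveFormFactor (2 * k + 1 + 1) (a + fun i => ((u i : ℕ) : ZMod (2 * k + 1 + 1))))).minEnergyOn (szSector (2 * ⌊(1 - δ) * ((2 * k + 1 + 1 : ℕ) : ℝ) ^ 2 / 2⌋₊) 0) - (hubbardTorus 2 (2 * k + 1 + 1) 1 U).minEnergyOn (szSector (2 * ⌊(1 - δ) * ((2 * k + 1 + 1 : ℕ) : ℝ) ^ 2 / 2⌋₊) 0)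

omit [NeZero L] in
/-- **Chord face purity** at `(U, δ)` — the stub's conclusion (= the PROMOTE dossier's hypothesis-free
`BlockRepelledChord U δ`): the left chord of the block-repelled sector energy is extensive, slope floor `a`
uniform in the block scale `R`, coupling `κ = κ(R)` INDEPENDENT of the side. -/
def ChordFacePurity (U δ : ℝ) : Prop :=
  ∃ a : ℝ, 0 < a ∧ ∀ R : ℕ, 0 < R → ∃ κ : ℝ, 0 < κ ∧ ∀ᶠ k : ℕ in atTop,
    κ * a * ((2 * k + 1 + 1 : ℕ) : ℝ) ^ 2 ≤
      (hubbardTorus 2 (2 * k + 1 + 1) 1 U + (κ : ℂ) • blockRepulsion (2 * k + 1 + 1) R).minEnergyOn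
          (szSector (2 * ⌊(1 - δ) * ((2 * k + 1 + 1 : ℕ) : ℝ) ^ 2 / 2⌋₊) 0) -
        (hubbardTorus 2 (2 * k + 1 + 1) 1 U).minEnergyOn
          (szSector (2 * ⌊(1 - δ) * ((2 * k + 1 + 1 : ℕ) : ℝ) ^ 2 / 2⌋₊) 0)

omit [NeZero L] in
/-- The stub is `crux hypotheses → ChordFacePurity` (definitional). -/
theorem stubFacePurityChord_iff :
    StubFacePurityChord ↔
      ∃ U₀ : ℝ, 0 < U₀ ∧ ∀ U ∈ Set.Ioo (0:ℝ) U₀, ∀ δ ∈ Set.Ioo (0:ℝ) (1 / 2), ∀ μ : ℝ,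
        DensityMatched U δ μ → HasDWaveOrder U μ → ChordFacePurity U δ :=
  Iff.rfl

omit [NeZero L] in
/-- **Derivative (every-ground-state) face purity** at `(U, δ)`: one `a > 0` such that at every block scale
`R`, eventually along even sides, EVERY admissible state has block coherence `Re⟨ψ, W_R ψ⟩ ≥ a L²`. -/
def DerivFacePurity (U δ : ℝ) : Prop :=
  ∃ a : ℝ, 0 < a ∧ ∀ R : ℕ, 0 < R → ∀ᶠ k : ℕ in atTop, ∀ ψ : Fock (Orb (FermionTorus 2 (2 * k + 1 + 1))),
    IsAdmissibleAt U δ (2 * k + 1 + 1) ψ →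
      a * ((2 * k + 1 + 1 : ℕ) : ℝ) ^ 2 ≤ (star ψ ⬝ᵥ blockRepulsion (2 * k + 1 + 1) R *ᵥ ψ).re

omit [NeZero L] in
/-- **(1) Chord ⇒ derivative** (Danskin in the repulsive direction; the chord inequality `chord_div_le_of_eigen`). -/
theorem derivFacePurity_of_chordFacePurity {U δ : ℝ} (h : ChordFacePurity U δ) : DerivFacePurity U δ := by
  obtain ⟨a, ha, h⟩ := h
  refine ⟨a, ha, fun R hR => ?_⟩
  obtain ⟨κ, hκ, hk⟩ := h R hR
  filter_upwards [hk] with k hk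
  intro ψ hψ
  have hchord := chord_div_le_of_eigen (hubbardTorus 2 (2 * k + 1 + 1) 1 U)
    (blockRepulsion (2 * k + 1 + 1) R) (szSector (2 * ⌊(1 - δ) * ((2 * k + 1 + 1 : ℕ) : ℝ) ^ 2 / 2⌋₊) 0)
    hκ hψ.1.1 hψ.2 hψ.1.2.2
  rw [div_le_iff₀ hκ] at hchord
  have : κ * (a * ((2 * k + 1 + 1 : ℕ) : ℝ) ^ 2) ≤
      κ * (star ψ ⬝ᵥ blockRepulsion (2 * k + 1 + 1) R *ᵥ ψ).re := by nlinarith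
  exact le_of_mul_le_mul_left this hκ

/-- `Σ_a B_a = R² · P` (every site is covered by exactly `R²` translates of the block). -/
theorem sum_blockPair (R : ℕ) :
    ∑ a : Literature.Probability.LatticeModels.TorusSite 2 L, blockPair L R a = ((R : ℂ) ^ 2) • pF L := by
  have key : ∀ u : Fin 2 → Fin R,
      ∑ a : Literature.Probability.LatticeModels.TorusSite 2 L,
        localPair dWaveFormFactor L (a + fun i => ((u i : ℕ) : ZMod L)) = pF L := by
    intro u
    exact Fintype.sum_equiv (Equiv.addRight (fun i => ((u i : ℕ) : ZMod L))) _ _ (fun a => rfl)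
  unfold blockPair
  rw [Finset.sum_comm]
  simp only [key, Finset.sum_const, Finset.card_univ, Fintype.card_pi, Fintype.card_fin, Finset.prod_const]
  rw [← Nat.cast_smul_eq_nsmul ℂ]
  push_cast
  rfl

omit [NeZero L] in
/-- Cauchy–Schwarz over a finite family of vectors: `‖Σ_a v_a‖² ≤ |s| · Σ_a ‖v_a‖²`. -/
theorem re_star_sum_dotProduct_sum_le {α : Type*} (s : Finset α) (v : α → ι L → ℂ) :
    (star (∑ a ∈ s, v a) ⬝ᵥ (∑ a ∈ s, v a)).re ≤ s.card * ∑ a ∈ s, (star (v a) ⬝ᵥ v a).re := by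
  have h1 : eucNorm (∑ a ∈ s, v a) ≤ ∑ a ∈ s, eucNorm (v a) :=
    Finset.le_sum_of_subadditive eucNorm eucNorm_zero.le eucNorm_add_le s v
  have h2 : (∑ a ∈ s, eucNorm (v a)) ^ 2 ≤ s.card * ∑ a ∈ s, eucNorm (v a) ^ 2 :=
    sq_sum_le_card_mul_sum_sq
  rw [← eucNorm_sq]
  simp_rw [← eucNorm_sq]
  exact (pow_le_pow_left₀ (eucNorm_nonneg _) h1 2).trans h2

/-- `Re⟨ψ, W_R ψ⟩ = R⁻⁴ Re Σ_a ‖B_a ψ‖²` (shape of the landed Fejér closure: `re` outside the sum). -/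
theorem re_expect_blockRepulsion (R : ℕ) (ψ : ι L → ℂ) :
    (star ψ ⬝ᵥ blockRepulsion L R *ᵥ ψ).re =
      ((R : ℝ) ^ 4)⁻¹ *
        (∑ a : Literature.Probability.LatticeModels.TorusSite 2 L,
          star (blockPair L R a *ᵥ ψ) ⬝ᵥ (blockPair L R a *ᵥ ψ)).re := by
  unfold blockRepulsion
  rw [Matrix.smul_mulVec, dotProduct_smul, smul_eq_mul, Complex.re_ofReal_mul, Matrix.sum_mulVec, dotProduct_sum]
  congr 2
  refine Finset.sum_congr rfl fun a _ => ?_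
  rw [Literature.MathematicalPhysics.QuantumLattice.star_mulVec_dotProduct_mulVec]

/-- `card (TorusSite 2 L) = L²`. -/
theorem card_torusSite_two : Fintype.card (Literature.Probability.LatticeModels.TorusSite 2 L) = L ^ 2 := by
  simp [Fintype.card_pi, ZMod.card, Finset.prod_const]

/-- **(2) Block coherence dominates pair order at every scale**: `L² · lro ψ ≤ Re⟨ψ, W_R ψ⟩` (`R ≥ 1`). -/
theorem sq_mul_lro_le_blockRepulsion (R : ℕ) (hR : 0 < R) (ψ : ι L → ℂ) :
    (L : ℝ) ^ 2 * lro L ψ ≤ (star ψ ⬝ᵥ blockRepulsion L R *ᵥ ψ).re := by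
  have hL : (0 : ℝ) < (L : ℝ) := Nat.cast_pos.2 (Nat.pos_of_ne_zero (NeZero.ne L))
  have hRr : (0 : ℝ) < (R : ℝ) := by exact_mod_cast hR
  rw [re_expect_blockRepulsion, Complex.re_sum]
  have hcs := re_star_sum_dotProduct_sum_le L Finset.univ (fun a => blockPair L R a *ᵥ ψ)
  have hsum : ∑ a : Literature.Probability.LatticeModels.TorusSite 2 L, blockPair L R a *ᵥ ψ =
      ((R : ℂ) ^ 2) • (pF L *ᵥ ψ) := by
    rw [← Matrix.sum_mulVec, sum_blockPair, Matrix.smul_mulVec]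
  have hsq : (star (((R : ℂ) ^ 2) • (pF L *ᵥ ψ)) ⬝ᵥ (((R : ℂ) ^ 2) • (pF L *ᵥ ψ))).re =
      (R : ℝ) ^ 4 * ((L : ℝ) ^ 4 * lro L ψ) := by
    rw [← eucNorm_sq, eucNorm_smul, mul_pow, eucNorm_sq, ← PosSemidefTrace.expect_conjTranspose_mul]
    have e1 : ‖(R : ℂ) ^ 2‖ ^ 2 = (R : ℝ) ^ 4 := by
      rw [norm_pow, Complex.norm_natCast]; ring
    have e2 : (expect ((pF L)ᴴ * pF L) ψ).re = (L : ℝ) ^ 4 * lro L ψ := by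
      unfold lro; field_simp
    rw [e1, e2]
  simp only [hsum, Finset.card_univ, card_torusSite_two, Nat.cast_pow] at hcs
  rw [hsq] at hcs
  -- hcs : R⁴ (L⁴ lro) ≤ L² Σ_a ‖B_a ψ‖²
  set S : ℝ := ∑ a : Literature.Probability.LatticeModels.TorusSite 2 L,
    (star (blockPair L R a *ᵥ ψ) ⬝ᵥ (blockPair L R a *ᵥ ψ)).re with hS_def
  have hR4 : (0 : ℝ) < (R : ℝ) ^ 4 := by positivity
  have hL2 : (0 : ℝ) < (L : ℝ) ^ 2 := by positivity
  have h3 : (R : ℝ) ^ 4 * ((L : ℝ) ^ 2 * lro L ψ) * (L : ℝ) ^ 2 ≤ S * (L : ℝ) ^ 2 :=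
    calc (R : ℝ) ^ 4 * ((L : ℝ) ^ 2 * lro L ψ) * (L : ℝ) ^ 2 = (R : ℝ) ^ 4 * ((L : ℝ) ^ 4 * lro L ψ) := by ring
      _ ≤ (L : ℝ) ^ 2 * S := hcs
      _ = S * (L : ℝ) ^ 2 := by ring
  have h4 : (R : ℝ) ^ 4 * ((L : ℝ) ^ 2 * lro L ψ) ≤ S := le_of_mul_le_mul_right h3 hL2
  have e5 : (R : ℝ) ^ 4 * (((R : ℝ) ^ 4)⁻¹ * S) = S := by field_simp
  have h5 : (R : ℝ) ^ 4 * ((L : ℝ) ^ 2 * lro L ψ) ≤ (R : ℝ) ^ 4 * (((R : ℝ) ^ 4)⁻¹ * S) := by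
    rw [e5]; exact h4
  exact le_of_mul_le_mul_left h5 hR4

omit [NeZero L] in
/-- **(2') Uniform floor ⇒ derivative face purity** (same constant `a`, every scale `R ≥ 1`). -/
theorem derivFacePurity_of_uniformPairFloor {U δ : ℝ} (h : UniformPairFloor U δ) : DerivFacePurity U δ := by
  obtain ⟨a, ha, h⟩ := h
  refine ⟨a, ha, fun R hR => ?_⟩
  filter_upwards [h] with k hk
  intro ψ hψ
  have h1 := hk ψ hψ
  have h2 := sq_mul_lro_le_blockRepulsion (2 * k + 1 + 1) R hR ψ
  have hL : (0 : ℝ) ≤ ((2 * k + 1 + 1 : ℕ) : ℝ) ^ 2 := sq_nonneg _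
  nlinarith [mul_le_mul_of_nonneg_left h1 hL]

omit [NeZero L] in
/-- **(2'') The summit matrix forces derivative face purity** (`δ ≥ 0`): the every-GS block-coherence floor at
all scales is NECESSARY for the crux's conclusion. -/
theorem derivFacePurity_of_hasDWavePairFieldLROAt {U δ : ℝ} (hδ : 0 ≤ δ) (h : HasDWavePairFieldLROAt U δ) :
    DerivFacePurity U δ :=
  derivFacePurity_of_uniformPairFloor (uniformPairFloor_of_hasDWavePairFieldLROAt hδ h)

omit [NeZero L] in
/-- The infrared-leak input at `(U, δ)` (the skeleton's `hIR` body stripped of its two idle grand-canonical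
hypotheses; on the line it is supplied by item stmt-1089 `KacWindowPenalty.WindowInfraredBound`). -/
def InfraredLeak (U δ : ℝ) : Prop :=
  ∀ b : ℝ, 0 < b → ∃ η : ℝ, 0 < η ∧ ∀ᶠ k : ℕ in atTop, ∀ ψ : Fock (Orb (FermionTorus 2 (2 * k + 1 + 1))),
    IsAdmissibleAt U δ (2 * k + 1 + 1) ψ →
      (∑ m ∈ (Finset.univ.filter fun m : Literature.Probability.LatticeModels.TorusSite 2 (2 * k + 1 + 1) =>
          m ≠ 0 ∧ momentumNormSq (2 * k + 1 + 1) m < η ^ 2),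
        pairStructureFactor dWaveFormFactor (2 * k + 1 + 1) ψ m) / ((2 * k + 1 + 1 : ℕ) : ℝ) ^ 2 ≤ b

omit [NeZero L] in
/-- A block scale making the Fejér UV tail small: `2π²C²/(R²η²) ≤ a/4`. -/
theorem exists_blockScale' (C : ℝ) {a η : ℝ} (ha : 0 < a) (hη : 0 < η) :
    ∃ R : ℕ, 0 < R ∧ 2 * Real.pi ^ 2 * C ^ 2 / ((R : ℝ) ^ 2 * η ^ 2) ≤ a / 4 := by
  obtain ⟨R, hR⟩ := exists_nat_gt (max (8 * Real.pi ^ 2 * C ^ 2 / (a * η ^ 2)) 1)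
  have hR1 : (1 : ℝ) < R := lt_of_le_of_lt (le_max_right _ _) hR
  have hRX : 8 * Real.pi ^ 2 * C ^ 2 / (a * η ^ 2) < R := lt_of_le_of_lt (le_max_left _ _) hR
  have hRpos : 0 < R := by exact_mod_cast (zero_lt_one.trans hR1)
  refine ⟨R, hRpos, ?_⟩
  have hR2 : (R : ℝ) ≤ (R : ℝ) ^ 2 := by nlinarith
  have hX : 8 * Real.pi ^ 2 * C ^ 2 ≤ a * η ^ 2 * (R : ℝ) ^ 2 := by
    rw [div_lt_iff₀ (by positivity)] at hRX
    nlinarith [mul_pos ha (pow_pos hη 2)]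
  rw [div_le_div_iff₀ (by positivity) (by norm_num : (0:ℝ) < 4)]
  nlinarith

omit [NeZero L] in
/-- **(3) Derivative face purity + infrared leak ⇒ uniform floor** (hence the summit matrix, §14), through the
LANDED Fejér closure `Theorems.WcbcsSsbToTorusLRO.stub_fejerClosure` (p72085). Constants as in the skeleton:
leak budget `a/4`, tail `≤ a/4`, floor `a/2`. -/
theorem uniformPairFloor_of_derivFacePurity_of_infraredLeak {U δ : ℝ} (hP : DerivFacePurity U δ)
    (hIR : InfraredLeak U δ) : UniformPairFloor U δ := by
  obtain ⟨a, ha, hP⟩ := hP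
  obtain ⟨η, hη, hIRη⟩ := hIR (a / 4) (by positivity)
  set C : ℝ := ∑ e ∈ insert (0 : Literature.Probability.LatticeModels.Site 2) unitSteps,
    ‖((dWaveFormFactor e / Real.sqrt 2 : ℝ) : ℂ)‖ * 2 with hC_def
  obtain ⟨R, hR, htail⟩ := exists_blockScale' C ha hη
  refine ⟨a / 2, by positivity, ?_⟩
  filter_upwards [hP R hR, hIRη] with k hPk hIRk
  intro ψ hψ
  have hblock := hPk ψ hψ
  have hY := re_expect_blockRepulsion (2 * k + 1 + 1) R ψ
  have hleak := hIRk ψ hψ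
  have hfejer :=
    Summit.HubbardSuperconductivity.HubbardSuperconductivity.Theorems.WcbcsSsbToTorusLRO.stub_fejerClosure
      dWaveFormFactor (2 * k + 1 + 1) R hR η hη ψ hψ.2
  have hLpos : (0 : ℝ) < ((2 * k + 1 + 1 : ℕ) : ℝ) := by positivity
  have hRpos : (0 : ℝ) < (R : ℝ) := by exact_mod_cast hR
  -- block coherence per `R⁴L²` is ≥ a
  have hb : a ≤ (∑ x : Literature.Probability.LatticeModels.TorusSite 2 (2 * k + 1 + 1),
      star (blockPair (2 * k + 1 + 1) R x *ᵥ ψ) ⬝ᵥ (blockPair (2 * k + 1 + 1) R x *ᵥ ψ)).re /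
        ((R : ℝ) ^ 4 * ((2 * k + 1 + 1 : ℕ) : ℝ) ^ 2) := by
    rw [le_div_iff₀ (by positivity)]
    rw [hY] at hblock
    have e : ((R : ℝ) ^ 4)⁻¹ * (∑ x : Literature.Probability.LatticeModels.TorusSite 2 (2 * k + 1 + 1),
        star (blockPair (2 * k + 1 + 1) R x *ᵥ ψ) ⬝ᵥ (blockPair (2 * k + 1 + 1) R x *ᵥ ψ)).re * (R : ℝ) ^ 4 =
        (∑ x : Literature.Probability.LatticeModels.TorusSite 2 (2 * k + 1 + 1),
          star (blockPair (2 * k + 1 + 1) R x *ᵥ ψ) ⬝ᵥ (blockPair (2 * k + 1 + 1) R x *ᵥ ψ)).re := by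
      field_simp
    nlinarith [mul_le_mul_of_nonneg_right hblock (pow_pos hRpos 4).le]
  have hfloor : a / 2 ≤ (expect ((pairField dWaveFormFactor (2 * k + 1 + 1))ᴴ *
      pairField dWaveFormFactor (2 * k + 1 + 1)) ψ).re / ((2 * k + 1 + 1 : ℕ) : ℝ) ^ 4 := by
    change a ≤ (∑ x : Literature.Probability.LatticeModels.TorusSite 2 (2 * k + 1 + 1),
      star ((∑ u : Fin 2 → Fin R, localPair dWaveFormFactor (2 * k + 1 + 1)
          (x + fun i => ((u i : ℕ) : ZMod (2 * k + 1 + 1)))) *ᵥ ψ) ⬝ᵥ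
        ((∑ u : Fin 2 → Fin R, localPair dWaveFormFactor (2 * k + 1 + 1)
          (x + fun i => ((u i : ℕ) : ZMod (2 * k + 1 + 1)))) *ᵥ ψ)).re /
          ((R : ℝ) ^ 4 * ((2 * k + 1 + 1 : ℕ) : ℝ) ^ 2) at hb
    linarith
  unfold lro
  exact hfloor

omit [NeZero L] in
/-- **(3') MODULO the infrared leak, derivative face purity IS the summit matrix** (`δ ≥ 0`). -/
theorem derivFacePurity_iff_matrix_of_infraredLeak {U δ : ℝ} (hδ : 0 ≤ δ) (hIR : InfraredLeak U δ) :
    DerivFacePurity U δ ↔ HasDWavePairFieldLROAt U δ :=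
  ⟨fun hP => hasDWavePairFieldLROAt_of_uniformPairFloor (uniformPairFloor_of_derivFacePurity_of_infraredLeak hP hIR),
    derivFacePurity_of_hasDWavePairFieldLROAt hδ⟩

omit [NeZero L] in
/-- One variational line: `E_K(H + κW) - E_K(H) ≤ (Re⟨φ,Hφ⟩ - E_K(H)) + κ Re⟨φ,Wφ⟩` for every unit `φ ∈ K`. -/
theorem chord_le_excess_add {n : Type*} [Fintype n] (H W : Matrix n n ℂ) (K : Submodule ℂ (n → ℂ)) (κ : ℝ)
    {φ : n → ℂ} (hφK : φ ∈ K) (hφ : star φ ⬝ᵥ φ = 1) :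
    (H + (κ : ℂ) • W).minEnergyOn K - H.minEnergyOn K ≤
      ((star φ ⬝ᵥ H *ᵥ φ).re - H.minEnergyOn K) + κ * (star φ ⬝ᵥ W *ᵥ φ).re := by
  have h1 := minEnergyOn_le_rayleigh (H + (κ : ℂ) • W) K hφK hφ
  rw [Matrix.add_mulVec, dotProduct_add, Complex.add_re, Matrix.smul_mulVec, dotProduct_smul, smul_eq_mul,
    Complex.re_ofReal_mul] at h1
  linarith

omit [NeZero L] in
/-- **(4) What the chord adds: order-poor states are EXTENSIVELY excited.** Under `ChordFacePurity U δ`, for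
every block scale `R` there is `κ = κ(R) > 0` such that eventually along even sides every unit vector `φ` of the
sector `(N_L, S^z = 0)` with block coherence `Re⟨φ, W_R φ⟩ ≤ (a/2)L²` has energy
`Re⟨φ, H φ⟩ ≥ E_sec(H) + (κa/2)L²`. -/
theorem extensiveGap_of_chordFacePurity {U δ : ℝ} (h : ChordFacePurity U δ) :
    ∃ a : ℝ, 0 < a ∧ ∀ R : ℕ, 0 < R → ∃ κ : ℝ, 0 < κ ∧ ∀ᶠ k : ℕ in atTop,
      ∀ φ : Fock (Orb (FermionTorus 2 (2 * k + 1 + 1))),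
        φ ∈ szSector (Λ := FermionTorus 2 (2 * k + 1 + 1)) (2 * ⌊(1 - δ) * ((2 * k + 1 + 1 : ℕ) : ℝ) ^ 2 / 2⌋₊) 0 →
        star φ ⬝ᵥ φ = 1 →
        (star φ ⬝ᵥ blockRepulsion (2 * k + 1 + 1) R *ᵥ φ).re ≤ a / 2 * ((2 * k + 1 + 1 : ℕ) : ℝ) ^ 2 →
          (hubbardTorus 2 (2 * k + 1 + 1) 1 U).minEnergyOn
                (szSector (2 * ⌊(1 - δ) * ((2 * k + 1 + 1 : ℕ) : ℝ) ^ 2 / 2⌋₊) 0) +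
              κ * (a / 2) * ((2 * k + 1 + 1 : ℕ) : ℝ) ^ 2 ≤
            (star φ ⬝ᵥ hubbardTorus 2 (2 * k + 1 + 1) 1 U *ᵥ φ).re := by
  obtain ⟨a, ha, h⟩ := h
  refine ⟨a, ha, fun R hR => ?_⟩
  obtain ⟨κ, hκ, hk⟩ := h R hR
  refine ⟨κ, hκ, ?_⟩
  filter_upwards [hk] with k hk
  intro φ hφK hφ hpoor
  have hvar := chord_le_excess_add (hubbardTorus 2 (2 * k + 1 + 1) 1 U) (blockRepulsion (2 * k + 1 + 1) R)
    (szSector (2 * ⌊(1 - δ) * ((2 * k + 1 + 1 : ℕ) : ℝ) ^ 2 / 2⌋₊) 0) κ hφK hφ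
  nlinarith [mul_le_mul_of_nonneg_left hpoor hκ.le]

omit [NeZero L] in
/-- Packaging for the lead/planner: the stub implies the crux hypotheses → derivative face purity, which (given
the line's other input at `(U, δ)`) is the crux body itself — so any proof of the stub proves the crux's
conclusion "in passing" and then some (`extensiveGap_of_chordFacePurity`). -/
theorem stub_gives_derivFacePurity (h : StubFacePurityChord) :
    ∃ U₀ : ℝ, 0 < U₀ ∧ ∀ U ∈ Set.Ioo (0:ℝ) U₀, ∀ δ ∈ Set.Ioo (0:ℝ) (1 / 2), ∀ μ : ℝ,
      DensityMatched U δ μ → HasDWaveOrder U μ → DerivFacePurity U δ := by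
  obtain ⟨U₀, hU₀, h⟩ := stubFacePurityChord_iff.1 h
  exact ⟨U₀, hU₀, fun U hU δ hδ μ hdm hord => derivFacePurity_of_chordFacePurity (h U hU δ hδ μ hdm hord)⟩


/-- At block scale `R = L` every block is the whole torus: `B_a = P` for every anchor. -/
theorem blockPair_self (a : Literature.Probability.LatticeModels.TorusSite 2 L) : blockPair L L a = pF L := by
  obtain ⟨n, rfl⟩ : ∃ n, L = n + 1 := ⟨L - 1, by have := NeZero.ne L; omega⟩
  unfold blockPair
  have hcast : ∀ u : Fin 2 → Fin (n + 1),
      (fun i => (((u i : ℕ) : ZMod (n + 1)))) = (u : Literature.Probability.LatticeModels.TorusSite 2 (n + 1)) := by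
    intro u
    funext i
    exact Fin.cast_val_eq_self (u i)
  simp_rw [hcast]
  exact Fintype.sum_equiv (Equiv.addLeft a) _ _ (fun u => rfl)

/-- Hence `W_L = L⁻² P†P` … -/
theorem blockRepulsion_self :
    blockRepulsion L L = ((((L : ℝ) ^ 2)⁻¹ : ℝ) : ℂ) • ((pF L)ᴴ * pF L) := by
  have hL : (L : ℂ) ≠ 0 := Nat.cast_ne_zero.2 (NeZero.ne L)
  unfold blockRepulsion
  simp only [blockPair_self, Finset.sum_const, Finset.card_univ, card_torusSite_two]
  rw [← Nat.cast_smul_eq_nsmul ℂ, smul_smul]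
  congr 1
  push_cast
  field_simp

/-- … and **(2) is tight**: at `R = L`, `Re⟨ψ, W_L ψ⟩ = L² · lro ψ`. (The derivative form at scale `R = L` would be
the uniform floor itself; it is the order of quantifiers `∀ R, ∀ᶠ k` that keeps `R` fixed while `L → ∞` and makes
the infrared leak necessary for the converse.) -/
theorem re_expect_blockRepulsion_self (ψ : ι L → ℂ) :
    (star ψ ⬝ᵥ blockRepulsion L L *ᵥ ψ).re = (L : ℝ) ^ 2 * lro L ψ := by
  have hL : (0 : ℝ) < (L : ℝ) := Nat.cast_pos.2 (Nat.pos_of_ne_zero (NeZero.ne L))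
  rw [blockRepulsion_self, Matrix.smul_mulVec, dotProduct_smul, smul_eq_mul, Complex.re_ofReal_mul]
  unfold lro expect
  field_simp


/-! ## §16 (gen 4) TARGETS — the line's imported input, item stmt-1089 `KacWindowPenalty.WindowInfraredBound`

The v2 skeleton takes `WindowInfraredBound` (stmt-HubbardSuperconductivity-1089, an OPEN crux of routes
KacWindowPenalty / FunctionFieldCertificate) BY NAME. Two checked remarks.
(i) `infraredLeak_of_windowInfraredBound` — what the composition consumes from it is only the pointwise
`InfraredLeak U δ` at the crux's own `(U, δ)`, `U < U₀`; and `crux_of_derivFacePurity_of_infraredLeak` — the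
composition consumes only the DERIVATIVE form of face purity (§15), never the chord.
(ii) `windowInfraredBound_smallest_momentum` — but 1089 speaks for EVERY `U > 0`: at every coupling and every
`δ ∈ (0, 1/2)` it forces the `d`-wave pair structure factor of every sector ground state at the smallest non-zero
momentum `m₁ = (1, 0)` (wavelength `L`) to be `≤ 2πC·L`, i.e. `‖Δ_d(m₁)ψ‖² = O(L³) = o(L⁴)`: NO system-scale
modulation of a `d`-wave condensate anywhere in `{U > 0} × (0, 1/2)`. That is the exclusion of canonical phase
separation with a paired component at ALL couplings — including strong coupling, where the item's own
why-might-fail cites mVMC phase separation at `U/t = 10`, `δ ≲ 0.2` (Misawa–Imada 2014). A refutation of 1089 at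
large `U` would break the v2 skeleton of THIS line although the crux lives at `U → 0⁺`. RECOMMENDATION: the
line should carry `∀ U ∈ Ioo 0 U₀, ∀ δ, InfraredLeak U δ` (or 1089 restricted to a weak-coupling window), not 1089
by name; `crux_of_derivFacePurity_of_infraredLeak` is the composition in that shape. -/

omit [NeZero L] in
/-- Item stmt-HubbardSuperconductivity-1089 `KacWindowPenalty.WindowInfraredBound`, VERBATIM (copied rather than
imported so that this workfile does not depend on another route's Theses module; `Iff.rfl` with the Theses decl,
checked in the refuter's scratch `W1089.lean`). -/
def WindowInfraredBound1089 : Prop :=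
  ∀ U : ℝ, 0 < U → ∀ δ ∈ Set.Ioo (0:ℝ) (1 / 2), ∃ C ε₀ : ℝ, 0 ≤ C ∧ 0 < ε₀ ∧ ∃ L₀ : ℕ, ∀ ε ∈ Set.Ioc (0:ℝ) ε₀, ∀ (L : ℕ) [NeZero L], L₀ ≤ L → Even L → let D : (Fin 2 → ZMod L) → Matrix (Finset (Literature.MathematicalPhysics.QuantumLattice.Orb (Literature.MathematicalPhysics.QuantumLattice.FermionTorus 2 L))) (Finset (Literature.MathematicalPhysics.QuantumLattice.Orb (Literature.MathematicalPhysics.QuantumLattice.FermionTorus 2 L))) ℂ := fun m => ∑ x : Fin 2 → ZMod L, Complex.exp (-(2 * Real.pi * Complex.I * (((∑ i : Fin 2, m i * x i).val : ℕ) : ℂ) / (L : ℂ))) • Literature.MathematicalPhysics.QuantumLattice.localPair Literature.MathematicalPhysics.QuantumLattice.dWaveFormFactor L x; ∀ ψ : Literature.MathematicalPhysics.QuantumLattice.Fock (Literature.MathematicalPhysics.QuantumLattice.Orb (Literature.MathematicalPhysics.QuantumLattice.FermionTorus 2 L)), star ψ ⬝ᵥ ψ = 1 → Literature.MathematicalPhysics.QuantumLattice.IsGroundStateInSector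 (Literature.MathematicalPhysics.QuantumLattice.hubbardTorus 2 L 1 U) (2 * ⌊(1 - δ) * (L : ℝ) ^ 2 / 2⌋₊) 0 ψ → (∑ m : Fin 2 → ZMod L, if m ≠ 0 ∧ (2 * Real.pi / (L : ℝ)) ^ 2 * (∑ i : Fin 2, (((m i).valMinAbs : ℤ) : ℝ) ^ 2) ≤ ε ^ 2 then (star (Matrix.mulVec (D m) ψ) ⬝ᵥ Matrix.mulVec (D m) ψ).re / (L : ℝ) ^ 2 else 0) ≤ C * ε * (L : ℝ) ^ 2

omit [NeZero L] in
/-- **(i)** 1089 ⇒ the pointwise infrared leak at every `(U, δ)`, `U > 0`, `δ ∈ (0,1/2)` (window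
`η := min ε₀ (b/(C+1))`; proof shape of the skeleton's `infraredLeak_of_windowInfraredBound`). -/
theorem infraredLeak_of_windowInfraredBound
    (hW : WindowInfraredBound1089)
    {U : ℝ} (hU : 0 < U) {δ : ℝ} (hδ : δ ∈ Set.Ioo (0:ℝ) (1 / 2)) : InfraredLeak U δ := by
  intro b hb
  obtain ⟨C, ε₀, hC, hε₀, L₀, hW⟩ := hW U hU δ hδ
  have hC1 : 0 < C + 1 := by linarith
  set η : ℝ := min ε₀ (b / (C + 1)) with hη_def
  have hη : 0 < η := lt_min hε₀ (div_pos hb hC1)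
  have hηε : η ∈ Set.Ioc (0:ℝ) ε₀ := ⟨hη, min_le_left _ _⟩
  have hCη : C * η ≤ b := by
    have h1 : η ≤ b / (C + 1) := min_le_right _ _
    have h2 : C * η ≤ C * (b / (C + 1)) := mul_le_mul_of_nonneg_left h1 hC
    have h3 : C * (b / (C + 1)) ≤ b := by
      rw [mul_div_assoc', div_le_iff₀ hC1]; nlinarith
    exact h2.trans h3
  refine ⟨η, hη, ?_⟩
  filter_upwards [Filter.eventually_ge_atTop L₀] with k hk
  intro ψ hψ
  have hL₀ : L₀ ≤ 2 * k + 1 + 1 := by omega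
  have hEven : Even (2 * k + 1 + 1) := ⟨k + 1, by ring⟩
  have key := hW η hηε (2 * k + 1 + 1) hL₀ hEven ψ hψ.2 hψ.1
  have key' : (∑ m : Literature.Probability.LatticeModels.TorusSite 2 (2 * k + 1 + 1),
      if m ≠ 0 ∧ momentumNormSq (2 * k + 1 + 1) m ≤ η ^ 2 then
        pairStructureFactor dWaveFormFactor (2 * k + 1 + 1) ψ m else 0) ≤
      C * η * ((2 * k + 1 + 1 : ℕ) : ℝ) ^ 2 := key
  have hsub : (Finset.univ.filter fun m : Literature.Probability.LatticeModels.TorusSite 2 (2 * k + 1 + 1) =>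
        m ≠ 0 ∧ momentumNormSq (2 * k + 1 + 1) m < η ^ 2) ⊆
      (Finset.univ.filter fun m : Literature.Probability.LatticeModels.TorusSite 2 (2 * k + 1 + 1) =>
        m ≠ 0 ∧ momentumNormSq (2 * k + 1 + 1) m ≤ η ^ 2) := by
    intro m
    simp only [Finset.mem_filter, Finset.mem_univ, true_and]
    exact fun hm => ⟨hm.1, hm.2.le⟩
  have hle := Finset.sum_le_sum_of_subset_of_nonneg hsub
    (fun m _ _ => pairStructureFactor_nonneg dWaveFormFactor (2 * k + 1 + 1) ψ m)
  replace hle := hle.trans_eq (Finset.sum_filter _ _)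
  have hLpos : (0 : ℝ) < ((2 * k + 1 + 1 : ℕ) : ℝ) ^ 2 := by positivity
  rw [div_le_iff₀ hLpos]
  calc _ ≤ _ := hle
    _ ≤ C * η * ((2 * k + 1 + 1 : ℕ) : ℝ) ^ 2 := key'
    _ ≤ b * ((2 * k + 1 + 1 : ℕ) : ℝ) ^ 2 := mul_le_mul_of_nonneg_right hCη hLpos.le

omit [NeZero L] in
/-- **(i')** The composition of the line consumes only DERIVATIVE face purity and the POINTWISE infrared leak at
the crux's own parameters. -/
theorem crux_of_derivFacePurity_of_infraredLeak
    (h : ∃ U₀ : ℝ, 0 < U₀ ∧ ∀ U ∈ Set.Ioo (0:ℝ) U₀, ∀ δ ∈ Set.Ioo (0:ℝ) (1 / 2), ∀ μ : ℝ,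
      DensityMatched U δ μ → HasDWaveOrder U μ → DerivFacePurity U δ ∧ InfraredLeak U δ) :
    WcbcsSsbToTorusLRO := by
  obtain ⟨U₀, hU₀, h⟩ := h
  refine ⟨U₀, hU₀, fun U hU δ hδ μ hdm hord => ?_⟩
  obtain ⟨hP, hIR⟩ := h U hU δ hδ μ hdm hord
  exact hasDWavePairFieldLROAt_of_uniformPairFloor (uniformPairFloor_of_derivFacePurity_of_infraredLeak hP hIR)

omit [NeZero L] in
/-- Hence the v2 skeleton's shape: `stub_facePurityChord` and 1089 close the crux (through the derivative form). -/
theorem crux_of_stub_of_windowInfraredBound (hS : StubFacePurityChord)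
    (hW : WindowInfraredBound1089) :
    WcbcsSsbToTorusLRO := by
  obtain ⟨U₀, hU₀, h⟩ := stub_gives_derivFacePurity hS
  exact crux_of_derivFacePurity_of_infraredLeak ⟨U₀, hU₀, fun U hU δ hδ μ hdm hord =>
    ⟨h U hU δ hδ μ hdm hord, infraredLeak_of_windowInfraredBound hW hU.1 hδ⟩⟩

omit [NeZero L] in
/-- The smallest non-zero momentum `m₁ = (1, 0)` has `|q_{m₁}|² = (2π/L)²` (`L ≥ 2`). -/
theorem momentumNormSq_unit (hL : 2 ≤ L) :
    momentumNormSq L (![(1 : ZMod L), 0] : Literature.Probability.LatticeModels.TorusSite 2 L) =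
      (2 * Real.pi / (L : ℝ)) ^ 2 := by
  have h1 : ((1 : ZMod L)).valMinAbs = 1 := by
    rw [← Nat.cast_one, ZMod.valMinAbs_natCast_of_le_half (by omega)]
    rfl
  rw [momentumNormSq_apply, Fin.sum_univ_two]
  simp [h1, ZMod.valMinAbs_zero]

omit [NeZero L] in
/-- `m₁ ≠ 0` (`L ≥ 2`). -/
theorem unit_momentum_ne_zero (hL : 2 ≤ L) :
    (![(1 : ZMod L), 0] : Literature.Probability.LatticeModels.TorusSite 2 L) ≠ 0 := by
  intro h
  have h0 : (1 : ZMod L) = 0 := by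
    have := congrFun h 0
    simpa using this
  have h1 : ((1 : ZMod L)).valMinAbs = 1 := by
    rw [← Nat.cast_one, ZMod.valMinAbs_natCast_of_le_half (by omega)]
    rfl
  rw [h0, ZMod.valMinAbs_zero] at h1
  exact zero_ne_one h1

omit [NeZero L] in
/-- **(ii) 1089 forbids system-scale pair modulation at EVERY coupling.** For every `U > 0`, `δ ∈ (0, 1/2)`:
eventually along even sides, every admissible state has `pairStructureFactor d L ψ m₁ ≤ 2πC·L` at the smallest
non-zero momentum `m₁ = (1,0)` — `‖Δ_d(m₁) ψ‖² ≤ 2πC L³ = o(L⁴)`. (Take `ε = 2π/L ≤ ε₀` in 1089 and keep the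
single window term `m₁`.) -/
theorem windowInfraredBound_smallest_momentum
    (hW : WindowInfraredBound1089)
    {U : ℝ} (hU : 0 < U) {δ : ℝ} (hδ : δ ∈ Set.Ioo (0:ℝ) (1 / 2)) :
    ∃ C : ℝ, 0 ≤ C ∧ ∃ L₁ : ℕ, ∀ (L : ℕ) [NeZero L], L₁ ≤ L → Even L →
      ∀ ψ : Fock (Orb (FermionTorus 2 L)), IsAdmissibleAt U δ L ψ →
        pairStructureFactor dWaveFormFactor L ψ (![(1 : ZMod L), 0]) ≤ 2 * Real.pi * C * (L : ℝ) := by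
  obtain ⟨C, ε₀, hC, hε₀, L₀, hW⟩ := hW U hU δ hδ
  obtain ⟨N, hN⟩ := exists_nat_gt (2 * Real.pi / ε₀)
  refine ⟨C, hC, max (max L₀ N) 2, fun L _ hL hev ψ hψ => ?_⟩
  have hL₀ : L₀ ≤ L := le_trans (le_trans (le_max_left _ _) (le_max_left _ _)) hL
  have hLN : N ≤ L := le_trans (le_trans (le_max_right _ _) (le_max_left _ _)) hL
  have hL2 : 2 ≤ L := le_trans (le_max_right _ _) hL
  have hLpos : (0 : ℝ) < (L : ℝ) := by positivity
  set ε : ℝ := 2 * Real.pi / (L : ℝ) with hε_def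
  have hεpos : 0 < ε := by positivity
  have hεle : ε ≤ ε₀ := by
    have hNL : (N : ℝ) ≤ (L : ℝ) := by exact_mod_cast hLN
    have h1 : 2 * Real.pi / ε₀ < (L : ℝ) := hN.trans_le hNL
    rw [div_lt_iff₀ hε₀] at h1
    rw [hε_def, div_le_iff₀ hLpos]
    linarith
  have key := hW ε ⟨hεpos, hεle⟩ L hL₀ hev ψ hψ.2 hψ.1
  have key' : (∑ m : Literature.Probability.LatticeModels.TorusSite 2 L,
      if m ≠ 0 ∧ momentumNormSq L m ≤ ε ^ 2 then pairStructureFactor dWaveFormFactor L ψ m else 0) ≤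
      C * ε * (L : ℝ) ^ 2 := key
  set m₁ : Literature.Probability.LatticeModels.TorusSite 2 L := ![(1 : ZMod L), 0] with hm₁_def
  have hm₁ : m₁ ≠ 0 ∧ momentumNormSq L m₁ ≤ ε ^ 2 :=
    ⟨unit_momentum_ne_zero L hL2, (momentumNormSq_unit L hL2).le⟩
  have hterm : pairStructureFactor dWaveFormFactor L ψ m₁ ≤
      ∑ m : Literature.Probability.LatticeModels.TorusSite 2 L,
        if m ≠ 0 ∧ momentumNormSq L m ≤ ε ^ 2 then pairStructureFactor dWaveFormFactor L ψ m else 0 := by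
    have hnn : ∀ m ∈ (Finset.univ : Finset (Literature.Probability.LatticeModels.TorusSite 2 L)),
        0 ≤ (if m ≠ 0 ∧ momentumNormSq L m ≤ ε ^ 2 then pairStructureFactor dWaveFormFactor L ψ m else 0) := by
      intro m _
      split_ifs
      · exact pairStructureFactor_nonneg dWaveFormFactor L ψ m
      · exact le_rfl
    have := Finset.single_le_sum hnn (Finset.mem_univ m₁)
    rwa [if_pos hm₁] at this
  calc pairStructureFactor dWaveFormFactor L ψ m₁ ≤ _ := hterm
    _ ≤ C * ε * (L : ℝ) ^ 2 := key'
    _ = 2 * Real.pi * C * (L : ℝ) := by rw [hε_def]; field_simp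


/-- **The two surviving lines meet at the largest block scale**: at `R = L` the block-REPELLED torus of the
tangent-face stub is the quenched canonical family of the quenched-corner line (§8b, §10) at NEGATIVE seed,
`H + κ W_L = Q_{-κ} = H - ((-κ)/L²) P†P`. So, were `R` allowed to grow with the side, the chord statement would read
`E_sec(Q_{-κ}) - E_sec(Q_0) ≥ κ a L²`, sandwiched by §10 between the pair order of the repelled and of the unrepelled
sector ground states (`lro(ψ_{-κ}) ≤ chord/(κL²) ≤ min_{GS(0)} lro`): the tangent-face chord is the `t < 0` side, the
quenched corner the `t > 0` side, of the same concave function `t ↦ E_sec(H - (t/L²)P†P)`. -/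
theorem repelled_fullScale_eq_quenchedCan (U κ : ℝ) :
    hubbardTorus 2 L 1 U + (κ : ℂ) • blockRepulsion L L = quenchedCan L U (-κ) := by
  have hL : (L : ℂ) ≠ 0 := Nat.cast_ne_zero.2 (NeZero.ne L)
  rw [blockRepulsion_self, quenchedCan, smul_smul, sub_eq_add_neg, ← neg_smul]
  congr 1
  push_cast
  field_simp

/-! ### §15e (gen 4) The other end of the chord: REPELLED coherence (the PROMOTE dossier's `RepelledCoherence`, proved)

Three levels, finite `L`, two variational lines each: for a unit sector ground state `ψ_κ` of the REPELLED model
`H + κW_R` and a unit sector ground state `ψ₀` of `H`,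
`κ·re⟨ψ_κ, W_R ψ_κ⟩ ≤ E_sec(H + κW_R) - E_sec(H) ≤ κ·re⟨ψ₀, W_R ψ₀⟩` (`chord_ge_repelled`, `chord_div_le_of_eigen`), and the
repelled coherence is NON-INCREASING in `κ` (`repelledCoherence_mono`, cf. §10 `lro_mono`). Hence
`RepelledCoherence ⇒ ChordFacePurity ⇒ DerivFacePurity` (`chordFacePurity_of_repelledCoherence`,
`derivFacePurity_of_chordFacePurity`): the stub sits BETWEEN "some ground state of the κ-repelled torus keeps block
coherence ≥ aL²" and "every ground state of the bare torus has block coherence ≥ aL²"; the lower level is SUFFICIENT,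
not necessary — the chord may hold with the order destroyed at `κ`, paid for by the condensation energy. -/

omit [NeZero L] in
/-- Lower end of the chord: `κ·re⟨ψ_κ, W ψ_κ⟩ ≤ E_K(H + κW) - E_K(H)` for a unit eigen-ground-state `ψ_κ` of `H + κW` in
`K` (variational principle for `H` at `ψ_κ`). -/
theorem chord_ge_repelled {n : Type*} [Fintype n] (H W : Matrix n n ℂ) (K : Submodule ℂ (n → ℂ)) (κ : ℝ)
    {ψ : n → ℂ} (hψK : ψ ∈ K) (hψ : star ψ ⬝ᵥ ψ = 1)
    (heig : (H + (κ : ℂ) • W) *ᵥ ψ = (((H + (κ : ℂ) • W).minEnergyOn K : ℝ) : ℂ) • ψ) :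
    κ * (star ψ ⬝ᵥ W *ᵥ ψ).re ≤ (H + (κ : ℂ) • W).minEnergyOn K - H.minEnergyOn K := by
  have hE : (star ψ ⬝ᵥ (H + (κ : ℂ) • W) *ᵥ ψ).re = (H + (κ : ℂ) • W).minEnergyOn K := by
    rw [heig, dotProduct_smul, hψ, smul_eq_mul, mul_one, Complex.ofReal_re]
  rw [Matrix.add_mulVec, dotProduct_add, Complex.add_re, Matrix.smul_mulVec, dotProduct_smul, smul_eq_mul,
    Complex.re_ofReal_mul] at hE
  have h1 := minEnergyOn_le_rayleigh H K hψK hψ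
  linarith

omit [NeZero L] in
/-- **Repelled coherence is non-increasing in the coupling** (two variational inequalities): for `κ₁ < κ₂` and unit
eigen-ground-states `ψ₁` of `H + κ₁W`, `ψ₂` of `H + κ₂W` in the same sector, `re⟨ψ₂, Wψ₂⟩ ≤ re⟨ψ₁, Wψ₁⟩`. -/
theorem repelledCoherence_mono {n : Type*} [Fintype n] (H W : Matrix n n ℂ) (K : Submodule ℂ (n → ℂ)) {κ₁ κ₂ : ℝ}
    (hκ : κ₁ < κ₂) {ψ₁ ψ₂ : n → ℂ} (h₁K : ψ₁ ∈ K) (h₁ : star ψ₁ ⬝ᵥ ψ₁ = 1)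
    (h₁eig : (H + (κ₁ : ℂ) • W) *ᵥ ψ₁ = (((H + (κ₁ : ℂ) • W).minEnergyOn K : ℝ) : ℂ) • ψ₁)
    (h₂K : ψ₂ ∈ K) (h₂ : star ψ₂ ⬝ᵥ ψ₂ = 1)
    (h₂eig : (H + (κ₂ : ℂ) • W) *ᵥ ψ₂ = (((H + (κ₂ : ℂ) • W).minEnergyOn K : ℝ) : ℂ) • ψ₂) :
    (star ψ₂ ⬝ᵥ W *ᵥ ψ₂).re ≤ (star ψ₁ ⬝ᵥ W *ᵥ ψ₁).re := by
  -- energies of the ground states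
  have hE₁ : (star ψ₁ ⬝ᵥ H *ᵥ ψ₁).re + κ₁ * (star ψ₁ ⬝ᵥ W *ᵥ ψ₁).re = (H + (κ₁ : ℂ) • W).minEnergyOn K := by
    have := congrArg (fun v => (star ψ₁ ⬝ᵥ v).re) h₁eig
    simp only [Matrix.add_mulVec, dotProduct_add, Complex.add_re, Matrix.smul_mulVec, dotProduct_smul, smul_eq_mul,
      Complex.re_ofReal_mul, h₁, mul_one, Complex.ofReal_re] at this
    exact this
  have hE₂ : (star ψ₂ ⬝ᵥ H *ᵥ ψ₂).re + κ₂ * (star ψ₂ ⬝ᵥ W *ᵥ ψ₂).re = (H + (κ₂ : ℂ) • W).minEnergyOn K := by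
    have := congrArg (fun v => (star ψ₂ ⬝ᵥ v).re) h₂eig
    simp only [Matrix.add_mulVec, dotProduct_add, Complex.add_re, Matrix.smul_mulVec, dotProduct_smul, smul_eq_mul,
      Complex.re_ofReal_mul, h₂, mul_one, Complex.ofReal_re] at this
    exact this
  -- variational principle for `H + κ₁W` at `ψ₂` and for `H + κ₂W` at `ψ₁`
  have hv₁ := minEnergyOn_le_rayleigh (H + (κ₁ : ℂ) • W) K h₂K h₂
  have hv₂ := minEnergyOn_le_rayleigh (H + (κ₂ : ℂ) • W) K h₁K h₁
  rw [Matrix.add_mulVec, dotProduct_add, Complex.add_re, Matrix.smul_mulVec, dotProduct_smul, smul_eq_mul,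
    Complex.re_ofReal_mul] at hv₁ hv₂
  nlinarith [hv₁, hv₂, hE₁, hE₂, sub_pos.2 hκ]

omit [NeZero L] in
/-- **Repelled coherence** at `(U, δ)` (PROMOTE dossier §3): for every scale `R` a coupling `κ = κ(R) > 0` such that,
eventually along even sides, SOME unit ground state of the repelled torus `H + κ W_R` in the sector keeps block coherence
`≥ a L²`. -/
def RepelledCoherence (U δ : ℝ) : Prop :=
  ∃ a : ℝ, 0 < a ∧ ∀ R : ℕ, 0 < R → ∃ κ : ℝ, 0 < κ ∧ ∀ᶠ k : ℕ in atTop,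
    ∃ ψ : Fock (Orb (FermionTorus 2 (2 * k + 1 + 1))),
      ψ ∈ szSector (Λ := FermionTorus 2 (2 * k + 1 + 1)) (2 * ⌊(1 - δ) * ((2 * k + 1 + 1 : ℕ) : ℝ) ^ 2 / 2⌋₊) 0 ∧
      star ψ ⬝ᵥ ψ = 1 ∧
      (hubbardTorus 2 (2 * k + 1 + 1) 1 U + (κ : ℂ) • blockRepulsion (2 * k + 1 + 1) R) *ᵥ ψ =
        (((hubbardTorus 2 (2 * k + 1 + 1) 1 U + (κ : ℂ) • blockRepulsion (2 * k + 1 + 1) R).minEnergyOn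
            (szSector (2 * ⌊(1 - δ) * ((2 * k + 1 + 1 : ℕ) : ℝ) ^ 2 / 2⌋₊) 0) : ℝ) : ℂ) • ψ ∧
      a * ((2 * k + 1 + 1 : ℕ) : ℝ) ^ 2 ≤ (star ψ ⬝ᵥ blockRepulsion (2 * k + 1 + 1) R *ᵥ ψ).re

omit [NeZero L] in
/-- **`RepelledCoherence ⇒ ChordFacePurity`** (the PROMOTE dossier's "FPC ⇐ RepelledCoherence", now checked; same `a`,
same `κ(R)`). -/
theorem chordFacePurity_of_repelledCoherence {U δ : ℝ} (h : RepelledCoherence U δ) : ChordFacePurity U δ := by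
  obtain ⟨a, ha, h⟩ := h
  refine ⟨a, ha, fun R hR => ?_⟩
  obtain ⟨κ, hκ, hk⟩ := h R hR
  refine ⟨κ, hκ, ?_⟩
  filter_upwards [hk] with k hk
  obtain ⟨ψ, hψK, hψ1, heig, hcoh⟩ := hk
  have := chord_ge_repelled (hubbardTorus 2 (2 * k + 1 + 1) 1 U) (blockRepulsion (2 * k + 1 + 1) R)
    (szSector (2 * ⌊(1 - δ) * ((2 * k + 1 + 1 : ℕ) : ℝ) ^ 2 / 2⌋₊) 0) κ hψK hψ1 heig
  nlinarith [mul_le_mul_of_nonneg_left hcoh hκ.le]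

/-! ### §15c (gen 4) TOY: the chord is strictly stronger than the derivative form (finite-dimensional, proved)

On `ℂ²` take `H = diag(0, 1)` and `W = diag(c, 0)`, `c ≥ 0` (think `c = a·L²`): EVERY ground state of `H` has
`re⟨ψ, W ψ⟩ = c` (the derivative floor, as large as desired), yet for every `κ ≥ 0` the chord
`E(H + κW) - E(H) ≤ 1` — the order-poor EXCITED state `e₁` at energy `1` caps it. So "every-GS coherence ≥ a L²"
does not give "chord ≥ κ a L²" with a side-independent `κ`: the chord form needs the order-poor states to be
EXTENSIVELY excited (`extensiveGap_of_chordFacePurity` is exactly that content). -/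

section Toy

/-- The toy Hamiltonian `diag(0, 1)` on `ℂ²`. -/
def toyH : Matrix (Fin 2) (Fin 2) ℂ := Matrix.diagonal ![0, 1]

/-- The toy "order" observable `diag(c, 0)`. -/
def toyW (c : ℝ) : Matrix (Fin 2) (Fin 2) ℂ := Matrix.diagonal ![(c : ℂ), 0]

omit [NeZero L] in
theorem toyH_mulVec (ψ : Fin 2 → ℂ) : toyH *ᵥ ψ = ![0, ψ 1] := by
  ext i
  fin_cases i <;> simp [toyH, Matrix.mulVec_diagonal]

omit [NeZero L] in
theorem toyW_mulVec (c : ℝ) (ψ : Fin 2 → ℂ) : toyW c *ᵥ ψ = ![(c : ℂ) * ψ 0, 0] := by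
  ext i
  fin_cases i <;> simp [toyW, Matrix.mulVec_diagonal]

omit [NeZero L] in
/-- `re⟨ψ, H ψ⟩ = |ψ 1|²`. -/
theorem re_rayleigh_toyH (ψ : Fin 2 → ℂ) : (star ψ ⬝ᵥ toyH *ᵥ ψ).re = ‖ψ 1‖ ^ 2 := by
  rw [toyH_mulVec, Complex.sq_norm, Complex.normSq_apply]
  simp [dotProduct, Fin.sum_univ_two, Complex.mul_re]
  try ring

omit [NeZero L] in
/-- `re⟨ψ, W ψ⟩ = c |ψ 0|²`. -/
theorem re_rayleigh_toyW (c : ℝ) (ψ : Fin 2 → ℂ) : (star ψ ⬝ᵥ toyW c *ᵥ ψ).re = c * ‖ψ 0‖ ^ 2 := by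
  rw [toyW_mulVec, Complex.sq_norm, Complex.normSq_apply]
  simp [dotProduct, Fin.sum_univ_two, Complex.mul_re, Complex.mul_im]
  try ring

omit [NeZero L] in
/-- Unit vectors of `ℂ²`: `|ψ 0|² + |ψ 1|² = 1`. -/
theorem toy_unit {ψ : Fin 2 → ℂ} (hψ : star ψ ⬝ᵥ ψ = 1) : ‖ψ 0‖ ^ 2 + ‖ψ 1‖ ^ 2 = 1 := by
  have := congrArg Complex.re hψ
  simp [dotProduct, Fin.sum_univ_two, Complex.mul_re] at this
  rw [Complex.sq_norm, Complex.sq_norm, Complex.normSq_apply, Complex.normSq_apply]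
  linarith

omit [NeZero L] in
/-- `E(H) = 0` on the whole space. -/
theorem minEnergyOn_toyH : toyH.minEnergyOn ⊤ = 0 := by
  apply le_antisymm
  · have h := minEnergyOn_le_rayleigh toyH ⊤ (ψ := ![1, 0]) Submodule.mem_top
      (by simp [dotProduct, Fin.sum_univ_two])
    rw [re_rayleigh_toyH] at h
    simpa using h
  · refine le_csInf ⟨_, ![1, 0], Submodule.mem_top, by simp [dotProduct, Fin.sum_univ_two], rfl⟩ ?_
    rintro E ⟨ψ, -, -, rfl⟩
    rw [re_rayleigh_toyH]
    positivity

omit [NeZero L] in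
/-- **Derivative floor holds**: every ground state of `H` (unit `ψ` with `Hψ = E(H)ψ`) has `re⟨ψ, Wψ⟩ = c`. -/
theorem toy_everyGS_coherence (c : ℝ) {ψ : Fin 2 → ℂ} (hψ : star ψ ⬝ᵥ ψ = 1)
    (hGS : toyH *ᵥ ψ = ((toyH.minEnergyOn ⊤ : ℝ) : ℂ) • ψ) : (star ψ ⬝ᵥ toyW c *ᵥ ψ).re = c := by
  rw [minEnergyOn_toyH] at hGS
  have h1 : ψ 1 = 0 := by
    have := congrFun hGS 1
    rw [toyH_mulVec] at this
    simpa using this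
  have hu := toy_unit hψ
  rw [h1, norm_zero] at hu
  have hu' : ‖ψ 0‖ ^ 2 = 1 := by nlinarith [hu]
  rw [re_rayleigh_toyW, hu', mul_one]

omit [NeZero L] in
/-- **Chord is capped**: `E(H + κW) - E(H) ≤ 1` for every `κ` and every `c` (trial state `e₁`). -/
theorem toy_chord_le_one (c κ : ℝ) : (toyH + (κ : ℂ) • toyW c).minEnergyOn ⊤ - toyH.minEnergyOn ⊤ ≤ 1 := by
  rw [minEnergyOn_toyH, sub_zero]
  have h := minEnergyOn_le_rayleigh (toyH + (κ : ℂ) • toyW c) ⊤ (ψ := ![0, 1]) Submodule.mem_top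
    (by simp [dotProduct, Fin.sum_univ_two])
  rw [Matrix.add_mulVec, dotProduct_add, Complex.add_re, Matrix.smul_mulVec, dotProduct_smul, smul_eq_mul,
    Complex.re_ofReal_mul, re_rayleigh_toyH, re_rayleigh_toyW] at h
  simpa using h

omit [NeZero L] in
/-- **The separation**: with `c > 1/κ` the chord inequality `κ · c ≤ E(H+κW) - E(H)` FAILS although every ground
state has coherence `c`. -/
theorem toy_chord_fails {c κ : ℝ} (hκ : 0 < κ) (hc : 1 / κ < c) :
    ¬ (κ * c ≤ (toyH + (κ : ℂ) • toyW c).minEnergyOn ⊤ - toyH.minEnergyOn ⊤) := by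
  intro h
  have h1 := toy_chord_le_one c κ
  rw [div_lt_iff₀ hκ] at hc
  nlinarith

end Toy

end CycleFour

/-! ## §7 Small models, computations, phase-diagram hazards (DOC)

* 4×4 exact diagonalisation (GS degeneracy and the spread of `2⟨Δ_d†Δ_d⟩/L⁴` over the `(N, S^z=0)`-sector
  ground manifolds, `N ∈ {8,10,12,14}`, small `U`; pair amplitude into the `(N-2)` sector): queued by gen 1
  as compute jobs j004880 / j004882 (hub queue ≈ 3000 at gen-2 start, not yet run).
* gen 2, the quenched-corner card's cheapest falsifier (ii) for `HolderCorner`: a `t`-SCAN of the every-GS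
  `lro` range (eigenvalues of the Gram matrix of `P` on the ground manifold `/L⁴`) of the number-conserving
  `hubbardTorus 2 4 1 U - (t/16)P†P` in the sector `(N, 0)` by Lanczos with kron-structured matvecs
  (`tscan_ed.py`): j007286 (`N = 8`, i.e. `δ ∈ (3/8,1/2)`, `U ∈ {2,4}`, `t ∈ {0,.005,.01,.02,.05,.1,.2,.5,1}`) and
  j007288 (`N = 10`, `δ ∈ (1/4,3/8)`, `U = 2`, coarser grid); results are attached to the item as
  `compute-<id>.json` when they run. Reading: an `L`-persistent JUMP of the every-GS `lro` at `t = 0⁺` refutes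
  `HolderCorner` at that `(U,δ)`; a `√t`-type onset supports the card's `a = 1/2`; `L = 4` is indicative only. `L = 4` is shell-dominated
  at weak `U` (open-shell degeneracies of the free torus spectrum), so the table is indicative only; by §K and
  the Schur remark of gen 1 (an invariant quadratic form is constant on a single irrep of translations ⋊ D₄ ×
  SU(2)), only ACCIDENTAL same-sector degeneracy can lower the every-GS pair order.
* B1g/B2g channel switch (`δ ≈ 0.4`, RKS2010 Fig. 2) as an endpoint hazard: EMPTY at the BCS level, by an
  analytic convexity argument (no numerics needed). In weak-coupling BCS with two channels of couplings
  `λ₁ ≥ λ₂` and normalised form factors `ĝ₁` (B1g), `ĝ₂` (B2g) on the Fermi curve, the `T = 0` condensation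
  energy of `Δ = r(cos θ ĝ₁ + e^{iχ} sin θ ĝ₂)` is `-½ exp(-2A - 1)` with
  `A(s, χ) = ε s + ⟨w ln √w⟩_FS`, `w = |cos θ ĝ₁ + e^{iχ} sin θ ĝ₂|²`, `s = sin²θ`, `ε = 1/λ₂ - 1/λ₁ ≥ 0`;
  `χ = π/2` is optimal (the cross term `ĝ₁ĝ₂` is odd under a mirror) and then `w = (1-s)ĝ₁² + sĝ₂²` is AFFINE
  in `s`, so `s ↦ A(s)` is STRICTLY CONVEX (`x ↦ x ln x`); its minimiser `s*(ε)` is unique and continuous in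
  `ε`, leaving `0` continuously at `ε_c = -∂_s⟨w ln √w⟩|_{s=0⁺} < ∞` (finite: `ln ĝ₁²` is integrable across the
  nodes). Hence the switch proceeds `d_{x²-y²} → d_{x²-y²} + i d_{xy} → d_{xy}` through two CONTINUOUS
  transitions, `m_{B1g}` vanishes continuously, and there is no GC density jump with a B1g-ordered endpoint.
  (BCS-level statement about the effective theory; it says nothing rigorous about `hubbardTorus`.)
* The remaining candidate for the uniform form's hazard is near half filling: Hartree–Fock at weak `U`,
  `t' = 0` gives first-order jumps of `n(μ)` between the commensurate AF insulator and incommensurate/doped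
  phases (phase separation) at dopings `δ*(U) → 0⁺`; whether a B1g-ordered phase sits at such an endpoint is
  unknown. This is why §4 recommends the swapped form: at fixed `δ` these moving boundaries are eventually
  avoided.
* gen 3 HAZARD AUDIT (DOC; sharpens the two bullets above AGAINST the adversary). The uniform form is killed
  only by a first-order endpoint `μ_c(U)`, present below every `U₀`, whose `B1g`-POOR phase `Y` has density
  `n_Y ∈ (1/2, 1)` STRICTLY (so that `δ_Y = 1 - n_Y ∈ (0, 1/2)` and `DensityMatched U δ_Y μ_c` can hold when the
  source-free tori select `Y`). Audit of the candidates at `t' = 0`, weak coupling: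
  (a) AF insulator / doped metal (HF phase separation near half filling): the `B1g`-poor endpoint is the
      half-filled insulator, `n_Y = 1` exactly (charge gap), i.e. `δ_Y = 0 ∉ (0, 1/2)` — DEFUSED by the open
      doping interval; the doped endpoint `X` (density `1 - δ*(U)`) is the `d`-wave metal itself, where the
      crux asks only for the expected LRO. A doped SDW/stripe metal `Y'` with `n_{Y'} < 1` would itself carry
      `B1g` (or mixed) pairing at `T = 0` in weak coupling (any Fermi surface remnant Cooper-pairs), so it is
      not `B1g`-poor either — unless fully gapped, which weak coupling excludes away from commensurate lock-in.
  (b) pairing-channel switches: `B1g → B2g` is continuous through `d + id` (convexity bullet above); for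
      `B1g` (singlet) vs `E` (triplet `p`) the GL quartic cross-coupling at the optimal relative phase is
      `2⟨|ψ|²|d|²⟩_FS ≤ 2√(⟨|ψ|⁴⟩⟨|d|⁴⟩)` (Cauchy–Schwarz), the coexistence side of the tetracritical
      criterion, so again a mixed (parity-broken) sliver with continuous edges rather than a first-order jump
      — at GL/BCS level.
  (c) a PURE non-`B1g` phase (`d_xy`, `p`) at some `δ`: harmless — `⟨Δ_d⟩_h = O(h)` by linear response, so
      `m = 0` and the body is vacuous there.
  Net: no identified instance; what remains is a beyond-mean-field first-order transition with a `B1g`-poor,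
  compressible endpoint inside `(1/2, 1)` — not excluded, not exhibited. The crux resists better than the
  gen-2 text suggests; the swap (§4) stays free insurance and `CornerModulus`/`PairOrderRigidity` (§11) say
  precisely what a line must still prove inside a pure phase.
* gen 3, SHARPNESS OF THE GC SIDE (DOC, tree fact): `quenchedGap_lower` (`gain ≥ t m²(1-4η) L²`) is sharp to
  first order in `t`. The tree's finite-volume Bogoliubov Jr. estimate
  `Literature.MathematicalPhysics.QuantumLattice.exists_pressure_model_le` (ApproximatingHamiltonianProofs) with
  `T = K_μ`, `U = √t·P`, `V = L²`, after `β → ∞` and modulo the commutator bounds (A3) for `P` (locality,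
  not yet in the tree), gives `E₀(K_μ) - E₀(Q_t) ≤ sup_h [E₀(K_μ) - E₀(S_h) - h²L²/t] + o(L²)`, i.e. in the
  limit `gain(t) = sup_h [G(h) - h²/t]`, `G(h) = lim L⁻²(E₀(S_0) - E₀(S_h)) = 2∫₀ʰ dens`, so `gain(t) = m²t +
  o(t)`: the grand-canonical quenched corner is a Legendre transform of the sourced energy and has NO slack;
  all of the crux's difficulty is canonical (§12) and every-GS (§11).
* gen 4 (DOC). COMPUTE: hub queue 3943 jobs / 120 cores at 00:51Z (cdisprove prio 79; p95 wait 6581 s); the gen-1/2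
  ED jobs j004880 / j004882 / j007286 / j007288 and drefute's JW test j007639 have not reported (no `compute-*.json`
  evidence on the item except the planners' j005892 / j007350 classical unit tests); no new job submitted this cycle —
  a κ-scan / t-scan at `L = 4` is shell-dominated and indicative only (§7 gen 2), and the checked content of
  §14–§16 does not depend on it. LITERATURE: `lit search` degraded again at 01:30Z (searchd rc 75); the status of the
  converse Koma–Tasaki direction (SSB ⇒ finite-volume GS LRO; KT1994 Conj. 10, Tasaki2019Tower §3) is unchanged in
  our holdings. WHAT A KILL STILL NEEDS (unchanged since gen 1): `HasDWaveOrder U μ` at some `U ∈ (0, U₀)` for every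
  `U₀` — a proof of `d`-wave U(1)-breaking in the weakly repulsive Hubbard model (qualitative crux 4).
-/

end Summit.HubbardSuperconductivity.HubbardSuperconductivity.Cruxes.WcbcsSsbToTorusLRO.Disproof

end
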